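import Mathlib.Analysis.Fourier.LpSpace
import Mathlib.Analysis.Calculus.LineDeriv.IntegrationByParts
import Mathlib.Analysis.Distribution.AEEqOfIntegralContDiff
import Mathlib.Algebra.Order.Chebyshev
import Literature.Analysis.FluidPDE.TaoAveragedConjugation
import Literature.Analysis.FluidPDE.TaoLocalisationHolds
import Literature.Analysis.FluidPDE.NSCriticalClosureBesovKatoClass
import Literature.Analysis.FluidPDE.TaoMildSolutionBounds
import Literature.Analysis.FluidPDE.TaoAveragedEulerFormBound
import Literature.Analysis.FluidPDE.TaoAveragedComplexAverageReal
import Literature.Analysis.FluidPDE.TaoAveragedEulerLerayL2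
import Literature.Analysis.FluidPDE.TaoCascadeDuhamel
import Mathlib.Analysis.InnerProductSpace.Dual
import Literature.Analysis.FluidPDE.TaoH10MildFourierCalculus
import HarnessLib

/-!
# Tao's `H¹⁰_df` mild Navier–Stokes solutions, file 2 of 3: `H¹⁰` membership and continuity — a classical Tao-class solution is `H¹⁰_df`-mild — and the weighted bilinear Duhamel operator with its form bound (re-homed proofs)

**T. Tao, *Finite time blowup for an averaged three-dimensional Navier–Stokes equation*, J. Amer. Math. Soc. 29 (2016), §1.1
[Tao2016AveragedNS]: the `H¹⁰_df` mild formulation ((1.3)–(1.5), (1.15)) of the Navier–Stokes equation and its dictionary with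
classical solutions.**  The named fact `Literature.Analysis.FluidPDE.FluidComputer.MildMaximalGivesBlowup`
(`FluidComputer/CascadeWitness.lean`: an `H¹⁰_df`-mild solution of the true equation from a Schwartz divergence-free datum on
`[0,S)` with no mild extension past `S` yields a maximal smooth solution with finite lifespan, Leray–Hopf from its rapidly
decaying datum) is PROVED in the tree by the Navier–Stokes perpetual-pump cell (a classical Tao-class solution is `H¹⁰_df`-mild —
Fourier-side Sobolev calculus on `ℝ³`, the trilinear form, the heat pairing and the tested Duhamel identity, `H¹⁰` membership and
continuity; uniqueness of `H¹⁰_df`-mild solutions through the weighted bilinear Duhamel operator; and the blow-up dictionary: no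
global Kato solution, the Kato maximal time, gluing of Tao-class solutions, Leray–Hopf by weak–strong comparison, maximality by
the singular point) — until now Summits-side only (`Summits/NavierStokesRegularity/NavierStokesRegularity/Theorems/FluidComputerCascade.lean`,
`mildMaximalGivesBlowup_holds := pumpContinuation_mildBlowupClassical_proof`).  RE-HOMED into `Literature/` by the Hodge foundations
lane (`lit-hodgefound`, prover p20, generation 39) as THREE files: verbatim DECLARATION-LEVEL ports (the 187 declarations the
discharge needs, in dependency order; each Part header lists the declarations of its source module that are NOT carried) of 24
Summits modules `Summits/NavierStokesRegularity/NavierStokesRegularity/Theorems/{PerpetualPumpEulerTypeIGlue*,PerpetualPumpThesis*,PumpContinuationMildBlowupClassical}.lean`,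
namespaces `Summit.NavierStokesRegularity.NavierStokesRegularity.Theorems{,.…}` re-rooted to `Literature.Analysis.PerpetualPump{,.…}`
(a root outside `Literature.Analysis.FluidPDE` on purpose: namespace-prefix resolution would otherwise shadow the cone's lemmas by
same-named `FluidPDE` lemmas); the three `local notation`s of the sources (`ℝ³`, `ℂ³`, `𝐞ᵤ i`) are expanded textually; imports
from `Literature/` and Mathlib only; no `sorry`, no new axiom, NO named fact (D-0026).  ONE deliberate deviation: the source states
`pumpContinuation_mildBlowupClassical_proof : Theses.PumpContinuation.MildBlowupClassical` (a Summits route Prop, by the fact's own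
docstring VERBATIM the same statement); here its type is written as the Literature fact `FluidComputer.MildMaximalGivesBlowup`
itself (identical binders, identical proof script).  PROVENANCE CONVENTION: docstrings are carried byte-for-byte; declarations the
cell cites keep their cites; `[folklore]`-tagged and untagged declarations (the cell's own lemmas) carry the Part's tag
`[cite: <Key>, <loc> (source of the NOTION / ARGUMENT this module implements; this declaration is the cell's own lemma or plumbing,
NOT a printed statement)]`, because the gate does not admit a public Literature theorem without a cite tag.

THIS FILE (2 of 3) ports: PerpetualPumpEulerTypeIGlueTestToH10, PerpetualPumpEulerTypeIGlueFourierIterated, PerpetualPumpEulerTypeIGlueSobolevR3, PerpetualPumpEulerTypeIGlueMemH10, PerpetualPumpEulerTypeIGlueContinuity, PerpetualPumpThesisBilinearOperatorWeighted, PerpetualPumpThesisBilinearOperatorForm, PerpetualPumpThesisUniquenessFormBound, PerpetualPumpThesisBilinearOperator.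
-/

noncomputable section

/-!
## Part 1 — port of `Summits/NavierStokesRegularity/NavierStokesRegularity/Theorems/PerpetualPumpEulerTypeIGlueTestToH10.lean` (5 declarations kept)

# Route PerpetualPump · `EulerTypeIGlue` — stub `stub_testToH10` (line `Sketch`)

Tao's mild identity (2016, (1.15)) at viscosity `ν` for the complexified curve `U`,
`⟨U t, w⟩ = ⟨e^{νtΔ} U 0, w⟩ + ∫₀ᵗ ⟨B(U s, U s), e^{ν(t-s)Δ} w⟩ ds`,
known for every complexified divergence-free test field `w = [φ^ℂ]`, `φ ∈ C_{c,σ}^∞`, extends to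
every `w ∈ H¹⁰_df` by an `L²`-closure argument (no `H¹⁰` density is needed):

* `C_{c,σ}^∞` is `L²`-dense in the real Fourier-divergence-free classes
  (`exists_divFreeTest_tendsto`, Temam 1977 Ch. I Thm. 1.4/1.6, landed);
* `z ↦ ⟨a, z⟩` is a continuous linear functional on `L²` (`pairing_eq_inner_conjL2`);
* the Duhamel term is Lipschitz in the `L²` test slot: by trilinearity (`eulerForm_sub₃`),
  linearity and `L²`-contractivity of `e^{τΔ}` (`fourierMultiplier_sub`, `norm_heat_le`) and the
  bound `|⟨B(u,u), z⟩| ≤ K ‖u‖²_{H¹⁰} ‖z‖` (`norm_eulerForm_le`, Tao p. 7), with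
  `sup_{[0,t]} ‖U s‖_{H¹⁰} < ∞` (`ContinuousInH10On.exists_bound`); the integrands are continuous
  in `s` (a version of the landed `continuousOn_eulerForm_heat` with an arbitrary
  `L²`-continuous test curve), hence interval integrable.

## References

* T. Tao, J. Amer. Math. Soc. 29 (2016), arXiv:1402.0290v3, §1.1 (1.15), p. 7. [Tao2016AveragedNS]
* R. Temam, *Navier–Stokes Equations* (1977), Ch. I, Thm. 1.4 / Thm. 1.6. [Temam1977]
-/

section Part1

open _root_.MeasureTheory _root_.Set _root_.Filter _root_.Topology FourierTransform
open scoped _root_.ENNReal _root_.NNReal RealInnerProductSpace SchwartzMap _root_.ContDiff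

namespace Literature.Analysis.PerpetualPump.PerpetualPumpEulerTypeIGlue

open Literature.Analysis.FluidPDE Literature.Analysis.FluidPDE.Tao2016
open Literature.Analysis.FunctionSpaces (eFourierSobolevNorm)
open Literature.Analysis.FunctionSpaces.EuclideanSpace (complexify complexify_apply norm_complexify
  continuous_complexify)

/-! ### Continuity in the `L²` test slot -/

/-- `z ↦ ⟨a, z⟩` is continuous on `L²` (it is the inner product against `ā`). [folklore]
[cite: Tao2016AveragedNS, §1.1 (1.3)–(1.5), (1.15) pp. 3–7 (the `H¹⁰_df` mild formulation of the true Navier–Stokes form and its Fourier-side calculus) (source of the NOTION / ARGUMENT this module implements; this declaration is the cell’s own lemma or plumbing, NOT a printed statement)] -/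
theorem continuous_pairing_right (a : L2C) : Continuous fun z : L2C => pairing a z := by
  have h : (fun z : L2C => pairing a z) = fun z => inner ℂ (conjL2 a) z := by
    funext z
    rw [pairing_swap, pairing_eq_inner_conjL2]
  rw [h]
  exact continuous_const.inner continuous_id

/-- **The integrand `s ↦ ⟨B(v(s), v(s)), Z(s)⟩` is continuous** on a time set on which `v` is
`H¹⁰`-continuous with finite, bounded `H¹⁰` norms and `Z` is `L²`-continuous (Tao 2016, p. 7: the
form converges absolutely on `H¹⁰ × H¹⁰ × L²`; trilinearity). [cite: Tao2016AveragedNS, §1.1 (1.15) p. 7] -/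
theorem continuousOn_eulerForm_of_continuousOn {I : Set ℝ} {v : ℝ → L2C}
    (hv : ContinuousInH10On I v) (hfin : ∀ s ∈ I, eFourierSobolevNorm 10 (v s) < ⊤) {M : ℝ}
    (hM : ∀ s ∈ I, (eFourierSobolevNorm 10 (v s)).toReal ≤ M) {Z : ℝ → L2C}
    (hZ : ContinuousOn Z I) :
    ContinuousOn (fun s => eulerForm (v s) (v s) (Z s)) I := by
  set K : ℝ := Real.pi * (2 * ((∫⁻ ξ : (EuclideanSpace ℝ (Fin 3)), ENNReal.ofReal ((1 + ‖ξ‖ ^ 2) ^ (-10 : ℝ))) ^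
      (1 / 2 : ℝ)).toReal) with hK
  have hK0 : 0 ≤ K := by positivity
  set M' : ℝ := max M 0 with hM'
  have hreal : ∀ s ∈ I, (eFourierSobolevNorm 10 (v s)).toReal ≤ M' := fun s hs =>
    (hM s hs).trans (le_max_left _ _)
  intro s₀ hs₀
  rw [ContinuousWithinAt, tendsto_iff_norm_sub_tendsto_zero]
  -- the three-term decomposition and its bound
  have hbound : ∀ s ∈ I, ‖eulerForm (v s) (v s) (Z s) - eulerForm (v s₀) (v s₀) (Z s₀)‖ ≤
      K * (eFourierSobolevNorm 10 (v s - v s₀)).toReal * M' * ‖Z s‖ +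
      K * M' * (eFourierSobolevNorm 10 (v s - v s₀)).toReal * ‖Z s‖ +
      K * M' * M' * ‖Z s - Z s₀‖ := by
    intro s hs
    have e1 := eulerForm_sub₁ (Z s) (hfin s hs) (hfin s₀ hs₀) (hfin s hs)
    have e2 := eulerForm_sub₂ (Z s) (hfin s₀ hs₀) (hfin s hs) (hfin s₀ hs₀)
    have e3 := eulerForm_sub₃ (Z s) (Z s₀) (hfin s₀ hs₀) (hfin s₀ hs₀)
    have hdec : eulerForm (v s) (v s) (Z s) - eulerForm (v s₀) (v s₀) (Z s₀) =
        eulerForm (v s - v s₀) (v s) (Z s) + eulerForm (v s₀) (v s - v s₀) (Z s) +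
          eulerForm (v s₀) (v s₀) (Z s - Z s₀) := by
      rw [← e1, ← e2, ← e3]; ring
    rw [hdec]
    have hsub := eFourierSobolevNorm_sub_lt_top (hfin s hs) (hfin s₀ hs₀)
    refine (norm_add₃_le).trans (add_le_add_three ?_ ?_ ?_)
    · refine (norm_eulerForm_le _ hsub (hfin s hs)).trans ?_
      have h1 := hreal s hs
      gcongr
    · refine (norm_eulerForm_le _ (hfin s₀ hs₀) hsub).trans ?_
      have h1 := hreal s₀ hs₀
      gcongr
    · refine (norm_eulerForm_le _ (hfin s₀ hs₀) (hfin s₀ hs₀)).trans ?_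
      have h1 := hreal s₀ hs₀
      gcongr
  -- the vanishing quantities
  have hH10 : Tendsto (fun s => (eFourierSobolevNorm 10 (v s - v s₀)).toReal) (𝓝[I] s₀) (𝓝 0) := by
    have h := (ENNReal.tendsto_toReal ENNReal.zero_ne_top).comp (hv s₀ hs₀)
    rw [ENNReal.toReal_zero] at h
    exact h
  have hZ0 : Tendsto (fun s => ‖Z s - Z s₀‖) (𝓝[I] s₀) (𝓝 0) := by
    have h := ((hZ s₀ hs₀).sub_const (Z s₀)).norm
    simp only [sub_self, norm_zero] at h
    exact h
  have hZn : Tendsto (fun s => ‖Z s‖) (𝓝[I] s₀) (𝓝 ‖Z s₀‖) := (hZ s₀ hs₀).norm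
  have hrhs : Tendsto (fun s => K * (eFourierSobolevNorm 10 (v s - v s₀)).toReal * M' * ‖Z s‖ +
      K * M' * (eFourierSobolevNorm 10 (v s - v s₀)).toReal * ‖Z s‖ +
      K * M' * M' * ‖Z s - Z s₀‖) (𝓝[I] s₀) (𝓝 0) := by
    have h1 : Tendsto (fun s => K * (eFourierSobolevNorm 10 (v s - v s₀)).toReal * M' * ‖Z s‖)
        (𝓝[I] s₀) (𝓝 (K * 0 * M' * ‖Z s₀‖)) := ((hH10.const_mul K).mul_const M').mul hZn
    have h2 : Tendsto (fun s => K * M' * (eFourierSobolevNorm 10 (v s - v s₀)).toReal * ‖Z s‖)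
        (𝓝[I] s₀) (𝓝 (K * M' * 0 * ‖Z s₀‖)) := (hH10.const_mul (K * M')).mul hZn
    have h3 : Tendsto (fun s => K * M' * M' * ‖Z s - Z s₀‖) (𝓝[I] s₀) (𝓝 (K * M' * M' * 0)) :=
      hZ0.const_mul (K * M' * M')
    simpa using (h1.add h2).add h3
  refine squeeze_zero_norm' ?_ hrhs
  filter_upwards [self_mem_nhdsWithin] with s hs
  rw [norm_norm]
  exact hbound s hs

/-! ### The Duhamel term is continuous in the `L²` test slot -/

/-- **`L²`-continuity of the Duhamel term in the test slot**: if `Φ n → w` in `L²`, then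
`∫₀ᵗ ⟨B(U s, U s), e^{ν(t-s)Δ} Φ n⟩ ds → ∫₀ᵗ ⟨B(U s, U s), e^{ν(t-s)Δ} w⟩ ds`, for an
`H¹⁰`-continuous curve `U` with finite `H¹⁰` norms on `[0,t]`
(`|∫₀ᵗ ⟨B(U,U), e^{ν(t-s)Δ}(Φ n - w)⟩| ≤ t K sup‖U‖²_{H¹⁰} ‖Φ n - w‖`). [cite: Tao2016AveragedNS, §1.1 (1.15) p. 7] -/
theorem tendsto_intervalIntegral_eulerForm_heat {ν t : ℝ} (ht : 0 ≤ t) {U : ℝ → L2C}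
    (hfin : ∀ s ∈ Icc 0 t, eFourierSobolevNorm 10 (U s) < ⊤) (hc : ContinuousInH10On (Icc 0 t) U)
    {Φ : ℕ → L2C} {w : L2C} (hΦ : Tendsto Φ atTop (𝓝 w)) :
    Tendsto (fun n => ∫ s in (0:ℝ)..t, eulerForm (U s) (U s) (heat (ν * (t - s)) (Φ n))) atTop
      (𝓝 (∫ s in (0:ℝ)..t, eulerForm (U s) (U s) (heat (ν * (t - s)) w))) := by
  obtain ⟨M, hM⟩ := hc.exists_bound hfin
  set K : ℝ := Real.pi * (2 * ((∫⁻ ξ : (EuclideanSpace ℝ (Fin 3)), ENNReal.ofReal ((1 + ‖ξ‖ ^ 2) ^ (-10 : ℝ))) ^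
      (1 / 2 : ℝ)).toReal) with hK
  have hK0 : 0 ≤ K := by positivity
  set M' : ℝ := max M 0 with hM'
  have hreal : ∀ s ∈ Icc 0 t, (eFourierSobolevNorm 10 (U s)).toReal ≤ M' := fun s hs =>
    (hM s hs).trans (le_max_left _ _)
  -- continuity, hence interval integrability, of the integrands
  have hcont : ∀ z : L2C,
      ContinuousOn (fun s => eulerForm (U s) (U s) (heat (ν * (t - s)) z)) (Icc 0 t) := fun z =>
    continuousOn_eulerForm_of_continuousOn hc hfin hM
      ((continuous_heat_apply z).comp (continuous_const.mul (continuous_const.sub continuous_id))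
        |>.continuousOn)
  have hint : ∀ z : L2C,
      IntervalIntegrable (fun s => eulerForm (U s) (U s) (heat (ν * (t - s)) z)) volume 0 t := by
    intro z
    refine ContinuousOn.intervalIntegrable ?_
    rw [uIcc_of_le ht]
    exact hcont z
  -- the Lipschitz bound in the test slot
  have hbound : ∀ n, ‖(∫ s in (0:ℝ)..t, eulerForm (U s) (U s) (heat (ν * (t - s)) (Φ n))) -
      ∫ s in (0:ℝ)..t, eulerForm (U s) (U s) (heat (ν * (t - s)) w)‖ ≤
      K * M' * M' * ‖Φ n - w‖ * |t - 0| := by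
    intro n
    rw [← intervalIntegral.integral_sub (hint (Φ n)) (hint w)]
    refine intervalIntegral.norm_integral_le_of_norm_le_const fun s hs => ?_
    rw [uIoc_of_le ht] at hs
    have hs' : s ∈ Icc 0 t := ⟨hs.1.le, hs.2⟩
    -- `e^{τΔ}` is linear (`heat τ = fourierMultiplier _`)
    have hlin : heat (ν * (t - s)) (Φ n) - heat (ν * (t - s)) w = heat (ν * (t - s)) (Φ n - w) :=
      (fourierMultiplier_sub _ (Φ n) w).symm
    rw [eulerForm_sub₃ _ _ (hfin s hs') (hfin s hs'), hlin]
    refine (norm_eulerForm_le _ (hfin s hs') (hfin s hs')).trans ?_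
    have h1 := hreal s hs'
    have h2 := norm_heat_le (ν * (t - s)) (Φ n - w)
    gcongr
  rw [tendsto_iff_norm_sub_tendsto_zero]
  refine squeeze_zero (fun n => norm_nonneg _) hbound ?_
  have h := ((tendsto_iff_norm_sub_tendsto_zero.1 hΦ).const_mul (K * M' * M')).mul_const |t - 0|
  simpa using h

/-! ### Passage to the limit in the identity -/

/-- **The identity passes to `L²` limits of the test field**: if Tao's identity at time `t`
holds for every `Φ n` and `Φ n → w` in `L²`, it holds for `w`. [cite: Tao2016AveragedNS, §1.1 (1.15)] -/
theorem pairing_identity_of_tendsto {ν t : ℝ} (ht : 0 ≤ t) {U : ℝ → L2C}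
    (hfin : ∀ s ∈ Icc 0 t, eFourierSobolevNorm 10 (U s) < ⊤) (hc : ContinuousInH10On (Icc 0 t) U)
    {Φ : ℕ → L2C} {w : L2C} (hΦ : Tendsto Φ atTop (𝓝 w))
    (hid : ∀ n, pairing (U t) (Φ n) = pairing (heat (ν * t) (U 0)) (Φ n) +
      ∫ s in (0:ℝ)..t, eulerForm (U s) (U s) (heat (ν * (t - s)) (Φ n))) :
    pairing (U t) w = pairing (heat (ν * t) (U 0)) w +
      ∫ s in (0:ℝ)..t, eulerForm (U s) (U s) (heat (ν * (t - s)) w) := by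
  have h1 : Tendsto (fun n => pairing (U t) (Φ n)) atTop (𝓝 (pairing (U t) w)) :=
    ((continuous_pairing_right (U t)).tendsto w).comp hΦ
  have h2 : Tendsto (fun n => pairing (heat (ν * t) (U 0)) (Φ n)) atTop
      (𝓝 (pairing (heat (ν * t) (U 0)) w)) :=
    ((continuous_pairing_right _).tendsto w).comp hΦ
  have h3 := tendsto_intervalIntegral_eulerForm_heat (ν := ν) ht hfin hc hΦ
  exact tendsto_nhds_unique (h1.congr hid) (h2.add h3)

/-! ### The stub -/

/-- **S3 — from test fields to all of `H¹⁰_df`**: Tao's identity (1.15) at viscosity `ν`,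
known for every complexified `φ ∈ C_{c,σ}^∞`, holds for every `w ∈ H¹⁰_df` (both sides are
`L²`-continuous in `w` by `norm_eulerForm_le` and the `L²`-contractivity of `e^{τΔ}`;
`C_{c,σ}^∞` is `L²`-dense in the real Fourier-divergence-free classes,
`exists_divFreeTest_tendsto`). [cite: Tao2016AveragedNS, §1.1 (1.15)] -/
theorem stub_testToH10 {ν T : ℝ} (U : ℝ → L2C)
    (hH : ∀ t ∈ Ico 0 T, MemH10df (U t)) (hc : ContinuousInH10On (Ico 0 T) U)
    (htest : ∀ t ∈ Ico 0 T, ∀ φ ∈ divFreeTest (EuclideanSpace ℝ (Fin 3)), ∀ (h2φ : MemLp (complexify ∘ φ) 2 (volume : Measure (EuclideanSpace ℝ (Fin 3)))),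
      pairing (U t) (h2φ.toLp _) = pairing (heat (ν * t) (U 0)) (h2φ.toLp _) +
        ∫ s in (0:ℝ)..t, eulerForm (U s) (U s) (heat (ν * (t - s)) (h2φ.toLp _))) :
    ∀ t ∈ Ico 0 T, ∀ w, MemH10df w →
      pairing (U t) w = pairing (heat (ν * t) (U 0)) w +
        ∫ s in (0:ℝ)..t, eulerForm (U s) (U s) (heat (ν * (t - s)) w) := by
  intro t ht w hw
  obtain ⟨φ, hφ, h2, hΦ⟩ := exists_divFreeTest_tendsto hw.2.1 hw.2.2
  have hI : Icc 0 t ⊆ Ico 0 T := fun s hs => ⟨hs.1, lt_of_le_of_lt hs.2 ht.2⟩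
  exact pairing_identity_of_tendsto ht.1 (fun s hs => (hH s (hI hs)).1) (hc.mono hI) hΦ
    fun n => htest t ht (φ n) (hφ n) (h2 n)

end Literature.Analysis.PerpetualPump.PerpetualPumpEulerTypeIGlue

end Part1

/-!
## Part 2 — port of `Summits/NavierStokesRegularity/NavierStokesRegularity/Theorems/PerpetualPumpEulerTypeIGlueFourierIterated.lean` (9 declarations kept)

# Route PerpetualPump · `EulerTypeIGlue` — toolkit III: iterated directional derivatives under
# the `L²` Fourier transform and the weighted Plancherel identity

Support file for the support item `EulerTypeIGlue` (stmt-NavierStokesRegularity-1838). For a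
smooth `f : V → F` (finite-dimensional real inner product space `V`, complex Hilbert space `F`)
whose iterated derivatives up to order `k` are square integrable, the `k`-th derivative along a
fixed direction `m`, `D_m^k f (x) = D^k f(x)(m, …, m)`, has Plancherel transform
`(2πi⟨ξ,m⟩)^k f̂(ξ)` (iteration of the first-order statement
`fourier_toLp_fderiv_ae_eq'`, reproved here so that this file is self-contained), whence the
**weighted Plancherel identity** `∫ |2π⟨ξ,m⟩|^{2k} ‖f̂(ξ)‖² dξ = ‖D_m^k f‖²_{L²} ≤ ‖m‖^{2k} ‖D^k f‖²_{L²}`: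
polynomial Fourier weights are controlled by physical-space Sobolev norms, for functions that are
in `H^k` but not in `L¹`.

## References

* E. M. Stein, G. Weiss, *Introduction to Fourier Analysis on Euclidean Spaces* (1971), Ch. I
  §1 (Thm. 1.8) and §3.
* T. Tao, J. Amer. Math. Soc. 29 (2016), arXiv:1402.0290v3, §1.1 p. 3. [Tao2016AveragedNS]
-/

section Part2

open _root_.MeasureTheory _root_.Set _root_.Filter _root_.Topology FourierTransform SchwartzMap TemperedDistribution
open scoped _root_.ENNReal _root_.NNReal FourierTransform RealInnerProductSpace _root_.ContDiff LineDeriv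

namespace Literature.Analysis.PerpetualPump.PerpetualPumpEulerTypeIGlue

variable {V : Type*} [NormedAddCommGroup V] [InnerProductSpace ℝ V] [FiniteDimensional ℝ V]
  [MeasurableSpace V] [BorelSpace V]
variable {F : Type*} [NormedAddCommGroup F] [InnerProductSpace ℂ F] [CompleteSpace F]

/-! ### Directional iterated derivatives `x ↦ D^k f(x)(m,…,m)` -/

omit [InnerProductSpace ℝ V] [FiniteDimensional ℝ V] [MeasurableSpace V] [BorelSpace V]
  [InnerProductSpace ℂ F] [CompleteSpace F] in
/-- `‖D^k f(x)(m,…,m)‖ ≤ ‖D^k f(x)‖ ‖m‖^k`. [folklore]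
[cite: Tao2016AveragedNS, §1.1 (1.3)–(1.5), (1.15) pp. 3–7 (the `H¹⁰_df` mild formulation of the true Navier–Stokes form and its Fourier-side calculus) (source of the NOTION / ARGUMENT this module implements; this declaration is the cell’s own lemma or plumbing, NOT a printed statement)] -/
theorem norm_iteratedFDeriv_const_le [NormedSpace ℝ V] [NormedSpace ℝ F] (f : V → F) (k : ℕ)
    (m : V) (x : V) :
    ‖iteratedFDeriv ℝ k f x (fun _ : Fin k => m)‖ ≤ ‖iteratedFDeriv ℝ k f x‖ * ‖m‖ ^ k := by
  have h := (iteratedFDeriv ℝ k f x).le_opNorm (fun _ : Fin k => m)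
  rwa [Finset.prod_const, Finset.card_univ, Fintype.card_fin] at h

omit [InnerProductSpace ℝ V] [FiniteDimensional ℝ V] [MeasurableSpace V] [BorelSpace V]
  [InnerProductSpace ℂ F] [CompleteSpace F] in
/-- The directional iterated derivative of a smooth function is smooth. [folklore]
[cite: Tao2016AveragedNS, §1.1 (1.3)–(1.5), (1.15) pp. 3–7 (the `H¹⁰_df` mild formulation of the true Navier–Stokes form and its Fourier-side calculus) (source of the NOTION / ARGUMENT this module implements; this declaration is the cell’s own lemma or plumbing, NOT a printed statement)] -/
theorem contDiff_iteratedFDeriv_const [NormedSpace ℝ V] [NormedSpace ℝ F] {f : V → F}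
    (hf : ContDiff ℝ (⊤ : ℕ∞) f) (k : ℕ) (m : V) :
    ContDiff ℝ (⊤ : ℕ∞) (fun x => iteratedFDeriv ℝ k f x (fun _ : Fin k => m)) := by
  have h1 : ContDiff ℝ (⊤ : ℕ∞) (iteratedFDeriv ℝ k f) :=
    hf.iteratedFDeriv_right (by exact_mod_cast le_top)
  exact (ContinuousMultilinearMap.apply ℝ (fun _ : Fin k => V) F (fun _ : Fin k => m)).contDiff.comp h1

omit [InnerProductSpace ℝ V] [FiniteDimensional ℝ V] [MeasurableSpace V] [BorelSpace V]
  [InnerProductSpace ℂ F] [CompleteSpace F] in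
/-- **Recursion**: `D^{k+1} f(x)(m,…,m) = ∂_m [x ↦ D^k f(x)(m,…,m)]` for smooth `f`. [folklore]
[cite: Tao2016AveragedNS, §1.1 (1.3)–(1.5), (1.15) pp. 3–7 (the `H¹⁰_df` mild formulation of the true Navier–Stokes form and its Fourier-side calculus) (source of the NOTION / ARGUMENT this module implements; this declaration is the cell’s own lemma or plumbing, NOT a printed statement)] -/
theorem iteratedFDeriv_const_succ_eq [NormedSpace ℝ V] [NormedSpace ℝ F] {f : V → F}
    (hf : ContDiff ℝ (⊤ : ℕ∞) f) (k : ℕ) (m : V) (x : V) :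
    iteratedFDeriv ℝ (k + 1) f x (fun _ : Fin (k + 1) => m) =
      fderiv ℝ (fun y => iteratedFDeriv ℝ k f y (fun _ : Fin k => m)) x m := by
  have hdiff : DifferentiableAt ℝ (iteratedFDeriv ℝ k f) x :=
    ((hf.iteratedFDeriv_right (i := k) (m := 1) (by exact_mod_cast le_top)).differentiable
      one_ne_zero).differentiableAt
  rw [iteratedFDeriv_succ_apply_left, fderiv_continuousMultilinear_apply_const hdiff,
    ContinuousLinearMap.flipMultilinear_apply_apply]
  rfl

/-- `∫⁻ ‖g‖ₑ² = ‖g‖²_{L²}`. [folklore]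
[cite: Tao2016AveragedNS, §1.1 (1.3)–(1.5), (1.15) pp. 3–7 (the `H¹⁰_df` mild formulation of the true Navier–Stokes form and its Fourier-side calculus) (source of the NOTION / ARGUMENT this module implements; this declaration is the cell’s own lemma or plumbing, NOT a printed statement)] -/
theorem lintegral_enorm_sq_eq_eLpNorm_sq {α : Type*} [MeasurableSpace α] (μ : Measure α)
    {G : Type*} [NormedAddCommGroup G] (g : α → G) : ∫⁻ x, ‖g x‖ₑ ^ 2 ∂μ = eLpNorm g 2 μ ^ 2 := by
  have h := eLpNorm_nnreal_pow_eq_lintegral (f := g) (μ := μ) (p := (2 : ℝ≥0)) two_ne_zero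
  simp only [ENNReal.coe_ofNat, NNReal.coe_ofNat, ENNReal.rpow_two] at h
  rw [h]

omit [InnerProductSpace ℂ F] [CompleteSpace F] in
/-- A continuous function with `∫⁻ ‖g‖ₑ² < ∞` is in `L²`. [folklore]
[cite: Tao2016AveragedNS, §1.1 (1.3)–(1.5), (1.15) pp. 3–7 (the `H¹⁰_df` mild formulation of the true Navier–Stokes form and its Fourier-side calculus) (source of the NOTION / ARGUMENT this module implements; this declaration is the cell’s own lemma or plumbing, NOT a printed statement)] -/
theorem memLp_two_of_continuous_of_lintegral {g : V → F} (hg : Continuous g)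
    (h : ∫⁻ x, ‖g x‖ₑ ^ 2 < ⊤) : MemLp g 2 (volume : Measure V) := by
  refine ⟨hg.aestronglyMeasurable, ?_⟩
  rw [lintegral_enorm_sq_eq_eLpNorm_sq] at h
  refine lt_top_iff_ne_top.2 fun htop => ?_
  rw [htop] at h
  simp at h

omit [CompleteSpace F] in
/-- The directional iterated derivatives of a smooth function with `D^k f ∈ L²` are in `L²`. [folklore]
[cite: Tao2016AveragedNS, §1.1 (1.3)–(1.5), (1.15) pp. 3–7 (the `H¹⁰_df` mild formulation of the true Navier–Stokes form and its Fourier-side calculus) (source of the NOTION / ARGUMENT this module implements; this declaration is the cell’s own lemma or plumbing, NOT a printed statement)] -/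
theorem memLp_iteratedFDeriv_const {f : V → F} (hf : ContDiff ℝ (⊤ : ℕ∞) f) {k : ℕ}
    (hk : ∫⁻ x, ‖iteratedFDeriv ℝ k f x‖ₑ ^ 2 < ⊤) (m : V) :
    MemLp (fun x => iteratedFDeriv ℝ k f x (fun _ : Fin k => m)) 2 (volume : Measure V) := by
  have hcont : Continuous (iteratedFDeriv ℝ k f) :=
    hf.continuous_iteratedFDeriv (by exact_mod_cast le_top)
  have hD : MemLp (iteratedFDeriv ℝ k f) 2 (volume : Measure V) :=
    memLp_two_of_continuous_of_lintegral hcont hk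
  refine MemLp.of_le_mul (c := ‖m‖ ^ k) hD (contDiff_iteratedFDeriv_const hf k m).continuous.aestronglyMeasurable
    (Eventually.of_forall fun x => ?_)
  rw [mul_comm]
  exact norm_iteratedFDeriv_const_le f k m x

/-! ### Plancherel in `lintegral` form -/

/-- **Plancherel, `lintegral` form**: `∫⁻ ‖𝓕u‖ₑ² = ∫⁻ ‖u‖ₑ²` for `u ∈ L²(V; F)`. [folklore]
[cite: Tao2016AveragedNS, §1.1 (1.3)–(1.5), (1.15) pp. 3–7 (the `H¹⁰_df` mild formulation of the true Navier–Stokes form and its Fourier-side calculus) (source of the NOTION / ARGUMENT this module implements; this declaration is the cell’s own lemma or plumbing, NOT a printed statement)] -/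
theorem lintegral_enorm_sq_fourier_eq (u : Lp F 2 (volume : Measure V)) :
    ∫⁻ ξ, ‖((𝓕 u : Lp F 2 (volume : Measure V)) : V → F) ξ‖ₑ ^ 2 = ∫⁻ x, ‖(u : V → F) x‖ₑ ^ 2 := by
  rw [lintegral_enorm_sq_eq_eLpNorm_sq, lintegral_enorm_sq_eq_eLpNorm_sq, ← Lp.enorm_def,
    ← Lp.enorm_def, ← ofReal_norm, ← ofReal_norm, Lp.norm_fourier_eq]

/-! ### `𝓕[D_m^k f] = (2πi⟨ξ,m⟩)^k 𝓕[f]` -/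

/-- **The `L²` Fourier transform of a directional iterated derivative**: for smooth `f` with
`D^j f ∈ L²` for `j ≤ k`, `𝓕[D_m^k f](ξ) = (2πi ⟨ξ,m⟩)^k 𝓕[f](ξ)` a.e. (iteration of the
first-order statement supplied as the hypothesis `hstep`, cf. toolkit II
`fourier_toLp_fderiv_ae_eq`). [folklore]
[cite: Tao2016AveragedNS, §1.1 (1.3)–(1.5), (1.15) pp. 3–7 (the `H¹⁰_df` mild formulation of the true Navier–Stokes form and its Fourier-side calculus) (source of the NOTION / ARGUMENT this module implements; this declaration is the cell’s own lemma or plumbing, NOT a printed statement)] -/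
theorem fourier_toLp_iteratedFDeriv_const_ae_eq_of_step
    (hstep : ∀ {g : V → F} (_ : ContDiff ℝ 1 g) (m : V) (hg2 : MemLp g 2 volume)
      (hd2 : MemLp (fun x => fderiv ℝ g x m) 2 volume),
      ((𝓕 (hd2.toLp _) : Lp F 2 (volume : Measure V)) : V → F) =ᵐ[volume]
        fun ξ => ((2 * Real.pi * Complex.I) * ((⟪ξ, m⟫ : ℝ) : ℂ)) •
          ((𝓕 (hg2.toLp g) : Lp F 2 (volume : Measure V)) : V → F) ξ)
    {f : V → F} (hf : ContDiff ℝ (⊤ : ℕ∞) f) (m : V) (k : ℕ)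
    (hint : ∀ j ≤ k, ∫⁻ x, ‖iteratedFDeriv ℝ j f x‖ₑ ^ 2 < ⊤) (hf2 : MemLp f 2 volume) :
    ((𝓕 ((memLp_iteratedFDeriv_const hf (hint k le_rfl) m).toLp _) : Lp F 2 (volume : Measure V)) :
        V → F) =ᵐ[volume]
      fun ξ => ((2 * Real.pi * Complex.I) * ((⟪ξ, m⟫ : ℝ) : ℂ)) ^ k •
        ((𝓕 (hf2.toLp f) : Lp F 2 (volume : Measure V)) : V → F) ξ := by
  induction k with
  | zero =>
    have h0 : (memLp_iteratedFDeriv_const hf (hint 0 le_rfl) m).toLp _ = hf2.toLp f := by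
      refine MemLp.toLp_congr _ _ (Eventually.of_forall fun x => ?_)
      simp only [iteratedFDeriv_zero_apply]
    rw [h0]
    exact Eventually.of_forall fun ξ => by simp only [pow_zero, one_smul]
  | succ k ih =>
    have hint' : ∀ j ≤ k, ∫⁻ x, ‖iteratedFDeriv ℝ j f x‖ₑ ^ 2 < ⊤ := fun j hj =>
      hint j (hj.trans (Nat.le_succ k))
    have ihk := ih hint'
    -- the `k`-th directional derivative `g` and its derivative along `m`
    set g : V → F := fun x => iteratedFDeriv ℝ k f x (fun _ : Fin k => m) with hg
    have hgs : ContDiff ℝ (⊤ : ℕ∞) g := contDiff_iteratedFDeriv_const hf k m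
    have hg1 : ContDiff ℝ 1 g := hgs.of_le (by exact_mod_cast le_top)
    have hg2 : MemLp g 2 volume := memLp_iteratedFDeriv_const hf (hint' k le_rfl) m
    have hsucc : MemLp (fun x => iteratedFDeriv ℝ (k + 1) f x (fun _ : Fin (k + 1) => m)) 2 volume :=
      memLp_iteratedFDeriv_const hf (hint (k + 1) le_rfl) m
    have hfun : (fun x => fderiv ℝ g x m) =
        fun x => iteratedFDeriv ℝ (k + 1) f x (fun _ : Fin (k + 1) => m) :=
      funext fun x => (iteratedFDeriv_const_succ_eq hf k m x).symm
    have hd2 : MemLp (fun x => fderiv ℝ g x m) 2 volume := by rw [hfun]; exact hsucc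
    have hstepg := hstep hg1 m hg2 hd2
    -- identify the `L²` classes
    have hcl1 : (memLp_iteratedFDeriv_const hf (hint (k + 1) le_rfl) m).toLp _ = hd2.toLp _ := by
      refine MemLp.toLp_congr _ _ (Eventually.of_forall fun x => ?_)
      exact iteratedFDeriv_const_succ_eq hf k m x
    have hcl2 : hg2.toLp g = (memLp_iteratedFDeriv_const hf (hint' k le_rfl) m).toLp _ := rfl
    rw [hcl1]
    filter_upwards [hstepg, ihk] with ξ h1 h2
    rw [h1, hcl2, h2, smul_smul, pow_succ, mul_comm]

/-- **Weighted Plancherel identity**: under the same hypotheses,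
`∫ ‖(2πi⟨ξ,m⟩)^k‖² ‖f̂(ξ)‖² dξ = ∫ ‖D_m^k f‖²`. [folklore]
[cite: Tao2016AveragedNS, §1.1 (1.3)–(1.5), (1.15) pp. 3–7 (the `H¹⁰_df` mild formulation of the true Navier–Stokes form and its Fourier-side calculus) (source of the NOTION / ARGUMENT this module implements; this declaration is the cell’s own lemma or plumbing, NOT a printed statement)] -/
theorem lintegral_weight_pow_mul_enorm_fourier_sq_eq_of_step
    (hstep : ∀ {g : V → F} (_ : ContDiff ℝ 1 g) (m : V) (hg2 : MemLp g 2 volume)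
      (hd2 : MemLp (fun x => fderiv ℝ g x m) 2 volume),
      ((𝓕 (hd2.toLp _) : Lp F 2 (volume : Measure V)) : V → F) =ᵐ[volume]
        fun ξ => ((2 * Real.pi * Complex.I) * ((⟪ξ, m⟫ : ℝ) : ℂ)) •
          ((𝓕 (hg2.toLp g) : Lp F 2 (volume : Measure V)) : V → F) ξ)
    {f : V → F} (hf : ContDiff ℝ (⊤ : ℕ∞) f) (m : V) (k : ℕ)
    (hint : ∀ j ≤ k, ∫⁻ x, ‖iteratedFDeriv ℝ j f x‖ₑ ^ 2 < ⊤) (hf2 : MemLp f 2 volume) :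
    ∫⁻ ξ, ‖((2 * Real.pi * Complex.I) * ((⟪ξ, m⟫ : ℝ) : ℂ)) ^ k‖ₑ ^ 2 *
        ‖((𝓕 (hf2.toLp f) : Lp F 2 (volume : Measure V)) : V → F) ξ‖ₑ ^ 2 =
      ∫⁻ x, ‖iteratedFDeriv ℝ k f x (fun _ : Fin k => m)‖ₑ ^ 2 := by
  have hD := memLp_iteratedFDeriv_const hf (hint k le_rfl) m
  have hae := fourier_toLp_iteratedFDeriv_const_ae_eq_of_step hstep hf m k hint hf2
  calc ∫⁻ ξ, ‖((2 * Real.pi * Complex.I) * ((⟪ξ, m⟫ : ℝ) : ℂ)) ^ k‖ₑ ^ 2 *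
          ‖((𝓕 (hf2.toLp f) : Lp F 2 (volume : Measure V)) : V → F) ξ‖ₑ ^ 2
      = ∫⁻ ξ, ‖((𝓕 (hD.toLp _) : Lp F 2 (volume : Measure V)) : V → F) ξ‖ₑ ^ 2 := by
        refine lintegral_congr_ae ?_
        filter_upwards [hae] with ξ hξ
        rw [hξ, enorm_smul]
        ring
    _ = ∫⁻ x, ‖((hD.toLp _ : Lp F 2 (volume : Measure V)) : V → F) x‖ₑ ^ 2 :=
        lintegral_enorm_sq_fourier_eq _
    _ = ∫⁻ x, ‖iteratedFDeriv ℝ k f x (fun _ : Fin k => m)‖ₑ ^ 2 := by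
        refine lintegral_congr_ae ?_
        filter_upwards [hD.coeFn_toLp] with x hx
        rw [hx]

end Literature.Analysis.PerpetualPump.PerpetualPumpEulerTypeIGlue

end Part2

/-!
## Part 3 — port of `Summits/NavierStokesRegularity/NavierStokesRegularity/Theorems/PerpetualPumpEulerTypeIGlueSobolevR3.lean` (13 declarations kept)

# Route PerpetualPump · `EulerTypeIGlue` — `ℝ³`: Fourier–Sobolev norms of smooth `H^N` fields and
# `H¹⁰_df` membership of complexified classical velocity fields

Support file for the support item `EulerTypeIGlue` (stmt-NavierStokesRegularity-1838).  For a
smooth real field `u : ℝ³ → ℝ³` with `u, Du, …, D^N u ∈ L²` the `L²` class of `u^ℂ` has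
`‖[u^ℂ]‖²_{H^N} ≤ 2^N (∫|u|² + 3^N ∫‖D^N u‖²)` in Tao's Fourier-side norm
(`eFourierSobolevNorm_sq_le`; binomial bound `(1+|ξ|²)^N ≤ 2^N(1 + 3^N Σᵢ ξᵢ^{2N})` and the
directional Plancherel identities of toolkit III with the derivative rule of toolkit II);
if moreover `div u = 0` then `ξ · 𝓕[u^ℂ](ξ) = 0` a.e. (`isFourierDivFree_toLp_complexify`), so
`[u^ℂ] ∈ H¹⁰_df` (`memH10df_toLp_complexify`) — the regularity class of Tao 2016, §1.1.

## References

* T. Tao, J. Amer. Math. Soc. 29 (2016), arXiv:1402.0290v3, §1.1 p. 3 (`H¹⁰_df`). [Tao2016AveragedNS]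
* E. M. Stein, G. Weiss, *Introduction to Fourier Analysis on Euclidean Spaces* (1971), Ch. I,
  Thm. 1.8, Thm. 2.3.

Not carried from this source module (not needed by the declarations re-homed here; their consumers are Summits-side): `memLp_complexify_comp_of_contDiff`.
-/

section Part3

open _root_.MeasureTheory _root_.Set _root_.Filter _root_.Topology FourierTransform SchwartzMap TemperedDistribution
open scoped _root_.ENNReal _root_.NNReal FourierTransform RealInnerProductSpace _root_.ContDiff LineDeriv

namespace Literature.Analysis.PerpetualPump.PerpetualPumpEulerTypeIGlue

/-! ### `ℝ³`: Fourier–Sobolev norms of smooth `H^N` vector fields, and `H¹⁰_df` membership -/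

section R3

open Literature.Analysis.FluidPDE Literature.Analysis.FluidPDE.Tao2016
open Literature.Analysis.FunctionSpaces (eFourierSobolevNorm)
open Literature.Analysis.FunctionSpaces.EuclideanSpace (complexify complexify_apply norm_complexify
  continuous_complexify)

/-- **The Sobolev weight against coordinate monomials**:
`(1+|ξ|²)^{n+1} ≤ 2^{n+1} (1 + 3ⁿ Σᵢ ξᵢ^{2(n+1)})` on `ℝ³`. [folklore]
[cite: Tao2016AveragedNS, §1.1 (1.3)–(1.5), (1.15) pp. 3–7 (the `H¹⁰_df` mild formulation of the true Navier–Stokes form and its Fourier-side calculus) (source of the NOTION / ARGUMENT this module implements; this declaration is the cell’s own lemma or plumbing, NOT a printed statement)] -/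
theorem one_add_norm_sq_pow_le (n : ℕ) (ξ : EuclideanSpace ℝ (Fin 3)) :
    (1 + ‖ξ‖ ^ 2) ^ (n + 1) ≤ 2 ^ (n + 1) * (1 + 3 ^ n * ∑ i, (ξ i) ^ (2 * (n + 1))) := by
  set a : ℝ := ‖ξ‖ ^ 2 with ha_def
  have ha : 0 ≤ a := sq_nonneg _
  have hsum : a = ∑ i, (ξ i) ^ 2 := EuclideanSpace.real_norm_sq_eq ξ
  have h1 : (1 + a) ^ (n + 1) ≤ 2 ^ (n + 1) * max 1 a ^ (n + 1) := by
    rw [← mul_pow]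
    refine pow_le_pow_left₀ (by positivity) ?_ _
    have h₁ := le_max_left 1 a
    have h₂ := le_max_right 1 a
    linarith
  have h2 : max 1 a ^ (n + 1) ≤ 1 + a ^ (n + 1) := by
    rcases le_total 1 a with h | h
    · rw [max_eq_right h]
      linarith [pow_nonneg ha (n + 1)]
    · rw [max_eq_left h, one_pow]
      linarith [pow_nonneg ha (n + 1)]
  have h3 : a ^ (n + 1) ≤ 3 ^ n * ∑ i, (ξ i) ^ (2 * (n + 1)) := by
    rw [hsum]
    have h := pow_sum_le_card_mul_sum_pow (s := Finset.univ) (f := fun i : Fin 3 => (ξ i) ^ 2)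
      (fun i _ => sq_nonneg _) n
    simp only [Finset.card_univ, Fintype.card_fin, Nat.cast_ofNat, ← pow_mul] at h
    exact h
  calc (1 + a) ^ (n + 1) ≤ 2 ^ (n + 1) * max 1 a ^ (n + 1) := h1
    _ ≤ 2 ^ (n + 1) * (1 + a ^ (n + 1)) := by gcongr
    _ ≤ 2 ^ (n + 1) * (1 + 3 ^ n * ∑ i, (ξ i) ^ (2 * (n + 1))) := by gcongr

variable {u : EuclideanSpace ℝ (Fin 3) → EuclideanSpace ℝ (Fin 3)}

/-- Smoothness of the complexified field. [folklore]
[cite: Tao2016AveragedNS, §1.1 (1.3)–(1.5), (1.15) pp. 3–7 (the `H¹⁰_df` mild formulation of the true Navier–Stokes form and its Fourier-side calculus) (source of the NOTION / ARGUMENT this module implements; this declaration is the cell’s own lemma or plumbing, NOT a printed statement)] -/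
theorem contDiff_complexify_comp {n : WithTop ℕ∞} (hu : ContDiff ℝ n u) : ContDiff ℝ n (complexify ∘ u) :=
  complexify.toContinuousLinearMap.contDiff.comp hu

/-- Iterated derivatives of the complexified field: `Dⁿ(u^ℂ) = complexify ∘ Dⁿu`. [folklore]
[cite: Tao2016AveragedNS, §1.1 (1.3)–(1.5), (1.15) pp. 3–7 (the `H¹⁰_df` mild formulation of the true Navier–Stokes form and its Fourier-side calculus) (source of the NOTION / ARGUMENT this module implements; this declaration is the cell’s own lemma or plumbing, NOT a printed statement)] -/
theorem iteratedFDeriv_complexify_comp (hu : ContDiff ℝ (⊤ : ℕ∞) u) (n : ℕ) (x : EuclideanSpace ℝ (Fin 3)) :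
    iteratedFDeriv ℝ n (complexify ∘ u) x =
      complexify.toContinuousLinearMap.compContinuousMultilinearMap (iteratedFDeriv ℝ n u x) :=
  complexify.toContinuousLinearMap.iteratedFDeriv_comp_left hu.contDiffAt (mod_cast le_top)

/-- The complexification does not increase the size of the iterated derivatives. [folklore]
[cite: Tao2016AveragedNS, §1.1 (1.3)–(1.5), (1.15) pp. 3–7 (the `H¹⁰_df` mild formulation of the true Navier–Stokes form and its Fourier-side calculus) (source of the NOTION / ARGUMENT this module implements; this declaration is the cell’s own lemma or plumbing, NOT a printed statement)] -/
theorem norm_iteratedFDeriv_complexify_comp_le (hu : ContDiff ℝ (⊤ : ℕ∞) u) (n : ℕ)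
    (x : EuclideanSpace ℝ (Fin 3)) :
    ‖iteratedFDeriv ℝ n (complexify ∘ u) x‖ ≤ ‖iteratedFDeriv ℝ n u x‖ := by
  rw [iteratedFDeriv_complexify_comp hu n x]
  refine (ContinuousLinearMap.norm_compContinuousMultilinearMap_le _ _).trans ?_
  refine mul_le_of_le_one_left (norm_nonneg _) ?_
  exact complexify.norm_toContinuousLinearMap_le

/-- Directional iterated derivatives of the complexified field have the same size. [folklore]
[cite: Tao2016AveragedNS, §1.1 (1.3)–(1.5), (1.15) pp. 3–7 (the `H¹⁰_df` mild formulation of the true Navier–Stokes form and its Fourier-side calculus) (source of the NOTION / ARGUMENT this module implements; this declaration is the cell’s own lemma or plumbing, NOT a printed statement)] -/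
theorem norm_iteratedFDeriv_complexify_comp_const (hu : ContDiff ℝ (⊤ : ℕ∞) u) (n : ℕ)
    (m x : EuclideanSpace ℝ (Fin 3)) :
    ‖iteratedFDeriv ℝ n (complexify ∘ u) x (fun _ => m)‖ = ‖iteratedFDeriv ℝ n u x (fun _ => m)‖ := by
  rw [iteratedFDeriv_complexify_comp hu n x, ContinuousLinearMap.compContinuousMultilinearMap_coe,
    Function.comp_apply]
  exact norm_complexify _

/-- `∫ ‖Dⁿ(u^ℂ)‖² ≤ ∫ ‖Dⁿu‖²`. [folklore]
[cite: Tao2016AveragedNS, §1.1 (1.3)–(1.5), (1.15) pp. 3–7 (the `H¹⁰_df` mild formulation of the true Navier–Stokes form and its Fourier-side calculus) (source of the NOTION / ARGUMENT this module implements; this declaration is the cell’s own lemma or plumbing, NOT a printed statement)] -/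
theorem lintegral_iteratedFDeriv_complexify_comp_le (hu : ContDiff ℝ (⊤ : ℕ∞) u) (n : ℕ) :
    ∫⁻ x, ‖iteratedFDeriv ℝ n (complexify ∘ u) x‖ₑ ^ 2 ≤ ∫⁻ x, ‖iteratedFDeriv ℝ n u x‖ₑ ^ 2 := by
  refine lintegral_mono fun x => ?_
  gcongr
  rw [← ofReal_norm, ← ofReal_norm]
  exact ENNReal.ofReal_le_ofReal (norm_iteratedFDeriv_complexify_comp_le hu n x)

/-- `∫ ‖Dⁿ(u^ℂ)(m,…,m)‖² ≤ ‖m‖^{2n} ∫ ‖Dⁿu‖²`. [folklore]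
[cite: Tao2016AveragedNS, §1.1 (1.3)–(1.5), (1.15) pp. 3–7 (the `H¹⁰_df` mild formulation of the true Navier–Stokes form and its Fourier-side calculus) (source of the NOTION / ARGUMENT this module implements; this declaration is the cell’s own lemma or plumbing, NOT a printed statement)] -/
theorem lintegral_iteratedFDeriv_complexify_comp_const_le (hu : ContDiff ℝ (⊤ : ℕ∞) u) (n : ℕ)
    (m : EuclideanSpace ℝ (Fin 3)) :
    ∫⁻ x, ‖iteratedFDeriv ℝ n (complexify ∘ u) x (fun _ => m)‖ₑ ^ 2 ≤
      ‖m‖ₑ ^ (2 * n) * ∫⁻ x, ‖iteratedFDeriv ℝ n u x‖ₑ ^ 2 := by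
  rw [← lintegral_const_mul' _ _ (by simp [enorm_ne_top])]
  refine lintegral_mono fun x => ?_
  rw [← ofReal_norm, norm_iteratedFDeriv_complexify_comp_const hu n m x, ofReal_norm]
  have h := norm_iteratedFDeriv_const_le u n m x
  have h' : ‖iteratedFDeriv ℝ n u x (fun _ : Fin n => m)‖ₑ ≤ ‖m‖ₑ ^ n * ‖iteratedFDeriv ℝ n u x‖ₑ := by
    rw [← ofReal_norm, ← ofReal_norm, ← ofReal_norm, ← ENNReal.ofReal_pow (norm_nonneg _),
      ← ENNReal.ofReal_mul (by positivity)]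
    exact ENNReal.ofReal_le_ofReal (by rw [mul_comm]; exact h)
  calc ‖iteratedFDeriv ℝ n u x (fun _ : Fin n => m)‖ₑ ^ 2
      ≤ (‖m‖ₑ ^ n * ‖iteratedFDeriv ℝ n u x‖ₑ) ^ 2 := by gcongr
    _ = ‖m‖ₑ ^ (2 * n) * ‖iteratedFDeriv ℝ n u x‖ₑ ^ 2 := by ring

/-- **Fourier–Sobolev norm of a smooth `H^N` field (physical → Fourier transfer)**: for smooth
`u : ℝ³ → ℝ³` with `u, Du, …, D^N u ∈ L²`, `N = n + 1`, the `L²` class of its complexification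
has `‖·‖²_{H^N} ≤ 2^N (∫|u|² + 3^N ∫ ‖D^N u‖²)` (Tao's `H¹⁰` norm is the Fourier-side one;
Plancherel on the derivatives). [cite: Tao2016AveragedNS, §1.1 p. 3 (H¹⁰ via Fourier weights)] -/
theorem eFourierSobolevNorm_sq_le (hu : ContDiff ℝ (⊤ : ℕ∞) u) (n : ℕ)
    (hint : ∀ j ≤ n + 1, ∫⁻ x, ‖iteratedFDeriv ℝ j u x‖ₑ ^ 2 < ⊤)
    (h2 : MemLp (complexify ∘ u) 2 (volume : Measure (EuclideanSpace ℝ (Fin 3)))) :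
    eFourierSobolevNorm (n + 1 : ℕ) (h2.toLp _) ^ 2 ≤
      2 ^ (n + 1) * ((∫⁻ x, ‖u x‖ₑ ^ 2) + 3 ^ (n + 1) * ∫⁻ x, ‖iteratedFDeriv ℝ (n + 1) u x‖ₑ ^ 2) := by
  set f : EuclideanSpace ℝ (Fin 3) → EuclideanSpace ℂ (Fin 3) := complexify ∘ u with hf_def
  have hf : ContDiff ℝ (⊤ : ℕ∞) f := contDiff_complexify_comp hu
  have hintf : ∀ j ≤ n + 1, ∫⁻ x, ‖iteratedFDeriv ℝ j f x‖ₑ ^ 2 < ⊤ := fun j hj =>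
    lt_of_le_of_lt (lintegral_iteratedFDeriv_complexify_comp_le hu j) (hint j hj)
  set G : EuclideanSpace ℝ (Fin 3) → EuclideanSpace ℂ (Fin 3) :=
    ((𝓕 (h2.toLp f) : L2C) : EuclideanSpace ℝ (Fin 3) → EuclideanSpace ℂ (Fin 3)) with hG
  have hGm : AEStronglyMeasurable G volume := Lp.aestronglyMeasurable _
  -- the norm as a weighted integral
  have hnorm : eFourierSobolevNorm (n + 1 : ℕ) (h2.toLp f) ^ 2 =
      ∫⁻ ξ, ENNReal.ofReal ((1 + ‖ξ‖ ^ 2) ^ (n + 1)) * ‖G ξ‖ₑ ^ 2 := by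
    rw [eFourierSobolevNorm_eq, ← ENNReal.rpow_natCast, ← ENNReal.rpow_mul,
      show ((1 : ℝ) / 2 * ((2 : ℕ) : ℝ)) = 1 by norm_num, ENNReal.rpow_one]
    unfold sobolevWeightIntegral
    refine lintegral_congr fun ξ => ?_
    rw [Real.rpow_natCast]
    rfl
  -- Plancherel for `f` itself
  have hP0 : ∫⁻ ξ, ‖G ξ‖ₑ ^ 2 = ∫⁻ x, ‖u x‖ₑ ^ 2 := by
    rw [hG, lintegral_enorm_sq_fourier_eq]
    refine lintegral_congr_ae ?_
    filter_upwards [h2.coeFn_toLp] with x hx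
    rw [hx, hf_def, Function.comp_apply, ← ofReal_norm, ← ofReal_norm, norm_complexify]
  -- Plancherel for the coordinate derivatives of order `N`
  have hPi : ∀ i : Fin 3, ∫⁻ ξ, ENNReal.ofReal ((ξ i) ^ (2 * (n + 1))) * ‖G ξ‖ₑ ^ 2 ≤
      ∫⁻ x, ‖iteratedFDeriv ℝ (n + 1) u x‖ₑ ^ 2 := by
    intro i
    set m : EuclideanSpace ℝ (Fin 3) := EuclideanSpace.single i (1 : ℝ) with hm
    have hW := lintegral_weight_pow_mul_enorm_fourier_sq_eq_of_step
      (fun hg m hg2 hd2 => fourier_toLp_fderiv_ae_eq hg m hg2 hd2) hf m (n + 1) hintf h2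
    have hbd := lintegral_iteratedFDeriv_complexify_comp_const_le hu (n + 1) m
    have hnorm1 : ‖(EuclideanSpace.single i (1 : ℝ) : EuclideanSpace ℝ (Fin 3))‖ = 1 := by simp
    rw [hm, ← ofReal_norm, hnorm1, ENNReal.ofReal_one, one_pow, one_mul, ← hm] at hbd
    refine le_trans ?_ (hW.le.trans hbd)
    refine lintegral_mono fun ξ => ?_
    refine mul_le_mul' ?_ le_rfl
    have hinner : ⟪ξ, EuclideanSpace.single i (1 : ℝ)⟫ = ξ i := by
      rw [EuclideanSpace.inner_single_right]; simp
    rw [hinner, ← ofReal_norm, ← ENNReal.ofReal_pow (norm_nonneg _)]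
    refine ENNReal.ofReal_le_ofReal ?_
    rw [norm_pow, norm_mul, Complex.norm_real, Real.norm_eq_abs, ← pow_mul, mul_comm (n + 1) 2,
      mul_pow]
    have h2π : (1 : ℝ) ≤ ‖2 * (Real.pi : ℂ) * Complex.I‖ ^ (2 * (n + 1)) := by
      refine one_le_pow₀ ?_
      rw [norm_mul, norm_mul, Complex.norm_I, mul_one, Complex.norm_ofNat, Complex.norm_real,
        Real.norm_of_nonneg Real.pi_pos.le]
      linarith [Real.two_le_pi]
    calc (ξ i) ^ (2 * (n + 1)) = |ξ i| ^ (2 * (n + 1)) := by rw [pow_mul, pow_mul, sq_abs]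
      _ = 1 * |ξ i| ^ (2 * (n + 1)) := (one_mul _).symm
      _ ≤ ‖2 * (Real.pi : ℂ) * Complex.I‖ ^ (2 * (n + 1)) * |ξ i| ^ (2 * (n + 1)) := by
          gcongr
  -- assemble
  rw [hnorm]
  calc ∫⁻ ξ, ENNReal.ofReal ((1 + ‖ξ‖ ^ 2) ^ (n + 1)) * ‖G ξ‖ₑ ^ 2
      ≤ ∫⁻ ξ, ENNReal.ofReal (2 ^ (n + 1) * (1 + 3 ^ n * ∑ i, (ξ i) ^ (2 * (n + 1)))) * ‖G ξ‖ₑ ^ 2 := by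
        refine lintegral_mono fun ξ => mul_le_mul' (ENNReal.ofReal_le_ofReal (one_add_norm_sq_pow_le n ξ)) le_rfl
    _ = ∫⁻ ξ, (2 ^ (n + 1) * ‖G ξ‖ₑ ^ 2 +
          ∑ i, 2 ^ (n + 1) * 3 ^ n * (ENNReal.ofReal ((ξ i) ^ (2 * (n + 1))) * ‖G ξ‖ₑ ^ 2)) := by
        refine lintegral_congr fun ξ => ?_
        have hnn : ∀ i : Fin 3, 0 ≤ (ξ i) ^ (2 * (n + 1)) := fun i => by
          rw [pow_mul]; exact pow_nonneg (sq_nonneg _) _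
        have hsn : 0 ≤ ∑ i, (ξ i) ^ (2 * (n + 1)) := Finset.sum_nonneg fun i _ => hnn i
        rw [ENNReal.ofReal_mul (by positivity), ENNReal.ofReal_add zero_le_one (by positivity),
          ENNReal.ofReal_one, ENNReal.ofReal_mul (by positivity),
          ENNReal.ofReal_sum_of_nonneg (fun i _ => hnn i), ENNReal.ofReal_pow (by norm_num),
          ENNReal.ofReal_pow (by norm_num), ENNReal.ofReal_ofNat, ENNReal.ofReal_ofNat]
        rw [mul_add, mul_one, add_mul, Finset.mul_sum, Finset.mul_sum, Finset.sum_mul]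
        congr 1
        refine Finset.sum_congr rfl fun i _ => ?_
        ring
    _ = 2 ^ (n + 1) * (∫⁻ ξ, ‖G ξ‖ₑ ^ 2) +
          ∑ i, 2 ^ (n + 1) * 3 ^ n * ∫⁻ ξ, ENNReal.ofReal ((ξ i) ^ (2 * (n + 1))) * ‖G ξ‖ₑ ^ 2 := by
        have hGe : AEMeasurable (fun ξ => ‖G ξ‖ₑ ^ 2) volume := hGm.enorm.pow_const 2
        have hB : ∀ i : Fin 3, AEMeasurable
            (fun ξ : EuclideanSpace ℝ (Fin 3) => ENNReal.ofReal ((ξ i) ^ (2 * (n + 1))) * ‖G ξ‖ₑ ^ 2)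
            volume := fun i =>
          (((EuclideanSpace.proj i).continuous.pow _).measurable.ennreal_ofReal.aemeasurable).mul hGe
        rw [lintegral_add_left' (hGe.const_mul _), lintegral_const_mul'' _ hGe,
          lintegral_finsetSum' _ (fun i _ => (hB i).const_mul _)]
        congr 1
        refine Finset.sum_congr rfl fun i _ => ?_
        rw [lintegral_const_mul'' _ (hB i)]
    _ ≤ 2 ^ (n + 1) * (∫⁻ x, ‖u x‖ₑ ^ 2) +
          ∑ _i : Fin 3, 2 ^ (n + 1) * 3 ^ n * ∫⁻ x, ‖iteratedFDeriv ℝ (n + 1) u x‖ₑ ^ 2 := by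
        rw [hP0]
        refine add_le_add le_rfl (Finset.sum_le_sum fun i _ => ?_)
        exact mul_le_mul_right (hPi i) _
    _ = 2 ^ (n + 1) * ((∫⁻ x, ‖u x‖ₑ ^ 2) + 3 ^ (n + 1) * ∫⁻ x, ‖iteratedFDeriv ℝ (n + 1) u x‖ₑ ^ 2) := by
        rw [Finset.sum_const, Finset.card_univ, Fintype.card_fin, nsmul_eq_mul, pow_succ]
        push_cast
        ring

/-! ### Divergence-free fields are Fourier-divergence-free; `H¹⁰_df` membership -/

/-- The derivative of the complexified field along `m` is the complexification of `Du(x) m`. [folklore]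
[cite: Tao2016AveragedNS, §1.1 (1.3)–(1.5), (1.15) pp. 3–7 (the `H¹⁰_df` mild formulation of the true Navier–Stokes form and its Fourier-side calculus) (source of the NOTION / ARGUMENT this module implements; this declaration is the cell’s own lemma or plumbing, NOT a printed statement)] -/
theorem fderiv_complexify_comp_apply (hu : ContDiff ℝ (⊤ : ℕ∞) u) (x m : EuclideanSpace ℝ (Fin 3)) :
    fderiv ℝ (complexify ∘ u) x m = complexify (fderiv ℝ u x m) := by
  have hd : DifferentiableAt ℝ u x := (hu.differentiable (by simp)).differentiableAt
  have h := (complexify.toContinuousLinearMap.hasFDerivAt.comp x hd.hasFDerivAt).fderiv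
  rw [show (complexify ∘ u) = (⇑complexify.toContinuousLinearMap ∘ u) from rfl, h]
  rfl

/-- The first derivatives of a smooth field with `Du ∈ L²` are in `L²` (complexified). [folklore]
[cite: Tao2016AveragedNS, §1.1 (1.3)–(1.5), (1.15) pp. 3–7 (the `H¹⁰_df` mild formulation of the true Navier–Stokes form and its Fourier-side calculus) (source of the NOTION / ARGUMENT this module implements; this declaration is the cell’s own lemma or plumbing, NOT a printed statement)] -/
theorem memLp_fderiv_complexify_comp (hu : ContDiff ℝ (⊤ : ℕ∞) u)
    (h1 : ∫⁻ x, ‖iteratedFDeriv ℝ 1 u x‖ₑ ^ 2 < ⊤) (m : EuclideanSpace ℝ (Fin 3)) :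
    MemLp (fun x => fderiv ℝ (complexify ∘ u) x m) 2 (volume : Measure (EuclideanSpace ℝ (Fin 3))) := by
  have hf : ContDiff ℝ (⊤ : ℕ∞) (complexify ∘ u) := contDiff_complexify_comp hu
  have h1f : ∫⁻ x, ‖iteratedFDeriv ℝ 1 (complexify ∘ u) x‖ₑ ^ 2 < ⊤ :=
    lt_of_le_of_lt (lintegral_iteratedFDeriv_complexify_comp_le hu 1) h1
  have h := memLp_iteratedFDeriv_const hf h1f m
  refine h.ae_eq (Eventually.of_forall fun x => ?_)
  exact iteratedFDeriv_one_apply (fun _ : Fin 1 => m)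

/-- **Divergence-free fields are Fourier-divergence-free**: for smooth `u : ℝ³ → ℝ³` with
`div u = 0` and `u, Du ∈ L²`, the `L²` class of its complexification satisfies `ξ · û(ξ) = 0`
for a.e. `ξ` (Tao 2016, p. 3: "the divergence-free condition ensures that `û(ξ₁) ∈ ξ₁^⊥` for
(almost) all `ξ₁`"). [cite: Tao2016AveragedNS, §1.1 p. 3] -/
theorem isFourierDivFree_toLp_complexify (hu : ContDiff ℝ (⊤ : ℕ∞) u)
    (hdiv : VectorCalculus.IsDivFree u) (h1 : ∫⁻ x, ‖iteratedFDeriv ℝ 1 u x‖ₑ ^ 2 < ⊤)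
    (h2 : MemLp (complexify ∘ u) 2 (volume : Measure (EuclideanSpace ℝ (Fin 3)))) :
    IsFourierDivFree (h2.toLp _) := by
  set f : EuclideanSpace ℝ (Fin 3) → EuclideanSpace ℂ (Fin 3) := complexify ∘ u with hf_def
  have hf : ContDiff ℝ (⊤ : ℕ∞) f := contDiff_complexify_comp hu
  have hf1 : ContDiff ℝ 1 f := hf.of_le (by exact_mod_cast le_top)
  set e : Fin 3 → EuclideanSpace ℝ (Fin 3) := fun i => EuclideanSpace.single i (1 : ℝ) with he
  have hD : ∀ i, MemLp (fun x => fderiv ℝ f x (e i)) 2 (volume : Measure (EuclideanSpace ℝ (Fin 3))) :=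
    fun i => memLp_fderiv_complexify_comp hu h1 (e i)
  set P : Fin 3 → (EuclideanSpace ℂ (Fin 3) →L[ℂ] ℂ) := fun i => EuclideanSpace.proj i with hP
  set v : Fin 3 → Lp ℂ 2 (volume : Measure (EuclideanSpace ℝ (Fin 3))) :=
    fun i => (P i).compLp ((hD i).toLp _) with hv
  -- the coefficients of the divergence sum to zero
  have hvi : ∀ i, (v i : EuclideanSpace ℝ (Fin 3) → ℂ) =ᵐ[volume] fun x => ((fderiv ℝ u x (e i) i : ℝ) : ℂ) := by
    intro i
    filter_upwards [ContinuousLinearMap.coeFn_compLp (P i) ((hD i).toLp _), (hD i).coeFn_toLp] with x hx hx'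
    rw [hv]
    dsimp only
    rw [hx, hx', hP]
    dsimp only
    rw [hf_def, fderiv_complexify_comp_apply hu]
    simp only [PiLp.proj_apply, complexify_apply]
  have hsum : v 0 + v 1 + v 2 = 0 := by
    refine Lp.eq_zero_iff_ae_eq_zero.2 ?_
    filter_upwards [Lp.coeFn_add (v 0 + v 1) (v 2), Lp.coeFn_add (v 0) (v 1), hvi 0, hvi 1, hvi 2]
      with x h01_2 h0_1 h0 h1' h2'
    rw [h01_2, Pi.add_apply, h0_1, Pi.add_apply, h0, h1', h2', Pi.zero_apply]
    have hx := hdiv x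
    rw [divergence_eq_sum_inner_fderiv (EuclideanSpace.basisFun (Fin 3) ℝ), Fin.sum_univ_three] at hx
    simp only [EuclideanSpace.basisFun_apply, EuclideanSpace.inner_single_left, map_one, one_mul] at hx
    exact_mod_cast hx
  -- apply the Fourier transform
  have hFsum : (𝓕 (v 0) : Lp ℂ 2 (volume : Measure (EuclideanSpace ℝ (Fin 3)))) + 𝓕 (v 1) + 𝓕 (v 2) = 0 := by
    rw [← FourierTransform.fourier_add, ← FourierTransform.fourier_add, hsum, FourierTransform.fourier_zero]
  have hC : ∀ i, ((𝓕 (v i) : Lp ℂ 2 (volume : Measure (EuclideanSpace ℝ (Fin 3)))) :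
      EuclideanSpace ℝ (Fin 3) → ℂ) =ᵐ[volume]
        fun ξ => (2 * Real.pi * Complex.I) * ((ξ i : ℝ) : ℂ) * fourierFn (h2.toLp f) ξ i := by
    intro i
    filter_upwards [fourier_compLp_ae_eq (P i) ((hD i).toLp _),
      fourier_toLp_fderiv_ae_eq hf1 (e i) h2 (hD i)] with ξ hξ hξ'
    rw [hv]
    dsimp only
    rw [hξ, hξ', hP]
    dsimp only
    have hinner : ∀ (η : EuclideanSpace ℝ (Fin 3)) (j : Fin 3), ⟪η, EuclideanSpace.single j (1 : ℝ)⟫ = η j :=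
      fun η j => by rw [EuclideanSpace.inner_single_right]; simp
    simp only [PiLp.proj_apply, PiLp.smul_apply, smul_eq_mul, he, hinner]
    rfl
  unfold IsFourierDivFree
  filter_upwards [Lp.coeFn_add ((𝓕 (v 0) : Lp ℂ 2 (volume : Measure (EuclideanSpace ℝ (Fin 3)))) + 𝓕 (v 1))
      (𝓕 (v 2)), Lp.coeFn_add (𝓕 (v 0) : Lp ℂ 2 (volume : Measure (EuclideanSpace ℝ (Fin 3)))) (𝓕 (v 1)),
    hC 0, hC 1, hC 2,
    Lp.coeFn_zero ℂ 2 (volume : Measure (EuclideanSpace ℝ (Fin 3))),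
    (Lp.ext_iff.1 hFsum)] with ξ h01_2 h0_1 h0 h1' h2' hz hF
  rw [h01_2, Pi.add_apply, h0_1, Pi.add_apply, h0, h1', h2', hz, Pi.zero_apply] at hF
  have h2πI : (2 * Real.pi * Complex.I : ℂ) ≠ 0 := by
    simp [Real.pi_ne_zero, Complex.I_ne_zero]
  unfold cdot
  rw [Fin.sum_univ_three, complexify_apply, complexify_apply, complexify_apply]
  have : (2 * Real.pi * Complex.I) * (((ξ 0 : ℝ) : ℂ) * fourierFn (h2.toLp f) ξ 0 +
      ((ξ 1 : ℝ) : ℂ) * fourierFn (h2.toLp f) ξ 1 + ((ξ 2 : ℝ) : ℂ) * fourierFn (h2.toLp f) ξ 2) = 0 := by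
    rw [← hF]; ring
  exact (mul_eq_zero.1 this).resolve_left h2πI

/-- The `L²` class of a real field is real. [folklore]
[cite: Tao2016AveragedNS, §1.1 (1.3)–(1.5), (1.15) pp. 3–7 (the `H¹⁰_df` mild formulation of the true Navier–Stokes form and its Fourier-side calculus) (source of the NOTION / ARGUMENT this module implements; this declaration is the cell’s own lemma or plumbing, NOT a printed statement)] -/
theorem isReal_toLp_complexify (h2 : MemLp (complexify ∘ u) 2 (volume : Measure (EuclideanSpace ℝ (Fin 3)))) :
    IsReal (h2.toLp _) := by
  unfold IsReal
  filter_upwards [h2.coeFn_toLp] with x hx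
  intro i
  rw [hx, Function.comp_apply, complexify_apply, Complex.ofReal_im]

/-- **`H¹⁰_df` membership of smooth divergence-free `H¹⁰` fields**: for smooth `u : ℝ³ → ℝ³` with
`div u = 0` and `u, Du, …, D¹⁰u ∈ L²`, the `L²` class of its complexification lies in Tao's
`H¹⁰_df(ℝ³)` (`MemH10df`). [cite: Tao2016AveragedNS, §1.1 p. 3] -/
theorem memH10df_toLp_complexify (hu : ContDiff ℝ (⊤ : ℕ∞) u) (hdiv : VectorCalculus.IsDivFree u)
    (hint : ∀ j ≤ 10, ∫⁻ x, ‖iteratedFDeriv ℝ j u x‖ₑ ^ 2 < ⊤)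
    (h2 : MemLp (complexify ∘ u) 2 (volume : Measure (EuclideanSpace ℝ (Fin 3)))) :
    MemH10df (h2.toLp _) := by
  refine ⟨?_, isReal_toLp_complexify h2, isFourierDivFree_toLp_complexify hu hdiv (hint 1 (by norm_num)) h2⟩
  have h := eFourierSobolevNorm_sq_le hu 9 hint h2
  have h0 : ∫⁻ x, ‖u x‖ₑ ^ 2 < ⊤ := by
    have h0' := hint 0 (by norm_num)
    have he : ∀ x, ‖iteratedFDeriv ℝ 0 u x‖ₑ = ‖u x‖ₑ := fun x => by
      rw [← ofReal_norm, norm_iteratedFDeriv_zero, ofReal_norm]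
    simp_rw [he] at h0'
    exact h0'
  have hfin : eFourierSobolevNorm ((9 : ℕ) + 1 : ℕ) (h2.toLp _) ^ 2 < ⊤ := by
    refine lt_of_le_of_lt h ?_
    refine ENNReal.mul_lt_top (ENNReal.pow_lt_top (by simp)) ?_
    exact ENNReal.add_lt_top.2 ⟨h0, ENNReal.mul_lt_top (ENNReal.pow_lt_top (by simp)) (hint 10 le_rfl)⟩
  have hfin' : eFourierSobolevNorm ((9 : ℕ) + 1 : ℕ) (h2.toLp _) < ⊤ := by
    by_contra hc
    rw [not_lt, top_le_iff] at hc
    rw [hc] at hfin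
    simp at hfin
  convert hfin' using 2
  norm_num

end R3
end Literature.Analysis.PerpetualPump.PerpetualPumpEulerTypeIGlue

end Part3

/-!
## Part 4 — port of `Summits/NavierStokesRegularity/NavierStokesRegularity/Theorems/PerpetualPumpEulerTypeIGlueMemH10.lean` (2 declarations kept)

# Route PerpetualPump · `EulerTypeIGlue` — stub `stub_memH10` (line `Sketch`)

`H¹⁰_df` membership of the slices of the complexified curve of a classical Leray–Hopf solution:
if `(u, p)` is a classical solution of the unforced Navier–Stokes system (viscosity `ν > 0`) on
`[0, T) × ℝ³`, Leray–Hopf from its rapidly decaying datum `u 0`, and `U t ∈ L²(ℝ³; ℂ³)` is any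
`L²` class with `⇑(U t) = (u t)^ℂ` a.e. for `t ∈ [0, T)`, then `U t ∈ H¹⁰_df(ℝ³)` (Tao's
`MemH10df`: `‖·‖_{H¹⁰} < ∞`, real, Fourier-divergence-free) for every `t ∈ [0, T)`.

Proof: for `t ∈ [0, T)` restrict `u` to the closed slab `[0, T₁]`, `T₁ = (t + T)/2 ∈ (t, T)`;
there the energy is bounded by the initial energy (`IsLerayHopfOn.lintegral_enorm_sq_le`,
Leray 1934, (5.2)), so Tao's slab theorem (`tao2011_hasBoundedSobolevNormsOn_holds`; Tao 2013,
arXiv:1108.1165, Cor. 11.1 + Cor. 4.3 + Thm. 5.4 (iv), a theorem of the tree) bounds all spatial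
`L²` Sobolev norms of `u t`; `u t` is smooth and divergence free (classical solution), and
`(u t)^ℂ ∈ L²` (`IsLerayHopfOn.memLp`), so the landed `memH10df_toLp_complexify` gives
`[(u t)^ℂ] ∈ H¹⁰_df`; finally `U t = [(u t)^ℂ]` as `L²` classes.

## References

* T. Tao, J. Amer. Math. Soc. 29 (2016), arXiv:1402.0290v3, §1.1 p. 3 (`H¹⁰_df`). [Tao2016AveragedNS]
* T. Tao, Anal. PDE 6 (2013), arXiv:1108.1165, Cor. 11.1 + Cor. 4.3 + Thm. 5.4 (iv). [Tao2011]
-/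

section Part4

open _root_.MeasureTheory _root_.Set _root_.Filter _root_.Topology FourierTransform
open scoped _root_.ENNReal _root_.NNReal RealInnerProductSpace SchwartzMap _root_.ContDiff

namespace Literature.Analysis.PerpetualPump.PerpetualPumpEulerTypeIGlue

open Literature.Analysis.FluidPDE Literature.Analysis.FluidPDE.Tao2016
open Literature.Analysis.FunctionSpaces (eFourierSobolevNorm)
open Literature.Analysis.FunctionSpaces.EuclideanSpace (complexify complexify_apply norm_complexify
  continuous_complexify)

/-- **All spatial Sobolev norms of a slice are finite**: for a classical unforced solution
`(u, p)` on `[0, T) × ℝ³` (viscosity `ν > 0`) which is Leray–Hopf from its rapidly decaying datum,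
`∫ ‖Dʲ(u t)‖² < ∞` for every `j` and every `t ∈ [0, T)` (Tao's slab theorem on the closed slab
`[0, (t + T)/2]`, where the energy is bounded by the initial energy).
[cite: Tao2011, Cor. 11.1 + Cor. 4.3 + Thm. 5.4 (iv)] -/
theorem lintegral_enorm_iteratedFDeriv_sq_lt_top_of_classical_lerayHopf {ν T : ℝ} (hν : 0 < ν)
    {u : ℝ → (EuclideanSpace ℝ (Fin 3)) → (EuclideanSpace ℝ (Fin 3))} {p : ℝ → (EuclideanSpace ℝ (Fin 3)) → ℝ} (hcl : IsClassicalNSSolutionOn (Ico 0 T) ν 0 u p)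
    (hLH : IsLerayHopfOn T ν 0 (u 0) u) (hdec : HasRapidSpatialDecay (u 0)) {t : ℝ}
    (ht : t ∈ Ico 0 T) (j : ℕ) : ∫⁻ x, ‖iteratedFDeriv ℝ j (u t) x‖ₑ ^ 2 < ⊤ := by
  -- the closed slab `[0, T₁]`, `t < T₁ < T`
  set T₁ : ℝ := (t + T) / 2 with hT₁_def
  have htT₁ : t < T₁ := by rw [hT₁_def]; linarith [ht.2]
  have hT₁T : T₁ < T := by rw [hT₁_def]; linarith [ht.2]
  have hT₁pos : 0 < T₁ := lt_of_le_of_lt ht.1 htT₁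
  have hsol₁ : IsClassicalNSSolutionOn (Icc 0 T₁) ν 0 u p :=
    hcl.mono (Icc_subset_Ico_right hT₁T) (uniqueDiffOn_Icc hT₁pos)
  -- energy bounded by the initial energy on `[0, T₁] ⊆ [0, T]`
  have hEn : ∃ C : ℝ≥0, ∀ s ∈ Icc 0 T₁, ∫⁻ x, ‖u s x‖ₑ ^ 2 ≤ C :=
    ⟨(2 * VectorCalculus.kineticEnergy (u 0)).toNNReal, fun s hs =>
      hLH.lintegral_enorm_sq_le hν.le ⟨hs.1, hs.2.trans hT₁T.le⟩⟩
  -- Tao 2011, Cor. 11.1: all Sobolev norms bounded on the closed slab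
  have hH : HasBoundedSobolevNormsOn (Icc 0 T₁) u :=
    tao2011_hasBoundedSobolevNormsOn_holds hν hT₁pos hsol₁ hEn hdec
  obtain ⟨C, hC⟩ := hH j
  exact (hC t ⟨ht.1, htT₁.le⟩).trans_lt ENNReal.coe_lt_top

/-- **S4 — `H¹⁰_df` membership of the slices**: for a classical unforced solution `(u, p)` on
`[0, T) × ℝ³` (viscosity `ν > 0`), Leray–Hopf from its rapidly decaying datum, and any
`U : ℝ → L²(ℝ³; ℂ³)` with `⇑(U t) = (u t)^ℂ` a.e. for `t ∈ [0, T)`, every slice `U t`,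
`t ∈ [0, T)`, lies in Tao's class `H¹⁰_df(ℝ³)` (slab Sobolev bounds
`tao2011_hasBoundedSobolevNormsOn_holds` + the landed `memH10df_toLp_complexify`).
[cite: Tao2016AveragedNS, §1.1 p. 3] -/
theorem stub_memH10 {ν T : ℝ} (hν : 0 < ν) {u : ℝ → (EuclideanSpace ℝ (Fin 3)) → (EuclideanSpace ℝ (Fin 3))} {p : ℝ → (EuclideanSpace ℝ (Fin 3)) → ℝ}
    (hcl : IsClassicalNSSolutionOn (Ico 0 T) ν 0 u p) (hLH : IsLerayHopfOn T ν 0 (u 0) u)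
    (hdec : HasRapidSpatialDecay (u 0)) (U : ℝ → L2C)
    (hU : ∀ t ∈ Ico 0 T, ((U t : L2C) : (EuclideanSpace ℝ (Fin 3)) → (EuclideanSpace ℂ (Fin 3))) =ᵐ[volume] complexify ∘ u t) :
    ∀ t ∈ Ico 0 T, MemH10df (U t) := by
  intro t ht
  have hint : ∀ j ≤ 10, ∫⁻ x, ‖iteratedFDeriv ℝ j (u t) x‖ₑ ^ 2 < ⊤ := fun j _ =>
    lintegral_enorm_iteratedFDeriv_sq_lt_top_of_classical_lerayHopf hν hcl hLH hdec ht j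
  have h2 : MemLp (complexify ∘ u t) 2 (volume : Measure (EuclideanSpace ℝ (Fin 3))) :=
    memLp_complexify_of_memLp (hLH.memLp t ⟨ht.1, ht.2.le⟩)
  have hmem : MemH10df (h2.toLp _) :=
    memH10df_toLp_complexify (hcl.contDiff_velocity ht) (hcl.divFree t ht) hint h2
  have hUt : U t = h2.toLp _ := Lp.ext ((hU t ht).trans h2.coeFn_toLp.symm)
  rw [hUt]
  exact hmem

end Literature.Analysis.PerpetualPump.PerpetualPumpEulerTypeIGlue

end Part4

/-!
## Part 5 — port of `Summits/NavierStokesRegularity/NavierStokesRegularity/Theorems/PerpetualPumpEulerTypeIGlueContinuity.lean` (7 declarations kept)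

# Route PerpetualPump · `EulerTypeIGlue` — stub `stub_continuity` (line `Sketch`)

For a classical Leray–Hopf solution `u` on `[0,T)` (from its rapidly decaying datum `u 0`) and
the curve `U t = [(u t)^ℂ] ∈ L²(ℝ³;ℂ³)` of its complexified slices, `U ∈ C([0,T); H¹⁰)` in Tao's
sense (`ContinuousInH10On (Ico 0 T) U`).  No time derivative of the `L²` classes is used; the
proof is an interpolation on each closed slab `[0,T₁]`, `T₁ = (t₀+T)/2`:

* `u ∈ C([0,T₁]; L²)` (`continuousInLpOn_two_of_tao_local`, Tao 2013 Thm. 5.4 + weak–strong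
  uniqueness, PROVED in the tree), and `‖U t - U t₀‖_{L²} = ‖u t - u t₀‖_{L²}`;
* `sup_{[0,T₁]} ‖U t‖_{H²⁰} < ∞`: all Sobolev norms of `u` are bounded on the closed slab
  (`tao2011_hasBoundedSobolevNormsOn_holds`, Tao 2013 Cor. 11.1) and the physical → Fourier
  transfer `eFourierSobolevNorm_sq_le` (toolkit `SobolevR3`);
* the Fourier-side Cauchy–Schwarz interpolation `‖g‖²_{H¹⁰} ≤ ‖g‖_{L²} ‖g‖_{H²⁰}`
  (`eFourierSobolevNorm_ten_sq_le_enorm_mul`), whence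
  `‖U t - U t₀‖_{H¹⁰} ≤ (2B ‖u t - u t₀‖_{L²})^{1/2} → 0` within `[0,T₁]`;
* localisation `𝓝[Ico 0 T] t₀ ≤ 𝓝[Icc 0 T₁] t₀` (as in `continuousInLpOn_of_forall_Icc`).

## References

* T. Tao, *Localisation and compactness properties of the Navier–Stokes global regularity
  problem*, Anal. PDE 6 (2013), arXiv:1108.1165, Cor. 11.1, Thm. 5.4 (iv). [Tao2011]
* T. Tao, J. Amer. Math. Soc. 29 (2016), arXiv:1402.0290v3, §1.1 (1.15) (continuity into
  `H¹⁰_df`). [Tao2016AveragedNS]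
-/

section Part5

open _root_.MeasureTheory _root_.Set _root_.Filter _root_.Topology FourierTransform
open scoped _root_.ENNReal _root_.NNReal RealInnerProductSpace SchwartzMap _root_.ContDiff

namespace Literature.Analysis.PerpetualPump.PerpetualPumpEulerTypeIGlue

open Literature.Analysis.FluidPDE Literature.Analysis.FluidPDE.Tao2016
open Literature.Analysis.FunctionSpaces (eFourierSobolevNorm)
open Literature.Analysis.FunctionSpaces.EuclideanSpace (complexify complexify_apply norm_complexify
  continuous_complexify)

/-! ### Fourier-side interpolation `‖g‖²_{H¹⁰} ≤ ‖g‖_{L²} ‖g‖_{H²⁰}` -/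

/-- The square of the Sobolev weight of order `10` is the weight of order `20`. [folklore]
[cite: Tao2016AveragedNS, §1.1 (1.3)–(1.5), (1.15) pp. 3–7 (the `H¹⁰_df` mild formulation of the true Navier–Stokes form and its Fourier-side calculus) (source of the NOTION / ARGUMENT this module implements; this declaration is the cell’s own lemma or plumbing, NOT a printed statement)] -/
theorem sobolevWeight_ten_sq {w : ℝ} (hw : 0 ≤ w) : (w ^ (10 : ℝ)) ^ 2 = w ^ (20 : ℝ) := by
  rw [← Real.rpow_natCast, ← Real.rpow_mul hw]
  norm_num

/-- `‖g‖²_{H^s}` is the weighted integral `∫ (1+|ξ|²)^s |ĝ|²`. [folklore]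
[cite: Tao2016AveragedNS, §1.1 (1.3)–(1.5), (1.15) pp. 3–7 (the `H¹⁰_df` mild formulation of the true Navier–Stokes form and its Fourier-side calculus) (source of the NOTION / ARGUMENT this module implements; this declaration is the cell’s own lemma or plumbing, NOT a printed statement)] -/
theorem eFourierSobolevNorm_sq_eq_sobolevWeightIntegral (s : ℝ) (g : L2C) :
    eFourierSobolevNorm s g ^ 2 = sobolevWeightIntegral s (fourierFn g) := by
  rw [eFourierSobolevNorm_eq, ← ENNReal.rpow_natCast, ← ENNReal.rpow_mul]
  norm_num

/-- `x = (x²)^{1/2}` in `ℝ≥0∞`. [folklore]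
[cite: Tao2016AveragedNS, §1.1 (1.3)–(1.5), (1.15) pp. 3–7 (the `H¹⁰_df` mild formulation of the true Navier–Stokes form and its Fourier-side calculus) (source of the NOTION / ARGUMENT this module implements; this declaration is the cell’s own lemma or plumbing, NOT a printed statement)] -/
theorem ennreal_eq_sq_rpow_half (x : ℝ≥0∞) : x = (x ^ 2) ^ (1 / 2 : ℝ) := by
  rw [← ENNReal.rpow_natCast, ← ENNReal.rpow_mul]
  norm_num

/-- **Fourier-side interpolation** `‖g‖²_{H¹⁰} ≤ ‖g‖_{L²} ‖g‖_{H²⁰}` for `g ∈ L²(ℝ³;ℂ³)`: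
Cauchy–Schwarz for the splitting `(1+|ξ|²)^{10}|ĝ|² = |ĝ| · ((1+|ξ|²)^{10}|ĝ|)` and Plancherel
`‖g‖²_{L²} = ∫ |ĝ|²`. [folklore]
[cite: Tao2016AveragedNS, §1.1 (1.3)–(1.5), (1.15) pp. 3–7 (the `H¹⁰_df` mild formulation of the true Navier–Stokes form and its Fourier-side calculus) (source of the NOTION / ARGUMENT this module implements; this declaration is the cell’s own lemma or plumbing, NOT a printed statement)] -/
theorem eFourierSobolevNorm_ten_sq_le_enorm_mul (g : L2C) :
    eFourierSobolevNorm 10 g ^ 2 ≤ ‖g‖ₑ * eFourierSobolevNorm 20 g := by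
  have hGm : AEMeasurable (fun ξ => ‖fourierFn g ξ‖ₑ) volume :=
    (aestronglyMeasurable_fourierFn g).enorm
  have hWm : AEMeasurable
      (fun ξ : (EuclideanSpace ℝ (Fin 3)) => ENNReal.ofReal ((1 + ‖ξ‖ ^ 2) ^ (10 : ℝ)) * ‖fourierFn g ξ‖ₑ) volume :=
    (measurable_sobolevWeight 10).aemeasurable.mul hGm
  have hH := ENNReal.lintegral_mul_le_Lp_mul_Lq volume Real.HolderConjugate.two_two hGm hWm
  simp only [Pi.mul_apply, ENNReal.rpow_two] at hH
  rw [eFourierSobolevNorm_sq_eq_sobolevWeightIntegral]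
  unfold sobolevWeightIntegral
  calc ∫⁻ ξ, ENNReal.ofReal ((1 + ‖ξ‖ ^ 2) ^ (10 : ℝ)) * ‖fourierFn g ξ‖ₑ ^ 2
      = ∫⁻ ξ, ‖fourierFn g ξ‖ₑ * (ENNReal.ofReal ((1 + ‖ξ‖ ^ 2) ^ (10 : ℝ)) * ‖fourierFn g ξ‖ₑ) :=
        lintegral_congr fun ξ => by ring
    _ ≤ (∫⁻ ξ, ‖fourierFn g ξ‖ₑ ^ 2) ^ (1 / 2 : ℝ) *
          (∫⁻ ξ, (ENNReal.ofReal ((1 + ‖ξ‖ ^ 2) ^ (10 : ℝ)) * ‖fourierFn g ξ‖ₑ) ^ 2) ^ (1 / 2 : ℝ) :=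
        hH
    _ = ‖g‖ₑ * eFourierSobolevNorm 20 g := by
        congr 1
        · rw [← enorm_sq_eq_lintegral_fourierFn]
          exact (ennreal_eq_sq_rpow_half _).symm
        · rw [eFourierSobolevNorm_eq]
          unfold sobolevWeightIntegral
          congr 1
          refine lintegral_congr fun ξ => ?_
          rw [mul_pow, ← ENNReal.ofReal_pow (by positivity), sobolevWeight_ten_sq (by positivity)]

/-! ### Uniform `H²⁰` bound of the complexified slices on a slab -/

/-- **Uniform `H²⁰` bound on a slab**: if all Sobolev norms of the smooth slices `u t`, `t ∈ S`,
are bounded (`HasBoundedSobolevNormsOn S u`) and `⇑(U t) = (u t)^ℂ` a.e., then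
`sup_{t ∈ S} ‖U t‖_{H²⁰} < ∞` (physical → Fourier transfer `eFourierSobolevNorm_sq_le` with
`N = 20`). [cite: Tao2011, Cor. 11.1 + Thm. 5.4 (iv)] -/
theorem exists_eFourierSobolevNorm_twenty_le {S : Set ℝ} {u : ℝ → (EuclideanSpace ℝ (Fin 3)) → (EuclideanSpace ℝ (Fin 3))} {U : ℝ → L2C}
    (hH : HasBoundedSobolevNormsOn S u) (hsm : ∀ t ∈ S, ContDiff ℝ (⊤ : ℕ∞) (u t))
    (hU : ∀ t ∈ S, ((U t : L2C) : (EuclideanSpace ℝ (Fin 3)) → (EuclideanSpace ℂ (Fin 3))) =ᵐ[volume] complexify ∘ u t) :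
    ∃ B : ℝ≥0∞, B ≠ ⊤ ∧ ∀ t ∈ S, eFourierSobolevNorm 20 (U t) ≤ B := by
  obtain ⟨C₀, hC₀⟩ := hH 0
  obtain ⟨C₂₀, hC₂₀⟩ := hH 20
  refine ⟨(2 ^ 20 * ((C₀ : ℝ≥0∞) + 3 ^ 20 * C₂₀)) ^ (1 / 2 : ℝ),
    ENNReal.rpow_ne_top_of_nonneg (by norm_num) (ENNReal.mul_ne_top (by simp)
      (ENNReal.add_ne_top.2 ⟨ENNReal.coe_ne_top, ENNReal.mul_ne_top (by simp) ENNReal.coe_ne_top⟩)),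
    fun t ht => ?_⟩
  have hint : ∀ j, ∫⁻ x, ‖iteratedFDeriv ℝ j (u t) x‖ₑ ^ 2 < ⊤ := fun j => by
    obtain ⟨C, hC⟩ := hH j
    exact (hC t ht).trans_lt ENNReal.coe_lt_top
  have h2 : MemLp (complexify ∘ u t) 2 (volume : Measure (EuclideanSpace ℝ (Fin 3))) := (Lp.memLp (U t)).ae_eq (hU t ht)
  have hUeq : U t = h2.toLp _ := Lp.ext ((hU t ht).trans h2.coeFn_toLp.symm)
  have h := eFourierSobolevNorm_sq_le (hsm t ht) 19 (fun j _ => hint j) h2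
  simp only [Nat.reduceAdd, Nat.cast_ofNat] at h
  have h0 : ∫⁻ x, ‖u t x‖ₑ ^ 2 ≤ C₀ := by
    refine (le_of_eq (lintegral_congr fun x => ?_)).trans (hC₀ t ht)
    rw [← ofReal_norm, ← norm_iteratedFDeriv_zero (𝕜 := ℝ) (f := u t), ofReal_norm]
  have hsq : eFourierSobolevNorm 20 (U t) ^ 2 ≤ 2 ^ 20 * ((C₀ : ℝ≥0∞) + 3 ^ 20 * C₂₀) := by
    rw [hUeq]
    exact h.trans (mul_le_mul_right (add_le_add h0 (mul_le_mul_right (hC₂₀ t ht) _)) _)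
  calc eFourierSobolevNorm 20 (U t) = (eFourierSobolevNorm 20 (U t) ^ 2) ^ (1 / 2 : ℝ) :=
        ennreal_eq_sq_rpow_half _
    _ ≤ _ := ENNReal.rpow_le_rpow hsq (by norm_num)

/-! ### The `L²` distance of the complexified classes -/

/-- `‖[v^ℂ] - [w^ℂ]‖_{L²(ℝ³;ℂ³)} = ‖v - w‖_{L²(ℝ³;ℝ³)}` (complexification is an `ℝ`-linear
isometry). [folklore]
[cite: Tao2016AveragedNS, §1.1 (1.3)–(1.5), (1.15) pp. 3–7 (the `H¹⁰_df` mild formulation of the true Navier–Stokes form and its Fourier-side calculus) (source of the NOTION / ARGUMENT this module implements; this declaration is the cell’s own lemma or plumbing, NOT a printed statement)] -/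
theorem enorm_sub_eq_eLpNorm_sub_of_ae_eq_complexify {V W : L2C} {v w : (EuclideanSpace ℝ (Fin 3)) → (EuclideanSpace ℝ (Fin 3))}
    (hV : ((V : L2C) : (EuclideanSpace ℝ (Fin 3)) → (EuclideanSpace ℂ (Fin 3))) =ᵐ[volume] complexify ∘ v)
    (hW : ((W : L2C) : (EuclideanSpace ℝ (Fin 3)) → (EuclideanSpace ℂ (Fin 3))) =ᵐ[volume] complexify ∘ w) :
    ‖V - W‖ₑ = eLpNorm (v - w) 2 volume := by
  rw [Lp.enorm_def]
  refine eLpNorm_congr_norm_ae ?_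
  filter_upwards [Lp.coeFn_sub V W, hV, hW] with x hx h1 h2
  rw [hx, Pi.sub_apply, h1, h2, Function.comp_apply, Function.comp_apply, ← complexify.map_sub,
    norm_complexify, Pi.sub_apply]

/-! ### The stub -/

/-- **S5 — continuity of `t ↦ U t` in `H¹⁰` on `[0,T)`** for the complexified curve
`U t = [(u t)^ℂ]` of a classical Leray–Hopf solution from a rapidly decaying datum: Fourier-side
interpolation `‖g‖²_{H¹⁰} ≤ ‖g‖_{L²} ‖g‖_{H²⁰}` between the slab facts `u ∈ C([0,T₁]; L²)`
(`continuousInLpOn_two_of_tao_local`) and `u ∈ L^∞([0,T₁]; H²⁰)`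
(`tao2011_hasBoundedSobolevNormsOn_holds`, `eFourierSobolevNorm_sq_le`), `T₁ = (t₀+T)/2`.
[cite: Tao2011, Cor. 11.1 + Thm. 5.4 (iv)] -/
theorem stub_continuity {ν T : ℝ} (hν : 0 < ν) (hT : 0 < T) {u : ℝ → (EuclideanSpace ℝ (Fin 3)) → (EuclideanSpace ℝ (Fin 3))} {p : ℝ → (EuclideanSpace ℝ (Fin 3)) → ℝ}
    (hcl : IsClassicalNSSolutionOn (Ico 0 T) ν 0 u p) (hLH : IsLerayHopfOn T ν 0 (u 0) u)
    (hdec : HasRapidSpatialDecay (u 0)) (U : ℝ → L2C)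
    (hU : ∀ t ∈ Ico 0 T, ((U t : L2C) : (EuclideanSpace ℝ (Fin 3)) → (EuclideanSpace ℂ (Fin 3))) =ᵐ[volume] complexify ∘ u t) :
    ContinuousInH10On (Ico 0 T) U := by
  intro t₀ ht₀
  -- the closed slab `[0, T₁]`, `t₀ < T₁ < T`
  set T₁ : ℝ := (t₀ + T) / 2 with hT₁def
  have hT₁ : T₁ ∈ Ioo 0 T :=
    ⟨by rw [hT₁def]; linarith [ht₀.1, ht₀.2], by rw [hT₁def]; linarith [ht₀.2]⟩
  have ht₀T₁ : t₀ < T₁ := by rw [hT₁def]; linarith [ht₀.2]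
  have hsub : Icc 0 T₁ ⊆ Ico 0 T := Icc_subset_Ico_right hT₁.2
  have ht₀' : t₀ ∈ Icc 0 T₁ := ⟨ht₀.1, ht₀T₁.le⟩
  -- (a) `L²` continuity on the slab
  have hL2 : ContinuousInLpOn (Icc 0 T₁) 2 u :=
    continuousInLpOn_two_of_tao_local tao2011_smooth_local_existence_holds
      tao2011_hasBoundedSobolevNormsOn_holds hν hT hcl hLH hdec T₁ hT₁
  -- (b) all Sobolev norms are bounded on the slab; uniform `H²⁰` bound of `U`
  have hcl₁ : IsClassicalNSSolutionOn (Icc 0 T₁) ν 0 u p :=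
    hcl.mono hsub (uniqueDiffOn_Icc hT₁.1)
  have hEn : ∃ C : ℝ≥0∞, C < ⊤ ∧ ∀ t ∈ Icc 0 T₁, ∫⁻ x, ‖u t x‖ₑ ^ 2 ≤ C :=
    ⟨ENNReal.ofReal (2 * VectorCalculus.kineticEnergy (u 0)), ENNReal.ofReal_lt_top, fun t ht =>
      hLH.lintegral_enorm_sq_le hν.le ⟨ht.1, ht.2.trans hT₁.2.le⟩⟩
  have hH : HasBoundedSobolevNormsOn (Icc 0 T₁) u :=
    (tao2011_hasBoundedSobolevNormsOn.closedSlab tao2011_hasBoundedSobolevNormsOn_holds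
      linfty_bound_of_hasBoundedSobolevNormsOn_holds ν T₁ hν hT₁.1 u p hcl₁ hEn hdec).1
  obtain ⟨B, hBtop, hB⟩ := exists_eFourierSobolevNorm_twenty_le hH
    (fun t ht => hcl₁.contDiff_velocity ht) (fun t ht => hU t (hsub ht))
  -- (c) interpolation: `‖U t - U t₀‖_{H¹⁰} ≤ (2B ‖u t - u t₀‖_{L²})^{1/2}` on the slab
  have hbd : ∀ t ∈ Icc 0 T₁, eFourierSobolevNorm 10 (U t - U t₀) ≤
      ((B + B) * eLpNorm (u t - u t₀) 2 volume) ^ (1 / 2 : ℝ) := by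
    intro t ht
    have h20 : eFourierSobolevNorm 20 (U t - U t₀) ≤ B + B := by
      calc eFourierSobolevNorm 20 (U t - U t₀)
          ≤ eFourierSobolevNorm 20 (U t) + eFourierSobolevNorm 20 (-U t₀) := by
            rw [sub_eq_add_neg]
            exact eFourierSobolevNorm_add_le _ _ _
        _ = eFourierSobolevNorm 20 (U t) + eFourierSobolevNorm 20 (U t₀) := by
            rw [eFourierSobolevNorm_neg]
        _ ≤ B + B := add_le_add (hB t ht) (hB t₀ ht₀')
    have hsq : eFourierSobolevNorm 10 (U t - U t₀) ^ 2 ≤ (B + B) * eLpNorm (u t - u t₀) 2 volume := by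
      calc eFourierSobolevNorm 10 (U t - U t₀) ^ 2
          ≤ ‖U t - U t₀‖ₑ * eFourierSobolevNorm 20 (U t - U t₀) :=
            eFourierSobolevNorm_ten_sq_le_enorm_mul _
        _ ≤ ‖U t - U t₀‖ₑ * (B + B) := mul_le_mul_right h20 _
        _ = (B + B) * eLpNorm (u t - u t₀) 2 volume := by
            rw [enorm_sub_eq_eLpNorm_sub_of_ae_eq_complexify (hU t (hsub ht)) (hU t₀ (hsub ht₀')),
              mul_comm]
    calc eFourierSobolevNorm 10 (U t - U t₀)
        = (eFourierSobolevNorm 10 (U t - U t₀) ^ 2) ^ (1 / 2 : ℝ) := ennreal_eq_sq_rpow_half _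
      _ ≤ _ := ENNReal.rpow_le_rpow hsq (by norm_num)
  -- (d) the limit within the slab
  have hlim : Tendsto (fun t => ((B + B) * eLpNorm (u t - u t₀) 2 volume) ^ (1 / 2 : ℝ))
      (𝓝[Icc 0 T₁] t₀) (𝓝 0) := by
    have h3 : Tendsto (fun t => (B + B) * eLpNorm (u t - u t₀) 2 volume) (𝓝[Icc 0 T₁] t₀) (𝓝 0) := by
      have h := ENNReal.Tendsto.const_mul (a := B + B) (hL2.2 t₀ ht₀')
        (Or.inr (ENNReal.add_ne_top.2 ⟨hBtop, hBtop⟩))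
      rwa [mul_zero] at h
    have h4 := ((ENNReal.continuous_rpow_const (y := 1 / 2)).tendsto 0).comp h3
    rwa [ENNReal.zero_rpow_of_pos (by norm_num)] at h4
  have hslab : Tendsto (fun t => eFourierSobolevNorm 10 (U t - U t₀)) (𝓝[Icc 0 T₁] t₀) (𝓝 0) := by
    refine tendsto_of_tendsto_of_tendsto_of_le_of_le' tendsto_const_nhds hlim
      (Eventually.of_forall fun _ => bot_le) ?_
    filter_upwards [self_mem_nhdsWithin] with t ht using hbd t ht
  -- (e) localise: `𝓝[Ico 0 T] t₀ ≤ 𝓝[Icc 0 T₁] t₀`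
  refine hslab.mono_left ?_
  have hmem : Iio T₁ ∈ 𝓝[Ico 0 T] t₀ := mem_nhdsWithin_of_mem_nhds (Iio_mem_nhds ht₀T₁)
  rw [← nhdsWithin_inter_of_mem hmem]
  exact nhdsWithin_mono _ fun t ht => ⟨ht.2.1, (mem_Iio.1 ht.1).le⟩

end Literature.Analysis.PerpetualPump.PerpetualPumpEulerTypeIGlue

end Part5

/-!
## Part 6 — port of `Summits/NavierStokesRegularity/NavierStokesRegularity/Theorems/PerpetualPumpThesisBilinearOperatorWeighted.lean` (21 declarations kept)

# Stub B (`bilinearOperator`) for `PerpetualPump.Thesis`, part I: the weighted trilinear estimate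

Support file (part 1 of the stub `bilinearOperator` of line `SketchIdeator2`, crux
stmt-NavierStokesRegularity-1832). The analytic heart of the statement "Tao's averaged operator
`B̃` is an honest bilinear operator `H¹⁰_df × H¹⁰_df → H⁹_df`" (T. Tao, J. Amer. Math. Soc. 29
(2016), arXiv:1402.0290v3, §1.1 (1.14): the averaged operators obey the same Sobolev bounds as
`B`, which loses one derivative) is the **`H¹⁰ × H¹⁰ × H⁻⁹` bound for the Euler form (1.3)**

  `|⟨B(u,v), w⟩| ≤ π · 2¹⁰ · C_emb · ‖u‖_{H¹⁰} ‖v‖_{H¹⁰} ‖w‖_{H⁻⁹}`,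
  `C_emb = (∫_{ℝ³} (1+|ξ|²)^{-10})^{1/2}` (`enorm_eulerForm_le_weighted`),

the negative-order companion of the tree's `L²` bound `enorm_eulerForm_le`
(`TaoAveragedEulerFormBound.lean`), on which its proof is modelled: pointwise
`|Λ_{ξ₁,ξ₂}(X₁,X₂,X₃)| ≤ (|ξ₁|+|ξ₂|)|X₁||X₂||X₃|` and the elementary weight inequality
`(|ξ₁|+|ξ₂|) ⟨ξ₁+ξ₂⟩⁹ ≤ 2⁹ (⟨ξ₁⟩¹⁰ + ⟨ξ₂⟩¹⁰)` (`⟨ξ⟩ = √(1+|ξ|²)`, `weight_ineq`), then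
Tonelli and Cauchy–Schwarz in the inner variable
`∫∫ a(ξ₁) b(ξ₂) c(ξ₁+ξ₂) ≤ ‖a‖_{L¹} ‖b‖_{L²} ‖c‖_{L²}` with `b = ⟨ξ⟩¹⁰|f̂|`, `c = ⟨ξ⟩⁻⁹|ĥ|` and
`‖f̂‖_{L¹} ≤ C_emb ‖f‖_{H¹⁰}` (tree: `lintegral_enorm_le_sobolevWeight`).

The Japanese bracket is written `√(1 + ‖ξ‖ ^ 2)` throughout; the `ℝ≥0∞` weights are
`ENNReal.ofReal (√(1 + ‖ξ‖ ^ 2) ^ 10)` (high) and `ENNReal.ofReal ((√(1 + ‖ξ‖ ^ 2))⁻¹ ^ 9)` (low).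

## References

* T. Tao, J. Amer. Math. Soc. 29 (2016), 601–674, arXiv:1402.0290v3, §1.1 (1.3)–(1.4), (1.14).

Not carried from this source module (not needed by the declarations re-homed here; their consumers are Summits-side): `stub_bilinearOperator_W`.
-/

section Part6

open _root_.MeasureTheory _root_.Set _root_.Filter _root_.Topology FourierTransform _root_.Complex
open scoped _root_.ENNReal _root_.NNReal

namespace Literature.Analysis.PerpetualPump.PerpetualPumpThesis.B

open Literature.Analysis.FluidPDE Literature.Analysis.FluidPDE.Tao2016
open Literature.Analysis.FunctionSpaces (eFourierSobolevNorm)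

/-! ### The Japanese bracket `⟨ξ⟩ = √(1+|ξ|²)` -/

/-- `⟨ξ⟩² = 1 + |ξ|²`.
[cite: Tao2016AveragedNS, §1.1 (1.15) p. 7 (local well-posedness of `H¹⁰_df` mild solutions: the bilinear Duhamel operator, uniqueness) (source of the NOTION / ARGUMENT this module implements; this declaration is the cell’s own lemma or plumbing, NOT a printed statement)] -/
theorem jb_sq (ξ : EuclideanSpace ℝ (Fin 3)) : √(1 + ‖ξ‖ ^ 2) ^ 2 = 1 + ‖ξ‖ ^ 2 :=
  Real.sq_sqrt (by positivity)

/-- `⟨ξ⟩ > 0`.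
[cite: Tao2016AveragedNS, §1.1 (1.15) p. 7 (local well-posedness of `H¹⁰_df` mild solutions: the bilinear Duhamel operator, uniqueness) (source of the NOTION / ARGUMENT this module implements; this declaration is the cell’s own lemma or plumbing, NOT a printed statement)] -/
theorem jb_pos (ξ : EuclideanSpace ℝ (Fin 3)) : 0 < √(1 + ‖ξ‖ ^ 2) :=
  Real.sqrt_pos.2 (by positivity)

/-- `|ξ| ≤ ⟨ξ⟩`.
[cite: Tao2016AveragedNS, §1.1 (1.15) p. 7 (local well-posedness of `H¹⁰_df` mild solutions: the bilinear Duhamel operator, uniqueness) (source of the NOTION / ARGUMENT this module implements; this declaration is the cell’s own lemma or plumbing, NOT a printed statement)] -/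
theorem norm_le_jb (ξ : EuclideanSpace ℝ (Fin 3)) : ‖ξ‖ ≤ √(1 + ‖ξ‖ ^ 2) := by
  rw [Real.le_sqrt (norm_nonneg _) (by positivity)]
  linarith

/-- The Japanese bracket is subadditive: `⟨ξ + η⟩ ≤ ⟨ξ⟩ + ⟨η⟩`.
[cite: Tao2016AveragedNS, §1.1 (1.15) p. 7 (local well-posedness of `H¹⁰_df` mild solutions: the bilinear Duhamel operator, uniqueness) (source of the NOTION / ARGUMENT this module implements; this declaration is the cell’s own lemma or plumbing, NOT a printed statement)] -/
theorem jb_add_le (ξ η : EuclideanSpace ℝ (Fin 3)) :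
    √(1 + ‖ξ + η‖ ^ 2) ≤ √(1 + ‖ξ‖ ^ 2) + √(1 + ‖η‖ ^ 2) := by
  have ha := jb_pos ξ
  have hb := jb_pos η
  have ha2 := jb_sq ξ
  have hb2 := jb_sq η
  have h1 : ‖ξ + η‖ ≤ ‖ξ‖ + ‖η‖ := norm_add_le ξ η
  have h2 : ‖ξ‖ * ‖η‖ ≤ √(1 + ‖ξ‖ ^ 2) * √(1 + ‖η‖ ^ 2) :=
    mul_le_mul (norm_le_jb ξ) (norm_le_jb η) (norm_nonneg _) ha.le
  rw [Real.sqrt_le_iff]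
  refine ⟨by positivity, ?_⟩
  nlinarith [mul_self_le_mul_self (norm_nonneg _) h1, norm_nonneg ξ, norm_nonneg η]

/-- The Japanese bracket is continuous.
[cite: Tao2016AveragedNS, §1.1 (1.15) p. 7 (local well-posedness of `H¹⁰_df` mild solutions: the bilinear Duhamel operator, uniqueness) (source of the NOTION / ARGUMENT this module implements; this declaration is the cell’s own lemma or plumbing, NOT a printed statement)] -/
theorem continuous_jb : Continuous fun ξ : EuclideanSpace ℝ (Fin 3) => √(1 + ‖ξ‖ ^ 2) := by
  fun_prop

/-- **The weight inequality** behind the one-derivative loss of `B`: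
`(|ξ₁| + |ξ₂|) ⟨ξ₁+ξ₂⟩⁹ ≤ 2⁹ (⟨ξ₁⟩¹⁰ + ⟨ξ₂⟩¹⁰)`.
[cite: Tao2016AveragedNS, §1.1 (1.15) p. 7 (local well-posedness of `H¹⁰_df` mild solutions: the bilinear Duhamel operator, uniqueness) (source of the NOTION / ARGUMENT this module implements; this declaration is the cell’s own lemma or plumbing, NOT a printed statement)] -/
theorem weight_ineq (ξ₁ ξ₂ : EuclideanSpace ℝ (Fin 3)) :
    (‖ξ₁‖ + ‖ξ₂‖) * √(1 + ‖ξ₁ + ξ₂‖ ^ 2) ^ 9 ≤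
      2 ^ 9 * (√(1 + ‖ξ₁‖ ^ 2) ^ 10 + √(1 + ‖ξ₂‖ ^ 2) ^ 10) := by
  have ha := jb_pos ξ₁
  have hb := jb_pos ξ₂
  have h1 : ‖ξ₁‖ + ‖ξ₂‖ ≤ √(1 + ‖ξ₁‖ ^ 2) + √(1 + ‖ξ₂‖ ^ 2) :=
    add_le_add (norm_le_jb ξ₁) (norm_le_jb ξ₂)
  have h2 : √(1 + ‖ξ₁ + ξ₂‖ ^ 2) ^ 9 ≤ (√(1 + ‖ξ₁‖ ^ 2) + √(1 + ‖ξ₂‖ ^ 2)) ^ 9 :=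
    pow_le_pow_left₀ (jb_pos _).le (jb_add_le ξ₁ ξ₂) 9
  have h3 := add_pow_le ha.le hb.le 10
  calc (‖ξ₁‖ + ‖ξ₂‖) * √(1 + ‖ξ₁ + ξ₂‖ ^ 2) ^ 9
      ≤ (√(1 + ‖ξ₁‖ ^ 2) + √(1 + ‖ξ₂‖ ^ 2)) * (√(1 + ‖ξ₁‖ ^ 2) + √(1 + ‖ξ₂‖ ^ 2)) ^ 9 :=
        mul_le_mul h1 h2 (by positivity) (by positivity)
    _ = (√(1 + ‖ξ₁‖ ^ 2) + √(1 + ‖ξ₂‖ ^ 2)) ^ 10 := by ring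
    _ ≤ 2 ^ (10 - 1) * (√(1 + ‖ξ₁‖ ^ 2) ^ 10 + √(1 + ‖ξ₂‖ ^ 2) ^ 10) := h3
    _ = 2 ^ 9 * (√(1 + ‖ξ₁‖ ^ 2) ^ 10 + √(1 + ‖ξ₂‖ ^ 2) ^ 10) := by norm_num

/-! ### The weighted pointwise bound for `Λ` -/

/-- **Weighted pointwise bound for Tao's symbol (1.4)**:
`|Λ_{ξ₁,ξ₂}(X₁,X₂,X₃)| ≤ 2⁹ (⟨ξ₁⟩¹⁰|X₁||X₂| + |X₁|⟨ξ₂⟩¹⁰|X₂|) · ⟨ξ₃⟩⁻⁹|X₃|`, `ξ₃ = -ξ₁-ξ₂`.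
[cite: Tao2016AveragedNS, §1.1 (1.15) p. 7 (local well-posedness of `H¹⁰_df` mild solutions: the bilinear Duhamel operator, uniqueness) (source of the NOTION / ARGUMENT this module implements; this declaration is the cell’s own lemma or plumbing, NOT a printed statement)] -/
theorem norm_Λ_le_weighted (ξ₁ ξ₂ : EuclideanSpace ℝ (Fin 3)) (X₁ X₂ X₃ : EuclideanSpace ℂ (Fin 3)) :
    ‖Λ ξ₁ ξ₂ X₁ X₂ X₃‖ ≤
      2 ^ 9 * ((√(1 + ‖ξ₁‖ ^ 2) ^ 10 * ‖X₁‖) * ‖X₂‖ + ‖X₁‖ * (√(1 + ‖ξ₂‖ ^ 2) ^ 10 * ‖X₂‖)) *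
        ((√(1 + ‖-ξ₁ - ξ₂‖ ^ 2))⁻¹ ^ 9 * ‖X₃‖) := by
  have hc : √(1 + ‖-ξ₁ - ξ₂‖ ^ 2) = √(1 + ‖ξ₁ + ξ₂‖ ^ 2) := by
    rw [show -ξ₁ - ξ₂ = -(ξ₁ + ξ₂) by abel, norm_neg]
  have hcpos : 0 < √(1 + ‖-ξ₁ - ξ₂‖ ^ 2) := jb_pos _
  have key : ‖ξ₁‖ + ‖ξ₂‖ ≤ 2 ^ 9 * (√(1 + ‖ξ₁‖ ^ 2) ^ 10 + √(1 + ‖ξ₂‖ ^ 2) ^ 10) *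
      (√(1 + ‖-ξ₁ - ξ₂‖ ^ 2))⁻¹ ^ 9 := by
    rw [inv_pow, ← div_eq_mul_inv, le_div_iff₀ (pow_pos hcpos 9), hc]
    exact weight_ineq ξ₁ ξ₂
  calc ‖Λ ξ₁ ξ₂ X₁ X₂ X₃‖
      ≤ ‖X₁‖ * ‖ξ₂‖ * (‖X₂‖ * ‖X₃‖) + ‖X₂‖ * ‖ξ₁‖ * (‖X₁‖ * ‖X₃‖) := norm_Λ_le ξ₁ ξ₂ X₁ X₂ X₃
    _ = (‖ξ₁‖ + ‖ξ₂‖) * (‖X₁‖ * ‖X₂‖ * ‖X₃‖) := by ring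
    _ ≤ (2 ^ 9 * (√(1 + ‖ξ₁‖ ^ 2) ^ 10 + √(1 + ‖ξ₂‖ ^ 2) ^ 10) *
          (√(1 + ‖-ξ₁ - ξ₂‖ ^ 2))⁻¹ ^ 9) * (‖X₁‖ * ‖X₂‖ * ‖X₃‖) :=
        mul_le_mul_of_nonneg_right key (by positivity)
    _ = _ := by ring

/-- `(⟨ξ⟩¹⁰)² = (1+|ξ|²)¹⁰`: the square of the high weight is the `H¹⁰` weight.
[cite: Tao2016AveragedNS, §1.1 (1.15) p. 7 (local well-posedness of `H¹⁰_df` mild solutions: the bilinear Duhamel operator, uniqueness) (source of the NOTION / ARGUMENT this module implements; this declaration is the cell’s own lemma or plumbing, NOT a printed statement)] -/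
theorem wHi_sq (ξ : EuclideanSpace ℝ (Fin 3)) :
    ENNReal.ofReal (√(1 + ‖ξ‖ ^ 2) ^ 10) ^ 2 = ENNReal.ofReal ((1 + ‖ξ‖ ^ 2) ^ (10 : ℝ)) := by
  rw [← ENNReal.ofReal_pow (by positivity), ← pow_mul, show 10 * 2 = 2 * 10 by norm_num, pow_mul,
    jb_sq, show (10 : ℝ) = ((10 : ℕ) : ℝ) by norm_num, Real.rpow_natCast]

/-- `(⟨ξ⟩⁻⁹)² = (1+|ξ|²)⁻⁹`: the square of the low weight is the `H⁻⁹` weight.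
[cite: Tao2016AveragedNS, §1.1 (1.15) p. 7 (local well-posedness of `H¹⁰_df` mild solutions: the bilinear Duhamel operator, uniqueness) (source of the NOTION / ARGUMENT this module implements; this declaration is the cell’s own lemma or plumbing, NOT a printed statement)] -/
theorem wLo_sq (ξ : EuclideanSpace ℝ (Fin 3)) :
    ENNReal.ofReal ((√(1 + ‖ξ‖ ^ 2))⁻¹ ^ 9) ^ 2 = ENNReal.ofReal ((1 + ‖ξ‖ ^ 2) ^ (-9 : ℝ)) := by
  have h0 : (0 : ℝ) ≤ 1 + ‖ξ‖ ^ 2 := by positivity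
  rw [← ENNReal.ofReal_pow (by positivity), ← pow_mul, show 9 * 2 = 2 * 9 by norm_num, pow_mul,
    inv_pow, jb_sq, Real.rpow_neg h0, show (9 : ℝ) = ((9 : ℕ) : ℝ) by norm_num, Real.rpow_natCast,
    inv_pow]

/-- The high weight is measurable.
[cite: Tao2016AveragedNS, §1.1 (1.15) p. 7 (local well-posedness of `H¹⁰_df` mild solutions: the bilinear Duhamel operator, uniqueness) (source of the NOTION / ARGUMENT this module implements; this declaration is the cell’s own lemma or plumbing, NOT a printed statement)] -/
theorem measurable_wHi :
    Measurable fun ξ : EuclideanSpace ℝ (Fin 3) => ENNReal.ofReal (√(1 + ‖ξ‖ ^ 2) ^ 10) :=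
  ((continuous_jb.pow 10).measurable).ennreal_ofReal

/-- The low weight is measurable.
[cite: Tao2016AveragedNS, §1.1 (1.15) p. 7 (local well-posedness of `H¹⁰_df` mild solutions: the bilinear Duhamel operator, uniqueness) (source of the NOTION / ARGUMENT this module implements; this declaration is the cell’s own lemma or plumbing, NOT a printed statement)] -/
theorem measurable_wLo :
    Measurable fun ξ : EuclideanSpace ℝ (Fin 3) => ENNReal.ofReal ((√(1 + ‖ξ‖ ^ 2))⁻¹ ^ 9) :=
  ((continuous_jb.inv₀ fun ξ => (jb_pos ξ).ne').pow 9).measurable.ennreal_ofReal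

/-- **Weighted pointwise bound for `Λ` in `ℝ≥0∞`**:
`‖Λ‖ₑ ≤ 2⁹ (⟨ξ₁⟩¹⁰‖X₁‖ ‖X₂‖ + ‖X₁‖ ⟨ξ₂⟩¹⁰‖X₂‖) · (⟨ξ₃⟩⁻⁹ ‖X₃‖)`.
[cite: Tao2016AveragedNS, §1.1 (1.15) p. 7 (local well-posedness of `H¹⁰_df` mild solutions: the bilinear Duhamel operator, uniqueness) (source of the NOTION / ARGUMENT this module implements; this declaration is the cell’s own lemma or plumbing, NOT a printed statement)] -/
theorem enorm_Λ_le_weighted (ξ₁ ξ₂ : EuclideanSpace ℝ (Fin 3)) (X₁ X₂ X₃ : EuclideanSpace ℂ (Fin 3)) :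
    ‖Λ ξ₁ ξ₂ X₁ X₂ X₃‖ₑ ≤
      2 ^ 9 * ((ENNReal.ofReal (√(1 + ‖ξ₁‖ ^ 2) ^ 10) * ‖X₁‖ₑ) * ‖X₂‖ₑ +
          ‖X₁‖ₑ * (ENNReal.ofReal (√(1 + ‖ξ₂‖ ^ 2) ^ 10) * ‖X₂‖ₑ)) *
        (ENNReal.ofReal ((√(1 + ‖-ξ₁ - ξ₂‖ ^ 2))⁻¹ ^ 9) * ‖X₃‖ₑ) := by
  rw [← ofReal_norm (Λ ξ₁ ξ₂ X₁ X₂ X₃)]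
  refine (ENNReal.ofReal_le_ofReal (norm_Λ_le_weighted ξ₁ ξ₂ X₁ X₂ X₃)).trans_eq ?_
  rw [ENNReal.ofReal_mul (by positivity), ENNReal.ofReal_mul (by positivity),
    ENNReal.ofReal_add (by positivity) (by positivity), ENNReal.ofReal_mul (by positivity),
    ENNReal.ofReal_mul (by positivity), ENNReal.ofReal_mul (by positivity),
    ENNReal.ofReal_mul (by positivity), ENNReal.ofReal_mul (by positivity),
    ENNReal.ofReal_pow (by norm_num), ENNReal.ofReal_ofNat, ofReal_norm, ofReal_norm, ofReal_norm]

/-! ### The weighted trilinear estimate -/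

/-- **Cauchy–Schwarz in the inner variable** for `ℝ≥0∞`-valued densities:
`∫ A(ξ) B(c - ξ) dξ ≤ (∫ A²)^{1/2} (∫ B²)^{1/2}` (the substitution `ξ ↦ c - ξ` preserves
Lebesgue measure).
[cite: Tao2016AveragedNS, §1.1 (1.15) p. 7 (local well-posedness of `H¹⁰_df` mild solutions: the bilinear Duhamel operator, uniqueness) (source of the NOTION / ARGUMENT this module implements; this declaration is the cell’s own lemma or plumbing, NOT a printed statement)] -/
theorem lintegral_mul_comp_sub_le {A B : EuclideanSpace ℝ (Fin 3) → ℝ≥0∞} (hA : AEMeasurable A volume)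
    (hB : AEMeasurable B volume) (c : EuclideanSpace ℝ (Fin 3)) :
    ∫⁻ ξ, A ξ * B (c - ξ) ≤ (∫⁻ ξ, A ξ ^ 2) ^ (1 / 2 : ℝ) * (∫⁻ ξ, B ξ ^ 2) ^ (1 / 2 : ℝ) := by
  have hmp : MeasurePreserving (fun ξ : EuclideanSpace ℝ (Fin 3) => c - ξ) volume volume :=
    Measure.measurePreserving_sub_left volume c
  have hB' : AEMeasurable (fun ξ => B (c - ξ)) volume :=
    hB.comp_quasiMeasurePreserving hmp.quasiMeasurePreserving
  calc ∫⁻ ξ, A ξ * B (c - ξ)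
      ≤ (∫⁻ ξ, A ξ ^ (2 : ℝ)) ^ (1 / (2 : ℝ)) * (∫⁻ ξ, B (c - ξ) ^ (2 : ℝ)) ^ (1 / (2 : ℝ)) :=
        ENNReal.lintegral_mul_le_Lp_mul_Lq volume Real.HolderConjugate.two_two hA hB'
    _ = (∫⁻ ξ, A ξ ^ 2) ^ (1 / 2 : ℝ) * (∫⁻ ξ, B ξ ^ 2) ^ (1 / 2 : ℝ) := by
        rw [lintegral_sub_left_eq_self (fun ξ => B ξ ^ (2 : ℝ)) c]
        simp only [ENNReal.rpow_two]

/-- **The weighted trilinear estimate for the Euler form (1.3)**: for measurable fields `f, g, h`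
on frequency space,
`∫∫ |Λ(f(ξ₁), g(ξ₂), h(-ξ₁-ξ₂))| ≤ 2⁹ (‖g‖₁ ‖⟨ξ⟩¹⁰f‖₂ + ‖f‖₁ ‖⟨ξ⟩¹⁰g‖₂) ‖⟨ξ⟩⁻⁹h‖₂`
(Tonelli, Cauchy–Schwarz in the inner variable, translation invariance).
[cite: Tao2016AveragedNS, §1.1 (1.15) p. 7 (local well-posedness of `H¹⁰_df` mild solutions: the bilinear Duhamel operator, uniqueness) (source of the NOTION / ARGUMENT this module implements; this declaration is the cell’s own lemma or plumbing, NOT a printed statement)] -/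
theorem lintegral_enorm_Λ_le_weighted {f g h : EuclideanSpace ℝ (Fin 3) → EuclideanSpace ℂ (Fin 3)}
    (hf : AEStronglyMeasurable f volume) (hg : AEStronglyMeasurable g volume)
    (hh : AEStronglyMeasurable h volume) :
    ∫⁻ p : EuclideanSpace ℝ (Fin 3) × EuclideanSpace ℝ (Fin 3),
        ‖Λ p.1 p.2 (f p.1) (g p.2) (h (-p.1 - p.2))‖ₑ ≤
      2 ^ 9 * ((∫⁻ ξ, ‖g ξ‖ₑ) *
            (∫⁻ ξ, (ENNReal.ofReal (√(1 + ‖ξ‖ ^ 2) ^ 10) * ‖f ξ‖ₑ) ^ 2) ^ (1 / 2 : ℝ) +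
          (∫⁻ ξ, ‖f ξ‖ₑ) *
            (∫⁻ ξ, (ENNReal.ofReal (√(1 + ‖ξ‖ ^ 2) ^ 10) * ‖g ξ‖ₑ) ^ 2) ^ (1 / 2 : ℝ)) *
        (∫⁻ ξ, (ENNReal.ofReal ((√(1 + ‖ξ‖ ^ 2))⁻¹ ^ 9) * ‖h ξ‖ₑ) ^ 2) ^ (1 / 2 : ℝ) := by
  rw [Measure.volume_eq_prod]
  set μ : Measure (EuclideanSpace ℝ (Fin 3)) := volume with hμ
  -- the weighted densities
  set F : EuclideanSpace ℝ (Fin 3) → ℝ≥0∞ :=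
    fun ξ => ENNReal.ofReal (√(1 + ‖ξ‖ ^ 2) ^ 10) * ‖f ξ‖ₑ with hFdef
  set G : EuclideanSpace ℝ (Fin 3) → ℝ≥0∞ :=
    fun ξ => ENNReal.ofReal (√(1 + ‖ξ‖ ^ 2) ^ 10) * ‖g ξ‖ₑ with hGdef
  set H : EuclideanSpace ℝ (Fin 3) → ℝ≥0∞ :=
    fun ξ => ENNReal.ofReal ((√(1 + ‖ξ‖ ^ 2))⁻¹ ^ 9) * ‖h ξ‖ₑ with hHdef
  have hFm : AEMeasurable F μ := measurable_wHi.aemeasurable.mul hf.enorm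
  have hGm : AEMeasurable G μ := measurable_wHi.aemeasurable.mul hg.enorm
  have hHm : AEMeasurable H μ := measurable_wLo.aemeasurable.mul hh.enorm
  -- measurability of the pieces on the product space
  have hf1 : AEMeasurable (fun p : EuclideanSpace ℝ (Fin 3) × EuclideanSpace ℝ (Fin 3) => ‖f p.1‖ₑ)
      (μ.prod μ) :=
    (hf.comp_quasiMeasurePreserving Measure.quasiMeasurePreserving_fst).enorm
  have hg2 : AEMeasurable (fun p : EuclideanSpace ℝ (Fin 3) × EuclideanSpace ℝ (Fin 3) => ‖g p.2‖ₑ)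
      (μ.prod μ) :=
    (hg.comp_quasiMeasurePreserving Measure.quasiMeasurePreserving_snd).enorm
  have hF1 : AEMeasurable (fun p : EuclideanSpace ℝ (Fin 3) × EuclideanSpace ℝ (Fin 3) => F p.1)
      (μ.prod μ) :=
    hFm.comp_quasiMeasurePreserving Measure.quasiMeasurePreserving_fst
  have hG2 : AEMeasurable (fun p : EuclideanSpace ℝ (Fin 3) × EuclideanSpace ℝ (Fin 3) => G p.2)
      (μ.prod μ) :=
    hGm.comp_quasiMeasurePreserving Measure.quasiMeasurePreserving_snd
  have hH3 : AEMeasurable (fun p : EuclideanSpace ℝ (Fin 3) × EuclideanSpace ℝ (Fin 3) =>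
      H (-p.1 - p.2)) (μ.prod μ) :=
    hHm.comp_quasiMeasurePreserving quasiMeasurePreserving_neg_fst_sub_snd
  -- the two Tonelli terms
  set T₁ : EuclideanSpace ℝ (Fin 3) × EuclideanSpace ℝ (Fin 3) → ℝ≥0∞ :=
    fun p => 2 ^ 9 * (‖g p.2‖ₑ * (F p.1 * H (-p.1 - p.2))) with hT₁
  set T₂ : EuclideanSpace ℝ (Fin 3) × EuclideanSpace ℝ (Fin 3) → ℝ≥0∞ :=
    fun p => 2 ^ 9 * (‖f p.1‖ₑ * (G p.2 * H (-p.1 - p.2))) with hT₂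
  have hT₁m : AEMeasurable T₁ (μ.prod μ) := (hg2.mul (hF1.mul hH3)).const_mul _
  have hT₂m : AEMeasurable T₂ (μ.prod μ) := (hf1.mul (hG2.mul hH3)).const_mul _
  set WF : ℝ≥0∞ := (∫⁻ ξ, F ξ ^ 2 ∂μ) ^ (1 / 2 : ℝ) with hWF
  set WG : ℝ≥0∞ := (∫⁻ ξ, G ξ ^ 2 ∂μ) ^ (1 / 2 : ℝ) with hWG
  set WH : ℝ≥0∞ := (∫⁻ ξ, H ξ ^ 2 ∂μ) ^ (1 / 2 : ℝ) with hWH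
  have h29 : (2 : ℝ≥0∞) ^ 9 ≠ ∞ := ENNReal.pow_ne_top ENNReal.ofNat_ne_top
  -- first term: integrate `ξ₁` inside
  have h1 : ∫⁻ p, T₁ p ∂(μ.prod μ) ≤ 2 ^ 9 * ((∫⁻ ξ, ‖g ξ‖ₑ ∂μ) * (WF * WH)) := by
    rw [lintegral_prod_symm _ hT₁m]
    calc ∫⁻ ξ₂, ∫⁻ ξ₁, T₁ (ξ₁, ξ₂) ∂μ ∂μ
        = ∫⁻ ξ₂, 2 ^ 9 * (‖g ξ₂‖ₑ * ∫⁻ ξ₁, F ξ₁ * H (-ξ₂ - ξ₁) ∂μ) ∂μ := by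
          refine lintegral_congr fun ξ₂ => ?_
          simp only [hT₁]
          rw [lintegral_const_mul' _ _ h29, lintegral_const_mul' _ _ enorm_ne_top]
          congr 2
          refine lintegral_congr fun ξ₁ => ?_
          rw [show -ξ₁ - ξ₂ = -ξ₂ - ξ₁ by abel]
      _ ≤ ∫⁻ ξ₂, 2 ^ 9 * (‖g ξ₂‖ₑ * (WF * WH)) ∂μ := by
          refine lintegral_mono fun ξ₂ => mul_le_mul' le_rfl (mul_le_mul' le_rfl ?_)
          exact lintegral_mul_comp_sub_le hFm hHm (-ξ₂)
      _ = 2 ^ 9 * ((∫⁻ ξ, ‖g ξ‖ₑ ∂μ) * (WF * WH)) := by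
          rw [lintegral_const_mul' _ _ h29, lintegral_mul_const'' _ hg.enorm]
  -- second term: integrate `ξ₂` inside
  have h2 : ∫⁻ p, T₂ p ∂(μ.prod μ) ≤ 2 ^ 9 * ((∫⁻ ξ, ‖f ξ‖ₑ ∂μ) * (WG * WH)) := by
    rw [lintegral_prod _ hT₂m]
    calc ∫⁻ ξ₁, ∫⁻ ξ₂, T₂ (ξ₁, ξ₂) ∂μ ∂μ
        = ∫⁻ ξ₁, 2 ^ 9 * (‖f ξ₁‖ₑ * ∫⁻ ξ₂, G ξ₂ * H (-ξ₁ - ξ₂) ∂μ) ∂μ := by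
          refine lintegral_congr fun ξ₁ => ?_
          simp only [hT₂]
          rw [lintegral_const_mul' _ _ h29, lintegral_const_mul' _ _ enorm_ne_top]
      _ ≤ ∫⁻ ξ₁, 2 ^ 9 * (‖f ξ₁‖ₑ * (WG * WH)) ∂μ := by
          refine lintegral_mono fun ξ₁ => mul_le_mul' le_rfl (mul_le_mul' le_rfl ?_)
          exact lintegral_mul_comp_sub_le hGm hHm (-ξ₁)
      _ = 2 ^ 9 * ((∫⁻ ξ, ‖f ξ‖ₑ ∂μ) * (WG * WH)) := by
          rw [lintegral_const_mul' _ _ h29, lintegral_mul_const'' _ hf.enorm]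
  calc ∫⁻ p, ‖Λ p.1 p.2 (f p.1) (g p.2) (h (-p.1 - p.2))‖ₑ ∂(μ.prod μ)
      ≤ ∫⁻ p, (T₁ p + T₂ p) ∂(μ.prod μ) := by
        refine lintegral_mono fun p => ?_
        rw [hT₁, hT₂]
        convert enorm_Λ_le_weighted p.1 p.2 (f p.1) (g p.2) (h (-p.1 - p.2)) using 1
        simp only [hFdef, hGdef, hHdef]
        ring
    _ = ∫⁻ p, T₁ p ∂(μ.prod μ) + ∫⁻ p, T₂ p ∂(μ.prod μ) := lintegral_add_left' hT₁m _
    _ ≤ 2 ^ 9 * ((∫⁻ ξ, ‖g ξ‖ₑ ∂μ) * (WF * WH)) + 2 ^ 9 * ((∫⁻ ξ, ‖f ξ‖ₑ ∂μ) * (WG * WH)) :=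
        add_le_add h1 h2
    _ = _ := by ring

/-! ### Specialisation to Fourier transforms: `H¹⁰ × H¹⁰ × H⁻⁹` -/

/-- The embedding constant `C_emb = (∫_{ℝ³} (1+|ξ|²)^{-10} dξ)^{1/2}` of `H¹⁰(ℝ³) ⊂ 𝓕L¹` is finite.
[cite: Tao2016AveragedNS, §1.1 (1.15) p. 7 (local well-posedness of `H¹⁰_df` mild solutions: the bilinear Duhamel operator, uniqueness) (source of the NOTION / ARGUMENT this module implements; this declaration is the cell’s own lemma or plumbing, NOT a printed statement)] -/
theorem Cemb_lt_top :
    (∫⁻ ξ : EuclideanSpace ℝ (Fin 3), ENNReal.ofReal ((1 + ‖ξ‖ ^ 2) ^ (-10 : ℝ))) ^ (1 / 2 : ℝ) < ∞ :=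
  ENNReal.rpow_lt_top_of_nonneg (by norm_num) lintegral_inv_sobolevWeight_lt_top.ne

/-- `‖⟨ξ⟩¹⁰ ĝ‖²_{L²} = ∫ (1+|ξ|²)¹⁰ |ĝ|²`: the high-weight `L²` norm is the `H¹⁰` integral.
[cite: Tao2016AveragedNS, §1.1 (1.15) p. 7 (local well-posedness of `H¹⁰_df` mild solutions: the bilinear Duhamel operator, uniqueness) (source of the NOTION / ARGUMENT this module implements; this declaration is the cell’s own lemma or plumbing, NOT a printed statement)] -/
theorem lintegral_wHi_mul_sq (g : EuclideanSpace ℝ (Fin 3) → EuclideanSpace ℂ (Fin 3)) :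
    ∫⁻ ξ, (ENNReal.ofReal (√(1 + ‖ξ‖ ^ 2) ^ 10) * ‖g ξ‖ₑ) ^ 2 = sobolevWeightIntegral 10 g := by
  unfold sobolevWeightIntegral
  refine lintegral_congr fun ξ => ?_
  rw [mul_pow, wHi_sq]

/-- `‖⟨ξ⟩⁻⁹ ĝ‖²_{L²} = ∫ (1+|ξ|²)⁻⁹ |ĝ|²`: the low-weight `L²` norm is the `H⁻⁹` integral.
[cite: Tao2016AveragedNS, §1.1 (1.15) p. 7 (local well-posedness of `H¹⁰_df` mild solutions: the bilinear Duhamel operator, uniqueness) (source of the NOTION / ARGUMENT this module implements; this declaration is the cell’s own lemma or plumbing, NOT a printed statement)] -/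
theorem lintegral_wLo_mul_sq (g : EuclideanSpace ℝ (Fin 3) → EuclideanSpace ℂ (Fin 3)) :
    ∫⁻ ξ, (ENNReal.ofReal ((√(1 + ‖ξ‖ ^ 2))⁻¹ ^ 9) * ‖g ξ‖ₑ) ^ 2 = sobolevWeightIntegral (-9) g := by
  unfold sobolevWeightIntegral
  refine lintegral_congr fun ξ => ?_
  rw [mul_pow, wLo_sq]

/-- **Absolute convergence of (1.3) against `H⁻⁹` test fields**: for `u, v, w ∈ L²`,
`∫∫ |Λ(û(ξ₁), v̂(ξ₂), ŵ(-ξ₁-ξ₂))| ≤ 2⁹ · 2 C_emb ‖u‖_{H¹⁰} ‖v‖_{H¹⁰} ‖w‖_{H⁻⁹}`.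
[cite: Tao2016AveragedNS, §1.1 (1.15) p. 7 (local well-posedness of `H¹⁰_df` mild solutions: the bilinear Duhamel operator, uniqueness) (source of the NOTION / ARGUMENT this module implements; this declaration is the cell’s own lemma or plumbing, NOT a printed statement)] -/
theorem lintegral_enorm_Λ_fourierFn_le_weighted (u v w : L2C) :
    ∫⁻ p : EuclideanSpace ℝ (Fin 3) × EuclideanSpace ℝ (Fin 3),
        ‖Λ p.1 p.2 (fourierFn u p.1) (fourierFn v p.2) (fourierFn w (-p.1 - p.2))‖ₑ ≤
      2 ^ 9 * (2 * (∫⁻ ξ : EuclideanSpace ℝ (Fin 3),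
          ENNReal.ofReal ((1 + ‖ξ‖ ^ 2) ^ (-10 : ℝ))) ^ (1 / 2 : ℝ)) *
        eFourierSobolevNorm 10 u * eFourierSobolevNorm 10 v * eFourierSobolevNorm (-9) w := by
  set C : ℝ≥0∞ := (∫⁻ ξ : EuclideanSpace ℝ (Fin 3),
    ENNReal.ofReal ((1 + ‖ξ‖ ^ 2) ^ (-10 : ℝ))) ^ (1 / 2 : ℝ) with hC
  have hu := lintegral_enorm_le_sobolevWeight (f := fourierFn u) (aestronglyMeasurable_fourierFn u)
  have hv := lintegral_enorm_le_sobolevWeight (f := fourierFn v) (aestronglyMeasurable_fourierFn v)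
  rw [← hC, ← eFourierSobolevNorm_eq] at hu hv
  refine (lintegral_enorm_Λ_le_weighted (aestronglyMeasurable_fourierFn u)
    (aestronglyMeasurable_fourierFn v) (aestronglyMeasurable_fourierFn w)).trans ?_
  rw [lintegral_wHi_mul_sq, lintegral_wHi_mul_sq, lintegral_wLo_mul_sq, ← eFourierSobolevNorm_eq,
    ← eFourierSobolevNorm_eq, ← eFourierSobolevNorm_eq]
  refine mul_le_mul' ?_ le_rfl
  rw [mul_assoc, mul_assoc]
  refine mul_le_mul' le_rfl ?_
  calc (∫⁻ ξ, ‖fourierFn v ξ‖ₑ) * eFourierSobolevNorm 10 u +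
        (∫⁻ ξ, ‖fourierFn u ξ‖ₑ) * eFourierSobolevNorm 10 v
      ≤ C * eFourierSobolevNorm 10 v * eFourierSobolevNorm 10 u +
          C * eFourierSobolevNorm 10 u * eFourierSobolevNorm 10 v :=
        add_le_add (mul_le_mul' hv le_rfl) (mul_le_mul' hu le_rfl)
    _ = 2 * C * (eFourierSobolevNorm 10 u * eFourierSobolevNorm 10 v) := by ring

/-- **The Euler form is bounded on `H¹⁰ × H¹⁰ × H⁻⁹`** (the one-derivative loss of `B`, Tao 2016
(1.14), in duality form): `|⟨B(u,v), w⟩| ≤ π · 2¹⁰ C_emb ‖u‖_{H¹⁰} ‖v‖_{H¹⁰} ‖w‖_{H⁻⁹}` for all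
`u, v, w ∈ L²(ℝ³; ℂ³)`, `C_emb = (∫ (1+|ξ|²)^{-10})^{1/2}`.
[cite: Tao2016AveragedNS, §1.1 (1.15) p. 7 (local well-posedness of `H¹⁰_df` mild solutions: the bilinear Duhamel operator, uniqueness) (source of the NOTION / ARGUMENT this module implements; this declaration is the cell’s own lemma or plumbing, NOT a printed statement)] -/
theorem enorm_eulerForm_le_weighted (u v w : L2C) :
    ‖eulerForm u v w‖ₑ ≤ ENNReal.ofReal Real.pi *
      (2 ^ 9 * (2 * (∫⁻ ξ : EuclideanSpace ℝ (Fin 3),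
          ENNReal.ofReal ((1 + ‖ξ‖ ^ 2) ^ (-10 : ℝ))) ^ (1 / 2 : ℝ)) *
        eFourierSobolevNorm 10 u * eFourierSobolevNorm 10 v * eFourierSobolevNorm (-9) w) := by
  have hπ : ‖-((Real.pi : ℂ) * I)‖ₑ = ENNReal.ofReal Real.pi := by
    rw [enorm_neg, enorm_mul, ← ofReal_norm, ← ofReal_norm, Complex.norm_I, ENNReal.ofReal_one,
      mul_one, Complex.norm_real, Real.norm_of_nonneg Real.pi_pos.le]
  unfold eulerForm
  rw [enorm_mul, hπ]
  exact mul_le_mul' le_rfl ((enorm_integral_le_lintegral_enorm _).trans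
    (lintegral_enorm_Λ_fourierFn_le_weighted u v w))

/-! ### Monotonicity of the Sobolev scale -/

/-- **The Sobolev scale is monotone**: `‖f‖_{H^s} ≤ ‖f‖_{H^t}` for `s ≤ t` (the weight
`(1+|ξ|²)^s` is monotone in `s` since `1+|ξ|² ≥ 1`).
[cite: Tao2016AveragedNS, §1.1 (1.15) p. 7 (local well-posedness of `H¹⁰_df` mild solutions: the bilinear Duhamel operator, uniqueness) (source of the NOTION / ARGUMENT this module implements; this declaration is the cell’s own lemma or plumbing, NOT a printed statement)] -/
theorem eFourierSobolevNorm_mono {s t : ℝ} (hst : s ≤ t) (f : L2C) :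
    eFourierSobolevNorm s f ≤ eFourierSobolevNorm t f := by
  unfold eFourierSobolevNorm
  refine ENNReal.rpow_le_rpow (lintegral_mono fun ξ => ?_) (by norm_num)
  exact mul_le_mul' (ENNReal.ofReal_le_ofReal
    (Real.rpow_le_rpow_of_exponent_le (le_add_of_nonneg_right (sq_nonneg _)) hst)) le_rfl

/-- `‖w‖_{H⁻⁹} ≤ ‖w‖_{L²}`.
[cite: Tao2016AveragedNS, §1.1 (1.15) p. 7 (local well-posedness of `H¹⁰_df` mild solutions: the bilinear Duhamel operator, uniqueness) (source of the NOTION / ARGUMENT this module implements; this declaration is the cell’s own lemma or plumbing, NOT a printed statement)] -/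
theorem eFourierSobolevNorm_neg_nine_le_enorm (w : L2C) : eFourierSobolevNorm (-9) w ≤ ‖w‖ₑ := by
  rw [← Literature.Analysis.FunctionSpaces.eFourierSobolevNorm_zero_eq_enorm]
  exact eFourierSobolevNorm_mono (by norm_num) w

end Literature.Analysis.PerpetualPump.PerpetualPumpThesis.B

namespace Literature.Analysis.PerpetualPump.PerpetualPumpThesis

open Literature.Analysis.FluidPDE Literature.Analysis.FluidPDE.Tao2016
open Literature.Analysis.FunctionSpaces (eFourierSobolevNorm)

end Literature.Analysis.PerpetualPump.PerpetualPumpThesis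

end Part6

/-!
## Part 7 — port of `Summits/NavierStokesRegularity/NavierStokesRegularity/Theorems/PerpetualPumpThesisBilinearOperatorForm.lean` (11 declarations kept)

# Stub B (`bilinearOperator`) for `PerpetualPump.Thesis`, part III: the averaged form on
# `H¹⁰ × H¹⁰ × H⁻⁹`

Support file (part 3 of the stub `bilinearOperator` of line `SketchIdeator2`, crux
stmt-NavierStokesRegularity-1832). For an *arbitrary* averaging datum `𝒜` (T. Tao, J. Amer.
Math. Soc. 29 (2016), arXiv:1402.0290v3, (1.12)–(1.13); no symmetry, no cancellation) the
duality form `⟨B̃(u,v), w⟩ = 𝒜.form u v w = ∫_Ω ⟨B(A₁u, A₂v), A₃w⟩ dμ` obeys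

* **the tame bound** (registered sub-goal `stub_bilinearOperator_F`)
  `|⟨B̃(u,v), w⟩| ≤ K(𝒜) ‖u‖_{H¹⁰} ‖v‖_{H¹⁰} ‖w‖_{H⁻⁹}` for `u, v` of finite `H¹⁰` norm and every
  `w ∈ L²` (Tao, (1.14): "`B̃` obeys the same Sobolev bounds as `B`", one derivative lost). This
  is part I (`enorm_eulerForm_le_weighted`, the `H¹⁰ × H¹⁰ × H⁻⁹` bound for `B`) pushed through
  the slots `Aᵢ = mᵢ(D) Rot_{Rᵢ} Dil_{λᵢ}`: slots 1, 2 by the tree's `eFourierSobolevNorm_slot_le`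
  (`s = 10`), slot 3 by the **negative-order** slot bound
  `‖A w‖_{H⁻⁹} ≤ ‖m‖₀ max(1, λ⁻¹)⁹ ‖w‖_{H⁻⁹}` (`eFourierSobolevNorm_slot_le_of_nonpos`, new: for
  `s ≤ 0` the dilation costs `max(1,λ⁻¹)^{-s}` instead of `max(1,λ)^s`), then the moment bound
  `𝔼 ‖m₁‖₀‖m₂‖₀‖m₃‖₀ < ∞`;
* **realness** on real fields (`form_im_eq_zero`: each `Aᵢ x` is Fourier-Hermitian for real `x`,
  and the Euler form is real on Hermitian fields, tree `eulerForm_im_of_isFourierHermitian`);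
* **trilinearity**: additivity and homogeneity in the first two slots on fields of finite `H¹⁰`
  norm (`form_add₁`, `form_smul₁`, `form_add₂`, `form_smul₂`; additivity needs the absolute
  convergence of (1.3) and of (1.13), tree `eulerForm_add_smul₁/₂`, `integrable_eulerForm_slot`)
  and `ℂ`-linearity in the third slot (`form_add₃`, `form_smul₃`, tree
  `average_eulerForm_add_smul`).

## References

* T. Tao, J. Amer. Math. Soc. 29 (2016), 601–674, arXiv:1402.0290v3, §1.1 (1.10)–(1.14), p. 7.

Not carried from this source module (not needed by the declarations re-homed here; their consumers are Summits-side): `isFourierHermitian_slot`, `form_im_eq_zero`, `slot_smul`, `form_smul₁`, `form_smul₂`, `form_smul₃`, `stub_bilinearOperator_F`.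
-/

section Part7

open _root_.MeasureTheory _root_.Set _root_.Filter _root_.Topology FourierTransform
open scoped _root_.ENNReal _root_.NNReal ComplexConjugate

namespace Literature.Analysis.PerpetualPump.PerpetualPumpThesis.B

open Literature.Analysis.FluidPDE Literature.Analysis.FluidPDE.Tao2016
open Literature.Analysis.FunctionSpaces (eFourierSobolevNorm)

/-! ### Dilations and slots on negative-order Sobolev spaces -/

/-- The weight comparison for negative orders: for `s ≤ 0` and `a > 0`,
`(1 + |η/a|²)^s ≤ max(1, a)^{-2s} (1 + |η|²)^s` (since `1 + |η|² ≤ max(1,a)² (1 + |η/a|²)` and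
`x ↦ x^s` is antitone).
[cite: Tao2016AveragedNS, §1.1 (1.15) p. 7 (local well-posedness of `H¹⁰_df` mild solutions: the bilinear Duhamel operator, uniqueness) (source of the NOTION / ARGUMENT this module implements; this declaration is the cell’s own lemma or plumbing, NOT a printed statement)] -/
theorem sobolevWeight_dilate_le_of_nonpos {s : ℝ} (hs : s ≤ 0) {a : ℝ} (ha : 0 < a)
    (η : EuclideanSpace ℝ (Fin 3)) :
    (1 + ‖a⁻¹ • η‖ ^ 2) ^ s ≤ (max 1 a ^ 2) ^ (-s) * (1 + ‖η‖ ^ 2) ^ s := by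
  set M : ℝ := max 1 a ^ 2 with hM
  have hM1 : 1 ≤ M := one_le_pow₀ (le_max_left 1 a)
  have hMpos : 0 < M := lt_of_lt_of_le one_pos hM1
  have hX : 0 < 1 + ‖a⁻¹ • η‖ ^ 2 := by positivity
  -- `1 + |η|² ≤ M (1 + |η/a|²)`
  have hcmp : (1 + ‖η‖ ^ 2) / M ≤ 1 + ‖a⁻¹ • η‖ ^ 2 := by
    rw [div_le_iff₀ hMpos, norm_smul, mul_pow, Real.norm_of_nonneg (inv_pos.2 ha).le]
    have h2 : 1 ≤ max 1 a ^ 2 * a⁻¹ ^ 2 := by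
      rw [← mul_pow]
      refine one_le_pow₀ ?_
      rw [le_mul_inv_iff₀ ha, one_mul]
      exact le_max_right _ _
    nlinarith [sq_nonneg ‖η‖, mul_le_mul_of_nonneg_right h2 (sq_nonneg ‖η‖)]
  calc (1 + ‖a⁻¹ • η‖ ^ 2) ^ s ≤ ((1 + ‖η‖ ^ 2) / M) ^ s :=
        Real.rpow_le_rpow_of_nonpos (by positivity) hcmp hs
    _ = (max 1 a ^ 2) ^ (-s) * (1 + ‖η‖ ^ 2) ^ s := by
        rw [Real.div_rpow (by positivity) hMpos.le, Real.rpow_neg hMpos.le, hM]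
        ring

/-- `∫ (1+|ξ|²)^s |a^{3/2} ĝ(aξ)|² dξ ≤ max(1,a)^{-2s} ∫ (1+|η|²)^s |ĝ(η)|² dη` for `a > 0` and
`s ≤ 0`.
[cite: Tao2016AveragedNS, §1.1 (1.15) p. 7 (local well-posedness of `H¹⁰_df` mild solutions: the bilinear Duhamel operator, uniqueness) (source of the NOTION / ARGUMENT this module implements; this declaration is the cell’s own lemma or plumbing, NOT a printed statement)] -/
theorem sobolevWeightIntegral_dilate_le_of_nonpos {s : ℝ} (hs : s ≤ 0) {a : ℝ} (ha : 0 < a)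
    (g : EuclideanSpace ℝ (Fin 3) → EuclideanSpace ℂ (Fin 3)) :
    sobolevWeightIntegral s (fun ξ => (((a ^ (3 / 2 : ℝ) : ℝ)) : ℂ) • g (a • ξ)) ≤
      ENNReal.ofReal ((max 1 a ^ 2) ^ (-s)) * sobolevWeightIntegral s g := by
  rw [sobolevWeightIntegral_dilate s ha g, sobolevWeightIntegral,
    ← lintegral_const_mul' _ _ ENNReal.ofReal_ne_top]
  refine lintegral_mono fun η => ?_
  rw [← mul_assoc, ← ENNReal.ofReal_mul (by positivity)]
  gcongr
  exact sobolevWeight_dilate_le_of_nonpos hs ha η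

/-- **`Dil_λ` on negative-order Sobolev spaces**: `‖Dil_λ u‖²_{H^s} ≤ max(1,λ⁻¹)^{-2s} ‖u‖²_{H^s}`
for `λ > 0`, `s ≤ 0` (Tao 2016, p. 6: dilations with `λ` in a compact subset of `(0,∞)` "and
their inverses" are uniformly bounded on Sobolev spaces).
[cite: Tao2016AveragedNS, §1.1 (1.15) p. 7 (local well-posedness of `H¹⁰_df` mild solutions: the bilinear Duhamel operator, uniqueness) (source of the NOTION / ARGUMENT this module implements; this declaration is the cell’s own lemma or plumbing, NOT a printed statement)] -/
theorem sobolevWeightIntegral_fourierFn_dil_le_of_nonpos {s : ℝ} (hs : s ≤ 0) {c : ℝ} (hc : 0 < c)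
    (u : L2C) :
    sobolevWeightIntegral s (fourierFn (dil c u)) ≤
      ENNReal.ofReal ((max 1 c⁻¹ ^ 2) ^ (-s)) * sobolevWeightIntegral s (fourierFn u) := by
  rw [sobolevWeightIntegral_congr_ae (fourierFn_dil u hc)]
  exact sobolevWeightIntegral_dilate_le_of_nonpos hs (inv_pos.2 hc) (fourierFn u)

/-- **Slots are bounded on `H^s`, `s ≤ 0`**: for `A = m(D) Rot_R Dil_λ` a slot of a complex average,
`‖A u‖²_{H^s} ≤ ‖m‖₀² max(1,λ⁻¹)^{-2s} ‖u‖²_{H^s}`.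
[cite: Tao2016AveragedNS, §1.1 (1.15) p. 7 (local well-posedness of `H¹⁰_df` mild solutions: the bilinear Duhamel operator, uniqueness) (source of the NOTION / ARGUMENT this module implements; this declaration is the cell’s own lemma or plumbing, NOT a printed statement)] -/
theorem sobolevWeightIntegral_slot_le_of_nonpos (𝒟 : ComplexAveragingDatum) (i : Fin 3) (θ : 𝒟.Ω)
    {s : ℝ} (hs : s ≤ 0) (u : L2C) :
    sobolevWeightIntegral s (fourierFn (𝒟.slot i θ u)) ≤
      symbolSeminorm 0 (𝒟.m i θ) ^ 2 * ENNReal.ofReal ((max 1 (𝒟.lam i θ)⁻¹ ^ 2) ^ (-s)) *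
        sobolevWeightIntegral s (fourierFn u) := by
  unfold ComplexAveragingDatum.slot
  calc sobolevWeightIntegral s (fourierFn (fourierMultiplier (𝒟.symbolLp i θ)
        (rot (𝒟.R i θ) (dil (𝒟.lam i θ) u))))
      ≤ symbolSeminorm 0 (𝒟.m i θ) ^ 2 *
          sobolevWeightIntegral s (fourierFn (rot (𝒟.R i θ) (dil (𝒟.lam i θ) u))) :=
        sobolevWeightIntegral_fourierMultiplier_le s _ (𝒟.ae_enorm_symbolLp_le i θ)
    _ = symbolSeminorm 0 (𝒟.m i θ) ^ 2 * sobolevWeightIntegral s (fourierFn (dil (𝒟.lam i θ) u)) := by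
        rw [sobolevWeightIntegral_fourierFn_rot]
    _ ≤ symbolSeminorm 0 (𝒟.m i θ) ^ 2 * (ENNReal.ofReal ((max 1 (𝒟.lam i θ)⁻¹ ^ 2) ^ (-s)) *
          sobolevWeightIntegral s (fourierFn u)) :=
        mul_le_mul' le_rfl (sobolevWeightIntegral_fourierFn_dil_le_of_nonpos hs (𝒟.lam_pos i θ) u)
    _ = _ := by ring

/-- The same bound for the norms: `‖A u‖_{H^s} ≤ ‖m‖₀ max(1,λ⁻¹)^{-s} ‖u‖_{H^s}` (`s ≤ 0`).
[cite: Tao2016AveragedNS, §1.1 (1.15) p. 7 (local well-posedness of `H¹⁰_df` mild solutions: the bilinear Duhamel operator, uniqueness) (source of the NOTION / ARGUMENT this module implements; this declaration is the cell’s own lemma or plumbing, NOT a printed statement)] -/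
theorem eFourierSobolevNorm_slot_le_of_nonpos (𝒟 : ComplexAveragingDatum) (i : Fin 3) (θ : 𝒟.Ω)
    {s : ℝ} (hs : s ≤ 0) (u : L2C) :
    eFourierSobolevNorm s (𝒟.slot i θ u) ≤
      symbolSeminorm 0 (𝒟.m i θ) * ENNReal.ofReal (max 1 (𝒟.lam i θ)⁻¹ ^ (-s)) *
        eFourierSobolevNorm s u := by
  have hm : (0 : ℝ) ≤ max 1 (𝒟.lam i θ)⁻¹ := le_trans zero_le_one (le_max_left _ _)
  rw [eFourierSobolevNorm_eq, eFourierSobolevNorm_eq]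
  calc sobolevWeightIntegral s (fourierFn (𝒟.slot i θ u)) ^ (1 / 2 : ℝ)
      ≤ (symbolSeminorm 0 (𝒟.m i θ) ^ 2 * ENNReal.ofReal ((max 1 (𝒟.lam i θ)⁻¹ ^ 2) ^ (-s)) *
          sobolevWeightIntegral s (fourierFn u)) ^ (1 / 2 : ℝ) :=
        ENNReal.rpow_le_rpow (sobolevWeightIntegral_slot_le_of_nonpos 𝒟 i θ hs u) (by norm_num)
    _ = _ := by
        rw [ENNReal.mul_rpow_of_nonneg _ _ (by norm_num), ENNReal.mul_rpow_of_nonneg _ _ (by norm_num)]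
        congr 2
        · rw [← ENNReal.rpow_natCast, ← ENNReal.rpow_mul]
          norm_num
        · rw [ENNReal.ofReal_rpow_of_nonneg (by positivity) (by norm_num), ← Real.rpow_natCast,
            ← Real.rpow_mul hm, ← Real.rpow_mul hm]
          simp only [Nat.cast_ofNat]
          rw [show (2 : ℝ) * -s * (1 / 2) = -s by ring]

/-! ### The tame bound for the averaged form -/

/-- **Pointwise bound for the integrand of (1.13) on `H¹⁰ × H¹⁰ × H⁻⁹`**: if
`C⁻¹ ≤ λ_{i,θ} ≤ C` then, with `M = max(1, C)` and `C_emb = (∫ (1+|ξ|²)^{-10})^{1/2}`,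
`|⟨B(A₁u, A₂v), A₃w⟩| ≤ π 2¹⁰ C_emb M¹⁰ M¹⁰ M⁹ ‖u‖_{H¹⁰} ‖v‖_{H¹⁰} ‖w‖_{H⁻⁹} · ‖m₁‖₀ ‖m₂‖₀ ‖m₃‖₀`.
[cite: Tao2016AveragedNS, §1.1 (1.15) p. 7 (local well-posedness of `H¹⁰_df` mild solutions: the bilinear Duhamel operator, uniqueness) (source of the NOTION / ARGUMENT this module implements; this declaration is the cell’s own lemma or plumbing, NOT a printed statement)] -/
theorem enorm_eulerForm_slot_le_weighted (𝒜 : AveragingDatum) {C : ℝ}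
    (hC : ∀ i θ, C⁻¹ ≤ 𝒜.lam i θ ∧ 𝒜.lam i θ ≤ C) (u v w : L2C) (θ : 𝒜.Ω) :
    ‖eulerForm (𝒜.slot 0 θ u) (𝒜.slot 1 θ v) (𝒜.slot 2 θ w)‖ₑ ≤
      (ENNReal.ofReal Real.pi * (2 ^ 9 * (2 * (∫⁻ ξ : EuclideanSpace ℝ (Fin 3),
          ENNReal.ofReal ((1 + ‖ξ‖ ^ 2) ^ (-10 : ℝ))) ^ (1 / 2 : ℝ))) *
        ENNReal.ofReal (max 1 C ^ (10 : ℝ)) * ENNReal.ofReal (max 1 C ^ (10 : ℝ)) *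
          ENNReal.ofReal (max 1 C ^ (-(-9) : ℝ))) *
        eFourierSobolevNorm 10 u * eFourierSobolevNorm 10 v * eFourierSobolevNorm (-9) w *
        (symbolSeminorm 0 (𝒜.m 0 θ) * symbolSeminorm 0 (𝒜.m 1 θ) * symbolSeminorm 0 (𝒜.m 2 θ)) := by
  set 𝒟 := 𝒜.toComplex with h𝒟
  -- `C > 0` and `λ⁻¹ ≤ C`
  have hCpos : 0 < C := lt_of_lt_of_le (𝒜.lam_pos 0 θ) (hC 0 θ).2
  have hK : ∀ i, ENNReal.ofReal (max 1 (𝒜.lam i θ) ^ (10 : ℝ)) ≤ ENNReal.ofReal (max 1 C ^ (10 : ℝ)) :=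
    fun i => ENNReal.ofReal_le_ofReal
      (Real.rpow_le_rpow (by positivity) (max_le_max le_rfl (hC i θ).2) (by norm_num))
  have hK' : ENNReal.ofReal (max 1 (𝒜.lam 2 θ)⁻¹ ^ (-(-9) : ℝ)) ≤ ENNReal.ofReal (max 1 C ^ (-(-9) : ℝ)) := by
    refine ENNReal.ofReal_le_ofReal (Real.rpow_le_rpow (by positivity) (max_le_max le_rfl ?_) (by norm_num))
    have h := (hC 2 θ).1
    rwa [inv_le_comm₀ hCpos (𝒜.lam_pos 2 θ)] at h
  have h0 : eFourierSobolevNorm 10 (𝒜.slot 0 θ u) ≤ symbolSeminorm 0 (𝒜.m 0 θ) *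
      (ENNReal.ofReal (max 1 C ^ (10 : ℝ)) * eFourierSobolevNorm 10 u) := by
    refine (𝒟.eFourierSobolevNorm_slot_le 0 θ (by norm_num : (0 : ℝ) ≤ 10) u).trans ?_
    rw [mul_assoc]
    exact mul_le_mul' le_rfl (mul_le_mul' (hK 0) le_rfl)
  have h1 : eFourierSobolevNorm 10 (𝒜.slot 1 θ v) ≤ symbolSeminorm 0 (𝒜.m 1 θ) *
      (ENNReal.ofReal (max 1 C ^ (10 : ℝ)) * eFourierSobolevNorm 10 v) := by
    refine (𝒟.eFourierSobolevNorm_slot_le 1 θ (by norm_num : (0 : ℝ) ≤ 10) v).trans ?_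
    rw [mul_assoc]
    exact mul_le_mul' le_rfl (mul_le_mul' (hK 1) le_rfl)
  have h2 : eFourierSobolevNorm (-9) (𝒜.slot 2 θ w) ≤ symbolSeminorm 0 (𝒜.m 2 θ) *
      (ENNReal.ofReal (max 1 C ^ (-(-9) : ℝ)) * eFourierSobolevNorm (-9) w) := by
    refine (eFourierSobolevNorm_slot_le_of_nonpos 𝒟 2 θ (by norm_num : (-9 : ℝ) ≤ 0) w).trans ?_
    rw [mul_assoc]
    exact mul_le_mul' le_rfl (mul_le_mul' hK' le_rfl)
  calc ‖eulerForm (𝒜.slot 0 θ u) (𝒜.slot 1 θ v) (𝒜.slot 2 θ w)‖ₑ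
      ≤ ENNReal.ofReal Real.pi * (2 ^ 9 * (2 * (∫⁻ ξ : EuclideanSpace ℝ (Fin 3),
          ENNReal.ofReal ((1 + ‖ξ‖ ^ 2) ^ (-10 : ℝ))) ^ (1 / 2 : ℝ)) *
          eFourierSobolevNorm 10 (𝒜.slot 0 θ u) * eFourierSobolevNorm 10 (𝒜.slot 1 θ v) *
          eFourierSobolevNorm (-9) (𝒜.slot 2 θ w)) := enorm_eulerForm_le_weighted _ _ _
    _ ≤ ENNReal.ofReal Real.pi * (2 ^ 9 * (2 * (∫⁻ ξ : EuclideanSpace ℝ (Fin 3),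
          ENNReal.ofReal ((1 + ‖ξ‖ ^ 2) ^ (-10 : ℝ))) ^ (1 / 2 : ℝ)) *
          (symbolSeminorm 0 (𝒜.m 0 θ) * (ENNReal.ofReal (max 1 C ^ (10 : ℝ)) * eFourierSobolevNorm 10 u)) *
          (symbolSeminorm 0 (𝒜.m 1 θ) * (ENNReal.ofReal (max 1 C ^ (10 : ℝ)) * eFourierSobolevNorm 10 v)) *
          (symbolSeminorm 0 (𝒜.m 2 θ) * (ENNReal.ofReal (max 1 C ^ (-(-9) : ℝ)) * eFourierSobolevNorm (-9) w))) := by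
        gcongr
    _ = _ := by ring

/-- **The tame bound for the averaged form** (Tao 2016, (1.14): `B̃` obeys the same Sobolev bounds
as `B`): for every averaging datum `𝒜` there is `K < ∞` with
`|⟨B̃(u,v), w⟩| ≤ K ‖u‖_{H¹⁰} ‖v‖_{H¹⁰} ‖w‖_{H⁻⁹}` for all `u, v` of finite `H¹⁰` norm and all
`w ∈ L²(ℝ³; ℂ³)` (pointwise bound, then the moment bound `𝔼 ‖m₁‖₀‖m₂‖₀‖m₃‖₀ < ∞`).
[cite: Tao2016AveragedNS, §1.1 (1.15) p. 7 (local well-posedness of `H¹⁰_df` mild solutions: the bilinear Duhamel operator, uniqueness) (source of the NOTION / ARGUMENT this module implements; this declaration is the cell’s own lemma or plumbing, NOT a printed statement)] -/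
theorem exists_enorm_form_le (𝒜 : AveragingDatum) :
    ∃ K : ℝ≥0, ∀ u v w : L2C, eFourierSobolevNorm 10 u < ⊤ → eFourierSobolevNorm 10 v < ⊤ →
      ‖𝒜.form u v w‖ₑ ≤ (K : ℝ≥0∞) * eFourierSobolevNorm 10 u * eFourierSobolevNorm 10 v *
        eFourierSobolevNorm (-9) w := by
  obtain ⟨C, hC⟩ := 𝒜.lam_bdd
  set Kpt : ℝ≥0∞ := ENNReal.ofReal Real.pi * (2 ^ 9 * (2 * (∫⁻ ξ : EuclideanSpace ℝ (Fin 3),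
      ENNReal.ofReal ((1 + ‖ξ‖ ^ 2) ^ (-10 : ℝ))) ^ (1 / 2 : ℝ))) *
    ENNReal.ofReal (max 1 C ^ (10 : ℝ)) * ENNReal.ofReal (max 1 C ^ (10 : ℝ)) *
      ENNReal.ofReal (max 1 C ^ (-(-9) : ℝ)) with hKpt
  set S : ℝ≥0∞ := ∫⁻ θ, symbolSeminorm 0 (𝒜.m 0 θ) * symbolSeminorm 0 (𝒜.m 1 θ) *
    symbolSeminorm 0 (𝒜.m 2 θ) ∂𝒜.μ with hS
  have hKpt_top : Kpt < ∞ := by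
    refine ENNReal.mul_lt_top (ENNReal.mul_lt_top (ENNReal.mul_lt_top (ENNReal.mul_lt_top
      ENNReal.ofReal_lt_top (ENNReal.mul_lt_top (ENNReal.pow_lt_top ENNReal.ofNat_lt_top)
      (ENNReal.mul_lt_top ENNReal.ofNat_lt_top Cemb_lt_top))) ENNReal.ofReal_lt_top)
      ENNReal.ofReal_lt_top) ENNReal.ofReal_lt_top
  have hS_top : S < ∞ := 𝒜.moment 0 0 0
  have hKS : Kpt * S ≠ ∞ := (ENNReal.mul_lt_top hKpt_top hS_top).ne
  refine ⟨(Kpt * S).toNNReal, fun u v w hu hv => ?_⟩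
  rw [ENNReal.coe_toNNReal hKS]
  set X : ℝ≥0∞ := eFourierSobolevNorm 10 u * eFourierSobolevNorm 10 v * eFourierSobolevNorm (-9) w
    with hX
  have hX_top : X < ∞ := ENNReal.mul_lt_top (ENNReal.mul_lt_top hu hv)
    ((eFourierSobolevNorm_neg_nine_le_enorm w).trans_lt enorm_lt_top)
  have hKX : Kpt * X ≠ ∞ := (ENNReal.mul_lt_top hKpt_top hX_top).ne
  calc ‖𝒜.form u v w‖ₑ
      ≤ ∫⁻ θ, ‖eulerForm (𝒜.slot 0 θ u) (𝒜.slot 1 θ v) (𝒜.slot 2 θ w)‖ₑ ∂𝒜.μ :=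
        enorm_integral_le_lintegral_enorm _
    _ ≤ ∫⁻ θ, Kpt * X * (symbolSeminorm 0 (𝒜.m 0 θ) * symbolSeminorm 0 (𝒜.m 1 θ) *
          symbolSeminorm 0 (𝒜.m 2 θ)) ∂𝒜.μ := by
        refine lintegral_mono fun θ => ?_
        refine (enorm_eulerForm_slot_le_weighted 𝒜 hC u v w θ).trans_eq ?_
        rw [hKpt, hX]
        ring
    _ = Kpt * X * S := lintegral_const_mul' _ _ hKX
    _ = Kpt * S * eFourierSobolevNorm 10 u * eFourierSobolevNorm 10 v * eFourierSobolevNorm (-9) w := by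
        rw [hX]
        ring

/-! ### Realness of the averaged form on real fields -/

/-- Slots are additive.
[cite: Tao2016AveragedNS, §1.1 (1.15) p. 7 (local well-posedness of `H¹⁰_df` mild solutions: the bilinear Duhamel operator, uniqueness) (source of the NOTION / ARGUMENT this module implements; this declaration is the cell’s own lemma or plumbing, NOT a printed statement)] -/
theorem slot_add (𝒜 : AveragingDatum) (i : Fin 3) (θ : 𝒜.Ω) (x y : L2C) :
    𝒜.slot i θ (x + y) = 𝒜.slot i θ x + 𝒜.slot i θ y := by
  simp only [AveragingDatum.slot, dil_add, rot_add, fourierMultiplier_add]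

/-- **`⟨B̃(u,v), w⟩` is additive in `u`** on fields of finite `H¹⁰` norm (`w ∈ L²` arbitrary):
slots are linear, the Euler form is additive on `H¹⁰` (absolute convergence of (1.3)) and the
`Ω`-integrands are integrable (absolute convergence of (1.13), Tao p. 7).
[cite: Tao2016AveragedNS, §1.1 (1.15) p. 7 (local well-posedness of `H¹⁰_df` mild solutions: the bilinear Duhamel operator, uniqueness) (source of the NOTION / ARGUMENT this module implements; this declaration is the cell’s own lemma or plumbing, NOT a printed statement)] -/
theorem form_add₁ (𝒜 : AveragingDatum) {u u' v : L2C} (w : L2C)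
    (hu : eFourierSobolevNorm 10 u < ∞) (hu' : eFourierSobolevNorm 10 u' < ∞)
    (hv : eFourierSobolevNorm 10 v < ∞) :
    𝒜.form (u + u') v w = 𝒜.form u v w + 𝒜.form u' v w := by
  have hint : Integrable (fun θ => eulerForm (𝒜.slot 0 θ u) (𝒜.slot 1 θ v) (𝒜.slot 2 θ w)) 𝒜.μ :=
    𝒜.toComplex.integrable_eulerForm_slot w hu hv
  have hint' : Integrable (fun θ => eulerForm (𝒜.slot 0 θ u') (𝒜.slot 1 θ v) (𝒜.slot 2 θ w)) 𝒜.μ :=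
    𝒜.toComplex.integrable_eulerForm_slot w hu' hv
  unfold AveragingDatum.form
  rw [← integral_add hint hint']
  refine integral_congr_ae (Eventually.of_forall fun θ => ?_)
  have h0 : eFourierSobolevNorm 10 (𝒜.slot 0 θ u) < ∞ := 𝒜.toComplex.eFourierSobolevNorm_slot_lt_top 0 θ hu
  have h0' : eFourierSobolevNorm 10 (𝒜.slot 0 θ u') < ∞ :=
    𝒜.toComplex.eFourierSobolevNorm_slot_lt_top 0 θ hu'
  have h1 : eFourierSobolevNorm 10 (𝒜.slot 1 θ v) < ∞ := 𝒜.toComplex.eFourierSobolevNorm_slot_lt_top 1 θ hv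
  have key := eulerForm_add_smul₁ 1 (𝒜.slot 2 θ w) h0 h0' h1
  rw [one_smul, one_mul] at key
  change eulerForm (𝒜.slot 0 θ (u + u')) (𝒜.slot 1 θ v) (𝒜.slot 2 θ w) =
    eulerForm (𝒜.slot 0 θ u) (𝒜.slot 1 θ v) (𝒜.slot 2 θ w) +
      eulerForm (𝒜.slot 0 θ u') (𝒜.slot 1 θ v) (𝒜.slot 2 θ w)
  rw [slot_add]
  exact key

/-- **`⟨B̃(u,v), w⟩` is additive in `v`** on fields of finite `H¹⁰` norm.
[cite: Tao2016AveragedNS, §1.1 (1.15) p. 7 (local well-posedness of `H¹⁰_df` mild solutions: the bilinear Duhamel operator, uniqueness) (source of the NOTION / ARGUMENT this module implements; this declaration is the cell’s own lemma or plumbing, NOT a printed statement)] -/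
theorem form_add₂ (𝒜 : AveragingDatum) {u v v' : L2C} (w : L2C)
    (hu : eFourierSobolevNorm 10 u < ∞) (hv : eFourierSobolevNorm 10 v < ∞)
    (hv' : eFourierSobolevNorm 10 v' < ∞) :
    𝒜.form u (v + v') w = 𝒜.form u v w + 𝒜.form u v' w := by
  have hint : Integrable (fun θ => eulerForm (𝒜.slot 0 θ u) (𝒜.slot 1 θ v) (𝒜.slot 2 θ w)) 𝒜.μ :=
    𝒜.toComplex.integrable_eulerForm_slot w hu hv
  have hint' : Integrable (fun θ => eulerForm (𝒜.slot 0 θ u) (𝒜.slot 1 θ v') (𝒜.slot 2 θ w)) 𝒜.μ :=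
    𝒜.toComplex.integrable_eulerForm_slot w hu hv'
  unfold AveragingDatum.form
  rw [← integral_add hint hint']
  refine integral_congr_ae (Eventually.of_forall fun θ => ?_)
  have h0 : eFourierSobolevNorm 10 (𝒜.slot 0 θ u) < ∞ := 𝒜.toComplex.eFourierSobolevNorm_slot_lt_top 0 θ hu
  have h1 : eFourierSobolevNorm 10 (𝒜.slot 1 θ v) < ∞ := 𝒜.toComplex.eFourierSobolevNorm_slot_lt_top 1 θ hv
  have h1' : eFourierSobolevNorm 10 (𝒜.slot 1 θ v') < ∞ :=
    𝒜.toComplex.eFourierSobolevNorm_slot_lt_top 1 θ hv'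
  have key := eulerForm_add_smul₂ 1 (𝒜.slot 2 θ w) h0 h1 h1'
  rw [one_smul, one_mul] at key
  change eulerForm (𝒜.slot 0 θ u) (𝒜.slot 1 θ (v + v')) (𝒜.slot 2 θ w) =
    eulerForm (𝒜.slot 0 θ u) (𝒜.slot 1 θ v) (𝒜.slot 2 θ w) +
      eulerForm (𝒜.slot 0 θ u) (𝒜.slot 1 θ v') (𝒜.slot 2 θ w)
  rw [slot_add]
  exact key

/-- **`⟨B̃(u,v), w⟩` is additive in `w ∈ L²`** for `u, v` of finite `H¹⁰` norm (tree:
`average_eulerForm_add_smul`, the absolute convergence of (1.13)).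
[cite: Tao2016AveragedNS, §1.1 (1.15) p. 7 (local well-posedness of `H¹⁰_df` mild solutions: the bilinear Duhamel operator, uniqueness) (source of the NOTION / ARGUMENT this module implements; this declaration is the cell’s own lemma or plumbing, NOT a printed statement)] -/
theorem form_add₃ (𝒜 : AveragingDatum) {u v : L2C} (w w' : L2C)
    (hu : eFourierSobolevNorm 10 u < ∞) (hv : eFourierSobolevNorm 10 v < ∞) :
    𝒜.form u v (w + w') = 𝒜.form u v w + 𝒜.form u v w' := by
  have h := 𝒜.toComplex.average_eulerForm_add_smul w w' 1 1 hu hv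
  rw [one_smul, one_smul, one_mul, one_mul] at h
  exact h

end Literature.Analysis.PerpetualPump.PerpetualPumpThesis.B

namespace Literature.Analysis.PerpetualPump.PerpetualPumpThesis

open Literature.Analysis.FluidPDE Literature.Analysis.FluidPDE.Tao2016
open Literature.Analysis.FunctionSpaces (eFourierSobolevNorm)

end Literature.Analysis.PerpetualPump.PerpetualPumpThesis

end Part7

/-!
## Part 8 — port of `Summits/NavierStokesRegularity/NavierStokesRegularity/Theorems/PerpetualPumpThesisUniquenessFormBound.lean` (15 declarations kept)

# Stub U (`uniqueness`) for `PerpetualPump.Thesis`, part I: the `L² × H¹⁰ × H¹` bound for the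
# averaged form

Support file (part 1 of the stub `uniqueness` of line `SketchIdeator2`, crux
stmt-NavierStokesRegularity-1832). Uniqueness of `H¹⁰_df`-mild solutions of Tao's averaged
Navier–Stokes equation (T. Tao, J. Amer. Math. Soc. 29 (2016), arXiv:1402.0290v3, §1.1 (1.9),
(1.12)–(1.15)) is an `L²`-energy/Grönwall argument on the difference of two solutions, which needs
the duality form `⟨B̃(f,g), h⟩ = 𝒜.form f g h` bounded with one bilinear argument measured in `L²`:
`|⟨B̃(f,g), h⟩| + |⟨B̃(g,f), h⟩| ≤ K(𝒜) ‖f‖_{L²} ‖g‖_{H¹⁰} ‖h‖_{H¹}` (`exists_enorm_form_le_one`).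
For the Euler form (1.3) this is `|⟨B(f,g), h⟩| ≤ 3π C₉ ‖f‖_{L²} ‖g‖_{H¹⁰} ‖h‖_{H¹}`,
`C₉ = (∫_{ℝ³} (1+|ξ|²)^{-9})^{1/2}` (`enorm_eulerForm_le_one`), from
`|Λ_{ξ₁,ξ₂}(X₁,X₂,X₃)| ≤ (|ξ₁|+|ξ₂|)|X₁||X₂||X₃|`, the weight inequality `|ξ₁| + |ξ₂| ≤ 3 ⟨ξ₂⟩⟨ξ₃⟩`
(`ξ₃ = -ξ₁-ξ₂`, `⟨ξ⟩ = √(1+|ξ|²)`: no derivative on the `L²` slot), Tonelli, Cauchy–Schwarz in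
the inner variable and `‖⟨ξ⟩ĝ‖₁ ≤ C₉ ‖g‖_{H¹⁰}`; then the tree's slot bounds on `L²`, `H¹⁰`, `H¹`
and the moment bound `𝔼 ‖m₁‖₀‖m₂‖₀‖m₃‖₀ < ∞`, as in part III of stub B.

## References

* T. Tao, J. Amer. Math. Soc. 29 (2016), 601–674, arXiv:1402.0290v3, §1.1 (1.3)–(1.4),
  (1.10)–(1.15).

Not carried from this source module (not needed by the declarations re-homed here; their consumers are Summits-side): `stub_uniqueness_FormBound`.
-/

section Part8

open _root_.MeasureTheory _root_.Set _root_.Filter _root_.Topology FourierTransform _root_.Complex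
open scoped _root_.ENNReal _root_.NNReal

namespace Literature.Analysis.PerpetualPump.PerpetualPumpThesis.U

open Literature.Analysis.FluidPDE Literature.Analysis.FluidPDE.Tao2016
open Literature.Analysis.FunctionSpaces (eFourierSobolevNorm)
open Literature.Analysis.PerpetualPump.PerpetualPumpThesis.B
  (jb_sq norm_le_jb continuous_jb lintegral_mul_comp_sub_le)

/-! ### The weight inequality and the pointwise bound for `Λ` -/

/-- `1 ≤ ⟨ξ⟩`.
[cite: Tao2016AveragedNS, §1.1 (1.15) p. 7 (local well-posedness of `H¹⁰_df` mild solutions: the bilinear Duhamel operator, uniqueness) (source of the NOTION / ARGUMENT this module implements; this declaration is the cell’s own lemma or plumbing, NOT a printed statement)] -/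
theorem one_le_jb (ξ : EuclideanSpace ℝ (Fin 3)) : 1 ≤ √(1 + ‖ξ‖ ^ 2) :=
  Real.one_le_sqrt.2 (le_add_of_nonneg_right (sq_nonneg _))

/-- **The weight inequality** with no derivative on the first slot:
`|ξ₁| + |ξ₂| ≤ 3 ⟨ξ₂⟩ ⟨ξ₃⟩`, `ξ₃ = -ξ₁-ξ₂` (since `|ξ₁| ≤ |ξ₂| + |ξ₃|` and `⟨·⟩ ≥ max(1, |·|)`).
[cite: Tao2016AveragedNS, §1.1 (1.15) p. 7 (local well-posedness of `H¹⁰_df` mild solutions: the bilinear Duhamel operator, uniqueness) (source of the NOTION / ARGUMENT this module implements; this declaration is the cell’s own lemma or plumbing, NOT a printed statement)] -/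
theorem weight_ineq_one (ξ₁ ξ₂ : EuclideanSpace ℝ (Fin 3)) :
    ‖ξ₁‖ + ‖ξ₂‖ ≤ 3 * (√(1 + ‖ξ₂‖ ^ 2) * √(1 + ‖-ξ₁ - ξ₂‖ ^ 2)) := by
  have h1 : ‖ξ₁‖ ≤ ‖ξ₂‖ + ‖-ξ₁ - ξ₂‖ := by
    have h : ξ₂ + (-ξ₁ - ξ₂) = -ξ₁ := by abel
    calc ‖ξ₁‖ = ‖-ξ₁‖ := (norm_neg ξ₁).symm
      _ = ‖ξ₂ + (-ξ₁ - ξ₂)‖ := by rw [h]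
      _ ≤ ‖ξ₂‖ + ‖-ξ₁ - ξ₂‖ := norm_add_le _ _
  have ha := one_le_jb ξ₂
  have hb := one_le_jb (-ξ₁ - ξ₂)
  have ha' := norm_le_jb ξ₂
  have hb' := norm_le_jb (-ξ₁ - ξ₂)
  have hA : √(1 + ‖ξ₂‖ ^ 2) ≤ √(1 + ‖ξ₂‖ ^ 2) * √(1 + ‖-ξ₁ - ξ₂‖ ^ 2) :=
    le_mul_of_one_le_right (zero_le_one.trans ha) hb
  have hB : √(1 + ‖-ξ₁ - ξ₂‖ ^ 2) ≤ √(1 + ‖ξ₂‖ ^ 2) * √(1 + ‖-ξ₁ - ξ₂‖ ^ 2) :=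
    le_mul_of_one_le_left (zero_le_one.trans hb) ha
  linarith

/-- **Pointwise bound for Tao's symbol (1.4) with the `L²` slot underived**:
`|Λ_{ξ₁,ξ₂}(X₁,X₂,X₃)| ≤ 3 |X₁| (⟨ξ₂⟩|X₂|) (⟨ξ₃⟩|X₃|)`.
[cite: Tao2016AveragedNS, §1.1 (1.15) p. 7 (local well-posedness of `H¹⁰_df` mild solutions: the bilinear Duhamel operator, uniqueness) (source of the NOTION / ARGUMENT this module implements; this declaration is the cell’s own lemma or plumbing, NOT a printed statement)] -/
theorem norm_Λ_le_one (ξ₁ ξ₂ : EuclideanSpace ℝ (Fin 3)) (X₁ X₂ X₃ : EuclideanSpace ℂ (Fin 3)) :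
    ‖Λ ξ₁ ξ₂ X₁ X₂ X₃‖ ≤
      3 * (‖X₁‖ * ((√(1 + ‖ξ₂‖ ^ 2) * ‖X₂‖) * (√(1 + ‖-ξ₁ - ξ₂‖ ^ 2) * ‖X₃‖))) := by
  calc ‖Λ ξ₁ ξ₂ X₁ X₂ X₃‖
      ≤ ‖X₁‖ * ‖ξ₂‖ * (‖X₂‖ * ‖X₃‖) + ‖X₂‖ * ‖ξ₁‖ * (‖X₁‖ * ‖X₃‖) := norm_Λ_le ξ₁ ξ₂ X₁ X₂ X₃
    _ = (‖ξ₁‖ + ‖ξ₂‖) * (‖X₁‖ * ‖X₂‖ * ‖X₃‖) := by ring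
    _ ≤ 3 * (√(1 + ‖ξ₂‖ ^ 2) * √(1 + ‖-ξ₁ - ξ₂‖ ^ 2)) * (‖X₁‖ * ‖X₂‖ * ‖X₃‖) :=
        mul_le_mul_of_nonneg_right (weight_ineq_one ξ₁ ξ₂) (by positivity)
    _ = _ := by ring

/-- The same bound in `ℝ≥0∞`, with the weights `⟨ξ⟩` as `ENNReal.ofReal (√(1 + ‖ξ‖ ^ 2))`.
[cite: Tao2016AveragedNS, §1.1 (1.15) p. 7 (local well-posedness of `H¹⁰_df` mild solutions: the bilinear Duhamel operator, uniqueness) (source of the NOTION / ARGUMENT this module implements; this declaration is the cell’s own lemma or plumbing, NOT a printed statement)] -/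
theorem enorm_Λ_le_one (ξ₁ ξ₂ : EuclideanSpace ℝ (Fin 3)) (X₁ X₂ X₃ : EuclideanSpace ℂ (Fin 3)) :
    ‖Λ ξ₁ ξ₂ X₁ X₂ X₃‖ₑ ≤
      3 * (‖X₁‖ₑ * ((ENNReal.ofReal (√(1 + ‖ξ₂‖ ^ 2)) * ‖X₂‖ₑ) *
        (ENNReal.ofReal (√(1 + ‖-ξ₁ - ξ₂‖ ^ 2)) * ‖X₃‖ₑ))) := by
  rw [← ofReal_norm (Λ ξ₁ ξ₂ X₁ X₂ X₃)]
  refine (ENNReal.ofReal_le_ofReal (norm_Λ_le_one ξ₁ ξ₂ X₁ X₂ X₃)).trans_eq ?_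
  rw [ENNReal.ofReal_mul (by positivity), ENNReal.ofReal_mul (by positivity),
    ENNReal.ofReal_mul (by positivity), ENNReal.ofReal_mul (by positivity),
    ENNReal.ofReal_mul (by positivity), ENNReal.ofReal_ofNat, ofReal_norm, ofReal_norm, ofReal_norm]

/-- `⟨ξ⟩² = (1+|ξ|²)¹` for the `ℝ≥0∞` weight: its square is the `H¹` weight.
[cite: Tao2016AveragedNS, §1.1 (1.15) p. 7 (local well-posedness of `H¹⁰_df` mild solutions: the bilinear Duhamel operator, uniqueness) (source of the NOTION / ARGUMENT this module implements; this declaration is the cell’s own lemma or plumbing, NOT a printed statement)] -/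
theorem wOne_sq (ξ : EuclideanSpace ℝ (Fin 3)) :
    ENNReal.ofReal (√(1 + ‖ξ‖ ^ 2)) ^ 2 = ENNReal.ofReal ((1 + ‖ξ‖ ^ 2) ^ (1 : ℝ)) := by
  rw [← ENNReal.ofReal_pow (Real.sqrt_nonneg _), jb_sq, Real.rpow_one]

/-- The weight `⟨ξ⟩` is measurable.
[cite: Tao2016AveragedNS, §1.1 (1.15) p. 7 (local well-posedness of `H¹⁰_df` mild solutions: the bilinear Duhamel operator, uniqueness) (source of the NOTION / ARGUMENT this module implements; this declaration is the cell’s own lemma or plumbing, NOT a printed statement)] -/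
theorem measurable_wOne :
    Measurable fun ξ : EuclideanSpace ℝ (Fin 3) => ENNReal.ofReal (√(1 + ‖ξ‖ ^ 2)) :=
  continuous_jb.measurable.ennreal_ofReal

/-! ### The trilinear estimate with an `L²` slot -/

/-- **The trilinear estimate for (1.3) with the first slot in `L²`**: for measurable fields
`f, g, h` on frequency space,
`∫∫ |Λ(f(ξ₁), g(ξ₂), h(-ξ₁-ξ₂))| ≤ 3 ‖⟨ξ⟩g‖₁ ‖f‖₂ ‖⟨ξ⟩h‖₂`
(Tonelli with `ξ₁` inside, Cauchy–Schwarz in `ξ₁`, translation invariance).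
[cite: Tao2016AveragedNS, §1.1 (1.15) p. 7 (local well-posedness of `H¹⁰_df` mild solutions: the bilinear Duhamel operator, uniqueness) (source of the NOTION / ARGUMENT this module implements; this declaration is the cell’s own lemma or plumbing, NOT a printed statement)] -/
theorem lintegral_enorm_Λ_le_one {f g h : EuclideanSpace ℝ (Fin 3) → EuclideanSpace ℂ (Fin 3)}
    (hf : AEStronglyMeasurable f volume) (hg : AEStronglyMeasurable g volume)
    (hh : AEStronglyMeasurable h volume) :
    ∫⁻ p : EuclideanSpace ℝ (Fin 3) × EuclideanSpace ℝ (Fin 3),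
        ‖Λ p.1 p.2 (f p.1) (g p.2) (h (-p.1 - p.2))‖ₑ ≤
      3 * ((∫⁻ ξ, ENNReal.ofReal (√(1 + ‖ξ‖ ^ 2)) * ‖g ξ‖ₑ) *
        ((∫⁻ ξ, ‖f ξ‖ₑ ^ 2) ^ (1 / 2 : ℝ) *
          (∫⁻ ξ, (ENNReal.ofReal (√(1 + ‖ξ‖ ^ 2)) * ‖h ξ‖ₑ) ^ 2) ^ (1 / 2 : ℝ))) := by
  rw [Measure.volume_eq_prod]
  set μ : Measure (EuclideanSpace ℝ (Fin 3)) := volume with hμ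
  -- the weighted densities
  set G : EuclideanSpace ℝ (Fin 3) → ℝ≥0∞ :=
    fun ξ => ENNReal.ofReal (√(1 + ‖ξ‖ ^ 2)) * ‖g ξ‖ₑ with hGdef
  set H : EuclideanSpace ℝ (Fin 3) → ℝ≥0∞ :=
    fun ξ => ENNReal.ofReal (√(1 + ‖ξ‖ ^ 2)) * ‖h ξ‖ₑ with hHdef
  have hFm : AEMeasurable (fun ξ => ‖f ξ‖ₑ) μ := hf.enorm
  have hGm : AEMeasurable G μ := measurable_wOne.aemeasurable.mul hg.enorm
  have hHm : AEMeasurable H μ := measurable_wOne.aemeasurable.mul hh.enorm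
  -- measurability of the pieces on the product space
  have hf1 : AEMeasurable (fun p : EuclideanSpace ℝ (Fin 3) × EuclideanSpace ℝ (Fin 3) => ‖f p.1‖ₑ)
      (μ.prod μ) :=
    (hf.comp_quasiMeasurePreserving Measure.quasiMeasurePreserving_fst).enorm
  have hG2 : AEMeasurable (fun p : EuclideanSpace ℝ (Fin 3) × EuclideanSpace ℝ (Fin 3) => G p.2)
      (μ.prod μ) :=
    hGm.comp_quasiMeasurePreserving Measure.quasiMeasurePreserving_snd
  have hH3 : AEMeasurable (fun p : EuclideanSpace ℝ (Fin 3) × EuclideanSpace ℝ (Fin 3) =>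
      H (-p.1 - p.2)) (μ.prod μ) :=
    hHm.comp_quasiMeasurePreserving quasiMeasurePreserving_neg_fst_sub_snd
  -- the Tonelli majorant
  set T : EuclideanSpace ℝ (Fin 3) × EuclideanSpace ℝ (Fin 3) → ℝ≥0∞ :=
    fun p => 3 * (G p.2 * (‖f p.1‖ₑ * H (-p.1 - p.2))) with hT
  have hTm : AEMeasurable T (μ.prod μ) := (hG2.mul (hf1.mul hH3)).const_mul _
  set WF : ℝ≥0∞ := (∫⁻ ξ, ‖f ξ‖ₑ ^ 2 ∂μ) ^ (1 / 2 : ℝ) with hWF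
  set WH : ℝ≥0∞ := (∫⁻ ξ, H ξ ^ 2 ∂μ) ^ (1 / 2 : ℝ) with hWH
  have h3 : (3 : ℝ≥0∞) ≠ ∞ := ENNReal.ofNat_ne_top
  have hGfin : ∀ ξ, G ξ ≠ ∞ := fun ξ => ENNReal.mul_ne_top ENNReal.ofReal_ne_top enorm_ne_top
  -- integrate `ξ₁` inside
  have h1 : ∫⁻ p, T p ∂(μ.prod μ) ≤ 3 * ((∫⁻ ξ, G ξ ∂μ) * (WF * WH)) := by
    rw [lintegral_prod_symm _ hTm]
    calc ∫⁻ ξ₂, ∫⁻ ξ₁, T (ξ₁, ξ₂) ∂μ ∂μ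
        = ∫⁻ ξ₂, 3 * (G ξ₂ * ∫⁻ ξ₁, ‖f ξ₁‖ₑ * H (-ξ₂ - ξ₁) ∂μ) ∂μ := by
          refine lintegral_congr fun ξ₂ => ?_
          simp only [hT]
          rw [lintegral_const_mul' _ _ h3, lintegral_const_mul' _ _ (hGfin ξ₂)]
          congr 2
          refine lintegral_congr fun ξ₁ => ?_
          rw [show -ξ₁ - ξ₂ = -ξ₂ - ξ₁ by abel]
      _ ≤ ∫⁻ ξ₂, 3 * (G ξ₂ * (WF * WH)) ∂μ := by
          refine lintegral_mono fun ξ₂ => mul_le_mul' le_rfl (mul_le_mul' le_rfl ?_)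
          exact lintegral_mul_comp_sub_le hFm hHm (-ξ₂)
      _ = 3 * ((∫⁻ ξ, G ξ ∂μ) * (WF * WH)) := by
          rw [lintegral_const_mul' _ _ h3, lintegral_mul_const'' _ hGm]
  calc ∫⁻ p, ‖Λ p.1 p.2 (f p.1) (g p.2) (h (-p.1 - p.2))‖ₑ ∂(μ.prod μ)
      ≤ ∫⁻ p, T p ∂(μ.prod μ) := by
        refine lintegral_mono fun p => ?_
        rw [hT]
        convert enorm_Λ_le_one p.1 p.2 (f p.1) (g p.2) (h (-p.1 - p.2)) using 1
        simp only [hGdef, hHdef]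
        ring
    _ ≤ 3 * ((∫⁻ ξ, G ξ ∂μ) * (WF * WH)) := h1

/-! ### `H¹⁰(ℝ³) ⊂ 𝓕L¹` with one extra weight: the constant `C₉ = (∫ (1+|ξ|²)^{-9})^{1/2}` -/

/-- `∫_{ℝ³} (1+|ξ|²)^{-9} dξ < ∞` (Mathlib's `integrable_rpow_neg_one_add_norm_sq`, `18 > 3`).
[cite: Tao2016AveragedNS, §1.1 (1.15) p. 7 (local well-posedness of `H¹⁰_df` mild solutions: the bilinear Duhamel operator, uniqueness) (source of the NOTION / ARGUMENT this module implements; this declaration is the cell’s own lemma or plumbing, NOT a printed statement)] -/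
theorem lintegral_sobolevWeight_neg_nine_lt_top :
    ∫⁻ ξ : EuclideanSpace ℝ (Fin 3), ENNReal.ofReal ((1 + ‖ξ‖ ^ 2) ^ (-9 : ℝ)) < ∞ := by
  have h := integrable_rpow_neg_one_add_norm_sq (E := EuclideanSpace ℝ (Fin 3))
    (μ := (volume : Measure (EuclideanSpace ℝ (Fin 3)))) (r := 18)
    (by rw [finrank_euclideanSpace, Fintype.card_fin]; norm_num)
  have h' : Integrable (fun ξ : EuclideanSpace ℝ (Fin 3) => (1 + ‖ξ‖ ^ 2) ^ (-9 : ℝ)) := by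
    refine h.congr (Eventually.of_forall fun ξ => ?_)
    norm_num
  exact h'.lintegral_lt_top

/-- **`‖⟨ξ⟩ f‖₁ ≤ C₉ (∫ (1+|ξ|²)^{10} |f|²)^{1/2}`** (Cauchy–Schwarz with `⟨ξ⟩ = ⟨ξ⟩^{-9} · ⟨ξ⟩^{10}`);
for `f = ĝ` the second factor is `‖g‖_{H¹⁰}`.
[cite: Tao2016AveragedNS, §1.1 (1.15) p. 7 (local well-posedness of `H¹⁰_df` mild solutions: the bilinear Duhamel operator, uniqueness) (source of the NOTION / ARGUMENT this module implements; this declaration is the cell’s own lemma or plumbing, NOT a printed statement)] -/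
theorem lintegral_wOne_enorm_le {f : EuclideanSpace ℝ (Fin 3) → EuclideanSpace ℂ (Fin 3)}
    (hf : AEStronglyMeasurable f volume) :
    ∫⁻ ξ, ENNReal.ofReal (√(1 + ‖ξ‖ ^ 2)) * ‖f ξ‖ₑ ≤
      (∫⁻ ξ : EuclideanSpace ℝ (Fin 3), ENNReal.ofReal ((1 + ‖ξ‖ ^ 2) ^ (-9 : ℝ))) ^ (1 / 2 : ℝ) *
        sobolevWeightIntegral 10 f ^ (1 / 2 : ℝ) := by
  have hw : ∀ s : ℝ, Measurable fun ξ : EuclideanSpace ℝ (Fin 3) =>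
      ENNReal.ofReal ((1 + ‖ξ‖ ^ 2) ^ s) := measurable_sobolevWeight
  have hsq : ∀ (s : ℝ) (ξ : EuclideanSpace ℝ (Fin 3)),
      ENNReal.ofReal ((1 + ‖ξ‖ ^ 2) ^ s) ^ (2 : ℝ) = ENNReal.ofReal ((1 + ‖ξ‖ ^ 2) ^ (2 * s)) := by
    intro s ξ
    have h0 : 0 < 1 + ‖ξ‖ ^ 2 := by positivity
    rw [ENNReal.ofReal_rpow_of_nonneg (Real.rpow_nonneg h0.le _) (by norm_num), ← Real.rpow_mul h0.le,
      mul_comm]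
  have hsplit : ∀ ξ : EuclideanSpace ℝ (Fin 3), ENNReal.ofReal (√(1 + ‖ξ‖ ^ 2)) =
      ENNReal.ofReal ((1 + ‖ξ‖ ^ 2) ^ (-(9 / 2) : ℝ)) * ENNReal.ofReal ((1 + ‖ξ‖ ^ 2) ^ (5 : ℝ)) := by
    intro ξ
    have h0 : 0 < 1 + ‖ξ‖ ^ 2 := by positivity
    rw [← ENNReal.ofReal_mul (Real.rpow_nonneg h0.le _), ← Real.rpow_add h0, Real.sqrt_eq_rpow]
    norm_num
  unfold sobolevWeightIntegral
  calc ∫⁻ ξ, ENNReal.ofReal (√(1 + ‖ξ‖ ^ 2)) * ‖f ξ‖ₑ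
      = ∫⁻ ξ, ENNReal.ofReal ((1 + ‖ξ‖ ^ 2) ^ (-(9 / 2) : ℝ)) *
          (ENNReal.ofReal ((1 + ‖ξ‖ ^ 2) ^ (5 : ℝ)) * ‖f ξ‖ₑ) := by
        refine lintegral_congr fun ξ => ?_
        rw [← mul_assoc, ← hsplit]
    _ ≤ (∫⁻ ξ, ENNReal.ofReal ((1 + ‖ξ‖ ^ 2) ^ (-(9 / 2) : ℝ)) ^ (2 : ℝ)) ^ (1 / (2 : ℝ)) *
          (∫⁻ ξ, (ENNReal.ofReal ((1 + ‖ξ‖ ^ 2) ^ (5 : ℝ)) * ‖f ξ‖ₑ) ^ (2 : ℝ)) ^ (1 / (2 : ℝ)) :=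
        ENNReal.lintegral_mul_le_Lp_mul_Lq volume Real.HolderConjugate.two_two (hw _).aemeasurable
          ((hw _).aemeasurable.mul hf.enorm)
    _ = _ := by
        congr 2
        · refine lintegral_congr fun ξ => ?_
          rw [hsq]
          norm_num
        · refine lintegral_congr fun ξ => ?_
          rw [ENNReal.mul_rpow_of_nonneg _ _ (by norm_num : (0 : ℝ) ≤ 2), hsq, ENNReal.rpow_two]
          norm_num

/-! ### Specialisation to Fourier transforms: `L² × H¹⁰ × H¹` -/

/-- `‖⟨ξ⟩ ĝ‖²_{L²} = ∫ (1+|ξ|²)¹ |ĝ|²`: the weighted `L²` norm is the `H¹` integral.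
[cite: Tao2016AveragedNS, §1.1 (1.15) p. 7 (local well-posedness of `H¹⁰_df` mild solutions: the bilinear Duhamel operator, uniqueness) (source of the NOTION / ARGUMENT this module implements; this declaration is the cell’s own lemma or plumbing, NOT a printed statement)] -/
theorem lintegral_wOne_mul_sq (g : EuclideanSpace ℝ (Fin 3) → EuclideanSpace ℂ (Fin 3)) :
    ∫⁻ ξ, (ENNReal.ofReal (√(1 + ‖ξ‖ ^ 2)) * ‖g ξ‖ₑ) ^ 2 = sobolevWeightIntegral 1 g := by
  unfold sobolevWeightIntegral
  refine lintegral_congr fun ξ => ?_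
  rw [mul_pow, wOne_sq]

/-- **Absolute convergence of (1.3) on `L² × H¹⁰ × H¹`**: for `f, g, h ∈ L²`,
`∫∫ |Λ(f̂(ξ₁), ĝ(ξ₂), ĥ(-ξ₁-ξ₂))| ≤ 3 C₉ ‖f‖_{L²} ‖g‖_{H¹⁰} ‖h‖_{H¹}`.
[cite: Tao2016AveragedNS, §1.1 (1.15) p. 7 (local well-posedness of `H¹⁰_df` mild solutions: the bilinear Duhamel operator, uniqueness) (source of the NOTION / ARGUMENT this module implements; this declaration is the cell’s own lemma or plumbing, NOT a printed statement)] -/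
theorem lintegral_enorm_Λ_fourierFn_le_one (f g h : L2C) :
    ∫⁻ p : EuclideanSpace ℝ (Fin 3) × EuclideanSpace ℝ (Fin 3),
        ‖Λ p.1 p.2 (fourierFn f p.1) (fourierFn g p.2) (fourierFn h (-p.1 - p.2))‖ₑ ≤
      3 * (∫⁻ ξ : EuclideanSpace ℝ (Fin 3), ENNReal.ofReal ((1 + ‖ξ‖ ^ 2) ^ (-9 : ℝ))) ^ (1 / 2 : ℝ) *
        ‖f‖ₑ * eFourierSobolevNorm 10 g * eFourierSobolevNorm 1 h := by
  refine (lintegral_enorm_Λ_le_one (aestronglyMeasurable_fourierFn f)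
    (aestronglyMeasurable_fourierFn g) (aestronglyMeasurable_fourierFn h)).trans ?_
  rw [lintegral_wOne_mul_sq, lintegral_enorm_sq_fourierFn_rpow_eq, ← eFourierSobolevNorm_eq]
  have hg := lintegral_wOne_enorm_le (aestronglyMeasurable_fourierFn g)
  rw [← eFourierSobolevNorm_eq] at hg
  calc 3 * ((∫⁻ ξ, ENNReal.ofReal (√(1 + ‖ξ‖ ^ 2)) * ‖fourierFn g ξ‖ₑ) * (‖f‖ₑ * eFourierSobolevNorm 1 h))
      ≤ 3 * (((∫⁻ ξ : EuclideanSpace ℝ (Fin 3), ENNReal.ofReal ((1 + ‖ξ‖ ^ 2) ^ (-9 : ℝ))) ^ (1 / 2 : ℝ) *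
          eFourierSobolevNorm 10 g) * (‖f‖ₑ * eFourierSobolevNorm 1 h)) := by gcongr
    _ = _ := by ring

/-- **The Euler form is bounded on `L² × H¹⁰ × H¹`**:
`|⟨B(f,g), h⟩| ≤ 3π C₉ ‖f‖_{L²} ‖g‖_{H¹⁰} ‖h‖_{H¹}` for all `f, g, h ∈ L²(ℝ³; ℂ³)`.
[cite: Tao2016AveragedNS, §1.1 (1.15) p. 7 (local well-posedness of `H¹⁰_df` mild solutions: the bilinear Duhamel operator, uniqueness) (source of the NOTION / ARGUMENT this module implements; this declaration is the cell’s own lemma or plumbing, NOT a printed statement)] -/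
theorem enorm_eulerForm_le_one (f g h : L2C) :
    ‖eulerForm f g h‖ₑ ≤ ENNReal.ofReal Real.pi *
      (3 * (∫⁻ ξ : EuclideanSpace ℝ (Fin 3), ENNReal.ofReal ((1 + ‖ξ‖ ^ 2) ^ (-9 : ℝ))) ^ (1 / 2 : ℝ) *
        ‖f‖ₑ * eFourierSobolevNorm 10 g * eFourierSobolevNorm 1 h) := by
  have hπ : ‖-((Real.pi : ℂ) * I)‖ₑ = ENNReal.ofReal Real.pi := by
    rw [enorm_neg, enorm_mul, ← ofReal_norm, ← ofReal_norm, Complex.norm_I, ENNReal.ofReal_one,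
      mul_one, Complex.norm_real, Real.norm_of_nonneg Real.pi_pos.le]
  unfold eulerForm
  rw [enorm_mul, hπ]
  exact mul_le_mul' le_rfl ((enorm_integral_le_lintegral_enorm _).trans
    (lintegral_enorm_Λ_fourierFn_le_one f g h))

/-- The symmetric bound: `|⟨B(g,f), h⟩| ≤ 3π C₉ ‖f‖_{L²} ‖g‖_{H¹⁰} ‖h‖_{H¹}` (`B` is symmetric).
[cite: Tao2016AveragedNS, §1.1 (1.15) p. 7 (local well-posedness of `H¹⁰_df` mild solutions: the bilinear Duhamel operator, uniqueness) (source of the NOTION / ARGUMENT this module implements; this declaration is the cell’s own lemma or plumbing, NOT a printed statement)] -/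
theorem enorm_eulerForm_le_one' (f g h : L2C) :
    ‖eulerForm g f h‖ₑ ≤ ENNReal.ofReal Real.pi *
      (3 * (∫⁻ ξ : EuclideanSpace ℝ (Fin 3), ENNReal.ofReal ((1 + ‖ξ‖ ^ 2) ^ (-9 : ℝ))) ^ (1 / 2 : ℝ) *
        ‖f‖ₑ * eFourierSobolevNorm 10 g * eFourierSobolevNorm 1 h) := by
  rw [eulerForm_symm]
  exact enorm_eulerForm_le_one f g h

/-! ### Through the slots of (1.12) and the average (1.13) -/

/-- **Pointwise bound for the integrand of (1.13) on `L² × H¹⁰ × H¹`** (both orders of the two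
bilinear slots): if `λ_{i,θ} ≤ C` then, with `M = max(1, C)`,
`|⟨B(A₁f, A₂g), A₃h⟩|, |⟨B(A₁g, A₂f), A₃h⟩| ≤ 3π C₉ M¹⁰ M ‖f‖_{L²} ‖g‖_{H¹⁰} ‖h‖_{H¹} ‖m₁‖₀‖m₂‖₀‖m₃‖₀`.
[cite: Tao2016AveragedNS, §1.1 (1.15) p. 7 (local well-posedness of `H¹⁰_df` mild solutions: the bilinear Duhamel operator, uniqueness) (source of the NOTION / ARGUMENT this module implements; this declaration is the cell’s own lemma or plumbing, NOT a printed statement)] -/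
theorem enorm_eulerForm_slot_le_one (𝒜 : AveragingDatum) {C : ℝ} (hC : ∀ i θ, 𝒜.lam i θ ≤ C)
    (f g h : L2C) (θ : 𝒜.Ω) :
    ‖eulerForm (𝒜.slot 0 θ f) (𝒜.slot 1 θ g) (𝒜.slot 2 θ h)‖ₑ ≤
        ENNReal.ofReal Real.pi * (3 * (∫⁻ ξ : EuclideanSpace ℝ (Fin 3),
            ENNReal.ofReal ((1 + ‖ξ‖ ^ 2) ^ (-9 : ℝ))) ^ (1 / 2 : ℝ)) *
          ENNReal.ofReal (max 1 C ^ (10 : ℝ)) * ENNReal.ofReal (max 1 C ^ (1 : ℝ)) *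
          (‖f‖ₑ * eFourierSobolevNorm 10 g * eFourierSobolevNorm 1 h) *
          (symbolSeminorm 0 (𝒜.m 0 θ) * symbolSeminorm 0 (𝒜.m 1 θ) * symbolSeminorm 0 (𝒜.m 2 θ)) ∧
      ‖eulerForm (𝒜.slot 0 θ g) (𝒜.slot 1 θ f) (𝒜.slot 2 θ h)‖ₑ ≤
        ENNReal.ofReal Real.pi * (3 * (∫⁻ ξ : EuclideanSpace ℝ (Fin 3),
            ENNReal.ofReal ((1 + ‖ξ‖ ^ 2) ^ (-9 : ℝ))) ^ (1 / 2 : ℝ)) *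
          ENNReal.ofReal (max 1 C ^ (10 : ℝ)) * ENNReal.ofReal (max 1 C ^ (1 : ℝ)) *
          (‖f‖ₑ * eFourierSobolevNorm 10 g * eFourierSobolevNorm 1 h) *
          (symbolSeminorm 0 (𝒜.m 0 θ) * symbolSeminorm 0 (𝒜.m 1 θ) * symbolSeminorm 0 (𝒜.m 2 θ)) := by
  set 𝒟 := 𝒜.toComplex with h𝒟
  have hK : ∀ i, ENNReal.ofReal (max 1 (𝒜.lam i θ) ^ (10 : ℝ)) ≤ ENNReal.ofReal (max 1 C ^ (10 : ℝ)) :=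
    fun i => ENNReal.ofReal_le_ofReal
      (Real.rpow_le_rpow (by positivity) (max_le_max le_rfl (hC i θ)) (by norm_num))
  have hK1 : ENNReal.ofReal (max 1 (𝒜.lam 2 θ) ^ (1 : ℝ)) ≤ ENNReal.ofReal (max 1 C ^ (1 : ℝ)) :=
    ENNReal.ofReal_le_ofReal
      (Real.rpow_le_rpow (by positivity) (max_le_max le_rfl (hC 2 θ)) (by norm_num))
  have hL2 : ∀ (i : Fin 3) (x : L2C), ‖𝒜.slot i θ x‖ₑ ≤ symbolSeminorm 0 (𝒜.m i θ) * ‖x‖ₑ :=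
    fun i x => 𝒟.enorm_slot_le i θ x
  have h10 : ∀ (i : Fin 3) (x : L2C), eFourierSobolevNorm 10 (𝒜.slot i θ x) ≤
      symbolSeminorm 0 (𝒜.m i θ) * (ENNReal.ofReal (max 1 C ^ (10 : ℝ)) * eFourierSobolevNorm 10 x) :=
    fun i x => by
      refine (𝒟.eFourierSobolevNorm_slot_le i θ (by norm_num : (0 : ℝ) ≤ 10) x).trans ?_
      rw [mul_assoc]
      exact mul_le_mul' le_rfl (mul_le_mul' (hK i) le_rfl)
  have h1 : eFourierSobolevNorm 1 (𝒜.slot 2 θ h) ≤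
      symbolSeminorm 0 (𝒜.m 2 θ) * (ENNReal.ofReal (max 1 C ^ (1 : ℝ)) * eFourierSobolevNorm 1 h) := by
    refine (𝒟.eFourierSobolevNorm_slot_le 2 θ (by norm_num : (0 : ℝ) ≤ 1) h).trans ?_
    rw [mul_assoc]
    exact mul_le_mul' le_rfl (mul_le_mul' hK1 le_rfl)
  constructor
  · have ha := hL2 0 f
    have hb := h10 1 g
    calc ‖eulerForm (𝒜.slot 0 θ f) (𝒜.slot 1 θ g) (𝒜.slot 2 θ h)‖ₑ
        ≤ ENNReal.ofReal Real.pi * (3 * (∫⁻ ξ : EuclideanSpace ℝ (Fin 3),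
            ENNReal.ofReal ((1 + ‖ξ‖ ^ 2) ^ (-9 : ℝ))) ^ (1 / 2 : ℝ) *
            ‖𝒜.slot 0 θ f‖ₑ * eFourierSobolevNorm 10 (𝒜.slot 1 θ g) *
            eFourierSobolevNorm 1 (𝒜.slot 2 θ h)) := enorm_eulerForm_le_one _ _ _
      _ ≤ ENNReal.ofReal Real.pi * (3 * (∫⁻ ξ : EuclideanSpace ℝ (Fin 3),
            ENNReal.ofReal ((1 + ‖ξ‖ ^ 2) ^ (-9 : ℝ))) ^ (1 / 2 : ℝ) *
            (symbolSeminorm 0 (𝒜.m 0 θ) * ‖f‖ₑ) *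
            (symbolSeminorm 0 (𝒜.m 1 θ) * (ENNReal.ofReal (max 1 C ^ (10 : ℝ)) * eFourierSobolevNorm 10 g)) *
            (symbolSeminorm 0 (𝒜.m 2 θ) * (ENNReal.ofReal (max 1 C ^ (1 : ℝ)) * eFourierSobolevNorm 1 h))) := by
          gcongr
      _ = _ := by ring
  · have ha := hL2 1 f
    have hb := h10 0 g
    calc ‖eulerForm (𝒜.slot 0 θ g) (𝒜.slot 1 θ f) (𝒜.slot 2 θ h)‖ₑ
        ≤ ENNReal.ofReal Real.pi * (3 * (∫⁻ ξ : EuclideanSpace ℝ (Fin 3),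
            ENNReal.ofReal ((1 + ‖ξ‖ ^ 2) ^ (-9 : ℝ))) ^ (1 / 2 : ℝ) *
            ‖𝒜.slot 1 θ f‖ₑ * eFourierSobolevNorm 10 (𝒜.slot 0 θ g) *
            eFourierSobolevNorm 1 (𝒜.slot 2 θ h)) := enorm_eulerForm_le_one' _ _ _
      _ ≤ ENNReal.ofReal Real.pi * (3 * (∫⁻ ξ : EuclideanSpace ℝ (Fin 3),
            ENNReal.ofReal ((1 + ‖ξ‖ ^ 2) ^ (-9 : ℝ))) ^ (1 / 2 : ℝ) *
            (symbolSeminorm 0 (𝒜.m 1 θ) * ‖f‖ₑ) *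
            (symbolSeminorm 0 (𝒜.m 0 θ) * (ENNReal.ofReal (max 1 C ^ (10 : ℝ)) * eFourierSobolevNorm 10 g)) *
            (symbolSeminorm 0 (𝒜.m 2 θ) * (ENNReal.ofReal (max 1 C ^ (1 : ℝ)) * eFourierSobolevNorm 1 h))) := by
          gcongr
      _ = _ := by ring

/-- **The `L² × H¹⁰ × H¹` bound for the averaged form** (both orders of the bilinear slots): for
every averaging datum `𝒜` there is `K < ∞` with
`|⟨B̃(f,g), h⟩| ≤ K ‖f‖_{L²} ‖g‖_{H¹⁰} ‖h‖_{H¹}` and `|⟨B̃(g,f), h⟩| ≤ K ‖f‖_{L²} ‖g‖_{H¹⁰} ‖h‖_{H¹}`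
for all `f ∈ L²`, `g` of finite `H¹⁰` norm and `h` of finite `H¹` norm (pointwise slot bound, then
the moment bound `𝔼 ‖m₁‖₀‖m₂‖₀‖m₃‖₀ < ∞` of (1.13)). This is the estimate that closes the
`L²`-Grönwall argument for the difference of two mild solutions.
[cite: Tao2016AveragedNS, §1.1 (1.15) p. 7 (local well-posedness of `H¹⁰_df` mild solutions: the bilinear Duhamel operator, uniqueness) (source of the NOTION / ARGUMENT this module implements; this declaration is the cell’s own lemma or plumbing, NOT a printed statement)] -/
theorem exists_enorm_form_le_one (𝒜 : AveragingDatum) :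
    ∃ K : ℝ≥0, ∀ f g h : L2C, eFourierSobolevNorm 10 g < ⊤ → eFourierSobolevNorm 1 h < ⊤ →
      ‖𝒜.form f g h‖ₑ ≤ (K : ℝ≥0∞) * ‖f‖ₑ * eFourierSobolevNorm 10 g * eFourierSobolevNorm 1 h ∧
      ‖𝒜.form g f h‖ₑ ≤ (K : ℝ≥0∞) * ‖f‖ₑ * eFourierSobolevNorm 10 g * eFourierSobolevNorm 1 h := by
  obtain ⟨C, hC⟩ := 𝒜.lam_bdd
  have hC' : ∀ i θ, 𝒜.lam i θ ≤ C := fun i θ => (hC i θ).2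
  set Kpt : ℝ≥0∞ := ENNReal.ofReal Real.pi * (3 * (∫⁻ ξ : EuclideanSpace ℝ (Fin 3),
      ENNReal.ofReal ((1 + ‖ξ‖ ^ 2) ^ (-9 : ℝ))) ^ (1 / 2 : ℝ)) *
    ENNReal.ofReal (max 1 C ^ (10 : ℝ)) * ENNReal.ofReal (max 1 C ^ (1 : ℝ)) with hKpt
  set S : ℝ≥0∞ := ∫⁻ θ, symbolSeminorm 0 (𝒜.m 0 θ) * symbolSeminorm 0 (𝒜.m 1 θ) *
    symbolSeminorm 0 (𝒜.m 2 θ) ∂𝒜.μ with hS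
  have hKpt_top : Kpt < ∞ :=
    ENNReal.mul_lt_top (ENNReal.mul_lt_top (ENNReal.mul_lt_top ENNReal.ofReal_lt_top
      (ENNReal.mul_lt_top ENNReal.ofNat_lt_top (ENNReal.rpow_lt_top_of_nonneg (by norm_num)
        lintegral_sobolevWeight_neg_nine_lt_top.ne))) ENNReal.ofReal_lt_top) ENNReal.ofReal_lt_top
  have hS_top : S < ∞ := 𝒜.moment 0 0 0
  have hKS : Kpt * S ≠ ∞ := (ENNReal.mul_lt_top hKpt_top hS_top).ne
  refine ⟨(Kpt * S).toNNReal, fun f g h hg hh => ?_⟩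
  rw [ENNReal.coe_toNNReal hKS]
  set X : ℝ≥0∞ := ‖f‖ₑ * eFourierSobolevNorm 10 g * eFourierSobolevNorm 1 h with hX
  have hX_top : X < ∞ := ENNReal.mul_lt_top (ENNReal.mul_lt_top enorm_lt_top hg) hh
  have hKX : Kpt * X ≠ ∞ := (ENNReal.mul_lt_top hKpt_top hX_top).ne
  have hfin : Kpt * S * ‖f‖ₑ * eFourierSobolevNorm 10 g * eFourierSobolevNorm 1 h = Kpt * X * S := by
    rw [hX]
    ring
  rw [hfin]
  constructor
  · calc ‖𝒜.form f g h‖ₑ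
        ≤ ∫⁻ θ, ‖eulerForm (𝒜.slot 0 θ f) (𝒜.slot 1 θ g) (𝒜.slot 2 θ h)‖ₑ ∂𝒜.μ :=
          enorm_integral_le_lintegral_enorm _
      _ ≤ ∫⁻ θ, Kpt * X * (symbolSeminorm 0 (𝒜.m 0 θ) * symbolSeminorm 0 (𝒜.m 1 θ) *
            symbolSeminorm 0 (𝒜.m 2 θ)) ∂𝒜.μ :=
          lintegral_mono fun θ => (enorm_eulerForm_slot_le_one 𝒜 hC' f g h θ).1
      _ = Kpt * X * S := lintegral_const_mul' _ _ hKX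
  · calc ‖𝒜.form g f h‖ₑ
        ≤ ∫⁻ θ, ‖eulerForm (𝒜.slot 0 θ g) (𝒜.slot 1 θ f) (𝒜.slot 2 θ h)‖ₑ ∂𝒜.μ :=
          enorm_integral_le_lintegral_enorm _
      _ ≤ ∫⁻ θ, Kpt * X * (symbolSeminorm 0 (𝒜.m 0 θ) * symbolSeminorm 0 (𝒜.m 1 θ) *
            symbolSeminorm 0 (𝒜.m 2 θ)) ∂𝒜.μ :=
          lintegral_mono fun θ => (enorm_eulerForm_slot_le_one 𝒜 hC' f g h θ).2
      _ = Kpt * X * S := lintegral_const_mul' _ _ hKX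

end Literature.Analysis.PerpetualPump.PerpetualPumpThesis.U

namespace Literature.Analysis.PerpetualPump.PerpetualPumpThesis

open Literature.Analysis.FluidPDE Literature.Analysis.FluidPDE.Tao2016
open Literature.Analysis.FunctionSpaces (eFourierSobolevNorm)

end Literature.Analysis.PerpetualPump.PerpetualPumpThesis

end Part8

/-!
## Part 9 — port of `Summits/NavierStokesRegularity/NavierStokesRegularity/Theorems/PerpetualPumpThesisBilinearOperator.lean` (1 declarations kept)

# Stub B (`bilinearOperator`) for `PerpetualPump.Thesis`: Tao's averaged operator `B̃` as an
# honest `H⁹`-valued bilinear operator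

Final file of the stub `bilinearOperator` of line `SketchIdeator2` (crux
stmt-NavierStokesRegularity-1832), proving the registered statement `stub_bilinearOperator`:
for **every** averaging datum `𝒜` (T. Tao, *Finite time blowup for an averaged three-dimensional
Navier–Stokes equation*, J. Amer. Math. Soc. 29 (2016), arXiv:1402.0290v3, (1.12)–(1.13); no
symmetry, no cancellation) there are a map `Bop : L² × L² → L²` and a constant `K ≥ 0` such that
for `u, v ∈ H¹⁰_df` the field `Bop u v` is real, divergence free, obeys the tame bound
`‖Bop u v‖_{H⁹} ≤ K ‖u‖_{H¹⁰} ‖v‖_{H¹⁰}` (Tao, (1.14): `B̃` "obeys the same Sobolev bounds as `B`",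
one derivative lost) and represents the duality form, `⟨Bop u v, w⟩ = ⟨B̃(u,v), w⟩ = 𝒜.form u v w`
for all `w ∈ H¹⁰_df`; and `Bop` is bilinear over `ℝ` on `H¹⁰_df`.

Construction (parts I–III are the support files `…BilinearOperatorWeighted/Space/Form.lean`):
for `u, v` of finite `H¹⁰` norm, `w ↦ 𝒜.form u v w` is a bounded `ℂ`-linear functional on the
Hilbert space `L²_σ` of divergence-free fields (part III: trilinearity and the tame
`H¹⁰ × H¹⁰ × H⁻⁹` bound; part II: `L²_σ` is closed); its Riesz vector `z ∈ L²_σ`,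
`⟪z, w⟫ = 𝒜.form u v w`, is unique, hence additive and real-homogeneous in `(u, v)`, lies in `H⁹`
with `‖z‖_{H⁹} ≤ K ‖u‖_{H¹⁰}‖v‖_{H¹⁰}` by the `H⁹` bootstrap of part II, and `Bop u v := Re z`
(`reL2 z`) is real, divergence free, has no larger `H⁹` norm, and pairs correctly with *real*
divergence-free `w` because the form is real on real fields (`⟨Re z, w⟩ = ½(⟪z,w⟫ + conj ⟪z,w⟫)`).

## References

* T. Tao, J. Amer. Math. Soc. 29 (2016), 601–674, arXiv:1402.0290v3, §1.1 (1.12)–(1.15).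

Not carried from this source module (not needed by the declarations re-homed here; their consumers are Summits-side): `eq_of_forall_inner_eq`, `exists_riesz`, `inner_conjL2_left_eq`, `pairing_reL2_eq`, `eFourierSobolevNorm_reL2_riesz_le`, `stub_bilinearOperator`.
-/

section Part9

open _root_.MeasureTheory _root_.Set _root_.Filter _root_.Topology FourierTransform
open scoped _root_.ENNReal _root_.NNReal ComplexConjugate _root_.InnerProductSpace SchwartzMap

namespace Literature.Analysis.PerpetualPump.PerpetualPumpThesis.B

open Literature.Analysis.FluidPDE Literature.Analysis.FluidPDE.Tao2016
open Literature.Analysis.FunctionSpaces (eFourierSobolevNorm)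

/-! ### Uniqueness of Riesz vectors in `L²_σ` -/

/-- The real-valued form of the tame bound: `|⟨B̃(u,v), w⟩| ≤ (K ‖u‖_{H¹⁰} ‖v‖_{H¹⁰}) ‖w‖_{L²}`
for `u, v` of finite `H¹⁰` norm (`‖w‖_{H⁻⁹} ≤ ‖w‖_{L²}`).
[cite: Tao2016AveragedNS, §1.1 (1.15) p. 7 (local well-posedness of `H¹⁰_df` mild solutions: the bilinear Duhamel operator, uniqueness) (source of the NOTION / ARGUMENT this module implements; this declaration is the cell’s own lemma or plumbing, NOT a printed statement)] -/
theorem norm_form_le (𝒜 : AveragingDatum) {K9 : ℝ≥0}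
    (hK9 : ∀ u v w : L2C, eFourierSobolevNorm 10 u < ⊤ → eFourierSobolevNorm 10 v < ⊤ →
      ‖𝒜.form u v w‖ₑ ≤ (K9 : ℝ≥0∞) * eFourierSobolevNorm 10 u * eFourierSobolevNorm 10 v *
        eFourierSobolevNorm (-9) w)
    {u v : L2C} (hu : eFourierSobolevNorm 10 u < ∞) (hv : eFourierSobolevNorm 10 v < ∞) (w : L2C) :
    ‖𝒜.form u v w‖ ≤ ((K9 : ℝ≥0∞) * eFourierSobolevNorm 10 u * eFourierSobolevNorm 10 v).toReal * ‖w‖ := by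
  have hfin : (K9 : ℝ≥0∞) * eFourierSobolevNorm 10 u * eFourierSobolevNorm 10 v ≠ ∞ :=
    (ENNReal.mul_lt_top (ENNReal.mul_lt_top ENNReal.coe_lt_top hu) hv).ne
  have h := (hK9 u v w hu hv).trans (mul_le_mul' le_rfl (eFourierSobolevNorm_neg_nine_le_enorm w))
  have h' := ENNReal.toReal_mono (ENNReal.mul_ne_top hfin enorm_ne_top) h
  rwa [toReal_enorm, ENNReal.toReal_mul, toReal_enorm] at h'

end Literature.Analysis.PerpetualPump.PerpetualPumpThesis.B

namespace Literature.Analysis.PerpetualPump.PerpetualPumpThesis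

open Literature.Analysis.FluidPDE Literature.Analysis.FluidPDE.Tao2016
open Literature.Analysis.FunctionSpaces

end Literature.Analysis.PerpetualPump.PerpetualPumpThesis

end Part9

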